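import Mathlib.Analysis.Complex.JensenFormula
import Mathlib.Analysis.Complex.CauchyIntegral
import Mathlib.MeasureTheory.Integral.DominatedConvergence
import Mathlib.MeasureTheory.Function.JacobianOneDim
import Mathlib.Analysis.SpecialFunctions.Trigonometric.ArctanDeriv
import Mathlib.Analysis.SpecialFunctions.Complex.Log
import Mathlib.Analysis.SpecialFunctions.Integrals.Basic
import Mathlib.Analysis.SpecialFunctions.Pow.Real
import Mathlib.Analysis.SpecialFunctions.Log.Basic
import Mathlib.MeasureTheory.Integral.Bochner.Set
import Mathlib.Analysis.SpecialFunctions.ImproperIntegrals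
import Mathlib.Analysis.MeanInequalities
import Mathlib.Analysis.Complex.ExponentialBounds
import Mathlib.MeasureTheory.Group.Integral
import Mathlib.MeasureTheory.Integral.Prod
import Mathlib.MeasureTheory.Integral.Lebesgue.Countable
import Mathlib.Algebra.Order.ToIntervalMod
import Literature.Analysis.Fourier.FractalUncertaintyFourierTools
import Literature.MathematicalPhysics.QuantumFieldTheory.OSTimePaleyWienerTools
import Mathlib.MeasureTheory.Integral.IntervalIntegral.Basic
import Mathlib.Analysis.SpecialFunctions.Log.Deriv
import Mathlib.Analysis.SpecialFunctions.Sqrt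
import Mathlib.MeasureTheory.Integral.MeanInequalities
import Mathlib.Analysis.SpecialFunctions.Integrability.Basic
import HarnessLib

/-!
# Bourgain–Dyatlov 2018, Lemma 3.2: the harmonic-measure bound, via an explicit conformal map

Topic `Literature/Analysis/Fourier`; a proved brick of J. Bourgain, S. Dyatlov, *Spectral gaps without
the pressure condition*, Ann. of Math. 187 (2018) 825–867 (`BourgainDyatlov2018`), towards the named fact
`bourgainDyatlov2018_thm4` (`FractalUncertaintyPrinciple.lean`, Theorem 4, the fractal uncertainty
principle for `δ`-regular sets). BD18 §3.2, Lemma 3.2 ("A bound on functions with compact Fourier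
support", display (3.9)) is the quantitative unique continuation estimate

  `Σ_{I} ‖f‖²_{L²(I)} ≤ (C/r) (Σ_{I} ‖f‖²_{L²(I'')})^κ · ‖e^{2πr|ξ|} f̂(ξ)‖_{L²}^{2(1-κ)}`,
  `0 < κ ≤ e^{-C/r}`, `C = C(c₀)`,

for a non-overlapping family of unit intervals `I` with sub-intervals `I'' ⊂ I` of size `c₀`, and it is
the input of BD18 Lemma 3.4 / Proposition 3.3 (the iterative step). The printed proof rests on the
harmonic measure of the slit strips `Σ = {|Im z| < r} ∖ I₀` (BD18 §2.4, Lemmas 2.12–2.15: Perron's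
method, subordination, three conformal maps). Present-day Mathlib has no harmonic measure; this file
proves Lemma 3.2 by an EXPLICIT substitute for §2.4:

* the sub-domain `Σ̃ = {|Im z| < r} ∖ (-∞, 0]` (in coordinates where `I₀ = [-ℓ, 0]` and the point `t`
  lies to the right of the slit) is the image of the upper half-plane under
  `Z(w) = (r/π) Log (1 - a w²)`, `a = e^{πt/r} - 1`, `Z(i) = t` (`SlitStrip.zmap`), and of the unit disc
  under `Z ∘ cayInv`; the composite `G = F ∘ Z ∘ cayInv` is holomorphic and bounded on the disc with
  explicit a.e. boundary values on the cut `(-∞, 0]` and on the edges `Im z = ±r` (`SlitStrip.zbd`,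
  `SlitStrip.tendsto_zmap_zbd`, using Mathlib's one-sided limits of `Complex.log` at the negative axis);
* Jensen's formula (`AnalyticOnNhd.circleAverage_log_norm`) on the circles `|ω| = ρ ↑ 1` and dominated
  convergence give the sub-mean-value inequality `log ‖F t‖ ≤ ∫ p(u) log ‖F (zbd u)‖ du` against the
  Poisson density `p(u) = π⁻¹(1+u²)⁻¹` of the half-plane at `i` (`SlitStrip.log_norm_le_average_log_boundary`,
  `SlitStrip.log_norm_le_integral_log_boundary`) — this replaces BD18 Lemma 2.12;
* the tangent-line form of Jensen's inequality on the two pieces "slit" / "rest" and the paper's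
  convexity step give `‖F t‖² ≤ (e^{1/e})⁵ A₀^{4k} (2B₀)^{1-k}` with `k` the Poisson mass of the slit
  (`SlitStrip.sq_norm_le_A_B`; BD18 (3.22));
* explicit changes of variables (`MeasureTheory.lintegral_image_eq_lintegral_abs_deriv_mul`) along the
  boundary correspondence `Xc/Xe/Ucut/Vedge` and elementary density estimates
  (`SlitStrip.edge_density_le`, `SlitStrip.cut_density_le`, `SlitStrip.slit_mass_ge`) replace BD18
  Lemmas 2.13–2.15, with Hölder `(4, 4/3)` at the tip of the slit exactly as in BD18 (3.23);
* the resulting pointwise bound `SlitStrip.norm_sq_le_pointwise` (BD18, display before "Integrating in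
  `t ∈ I ∖ I''`") is integrated over the cells and summed with the discrete Hölder inequality and
  Tonelli exactly as printed (`SlitStrip.cell_estimate`, `bourgainDyatlov2018_lemma_3_2`), for
  `f = 𝓕⁻ g` presented through its entire Fourier–Laplace extension
  (`Literature.MathematicalPhysics.QuantumFieldTheory.laplaceExt`) and Plancherel on the lines `Im z = 0, ±r`.

Main result: `Literature.Analysis.Fourier.bourgainDyatlov2018_lemma_3_2` (grid form: cells `[j, j+1]`,
`j ∈ ℤ`, sub-intervals `[b_j, b_j + c₀]`; this is the form consumed by BD18 Lemma 3.4, where the family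
`𝓘` is the unit grid (3.10)). Everything here is proved (no named facts); the helper definitions
(`cayBd`, `cayInv`, `zmap`, `zbd`, `Xc`, `Xe`, `Ucut`, `Vedge`, `pfun`, `XcD`, `UD`, `VD`, `Wfun`,
`Sfun`) are explicit formulas living in the sub-namespace `Literature.Analysis.Fourier.SlitStrip`.

Deliberately NOT here: BD18 Lemma 3.1 (the adapted multiplier / Beurling–Malliavin), Lemma 3.4 and
Proposition 3.3, the iteration §3.4, and general non-overlapping families `𝓘` (only the unit grid).

## References

* J. Bourgain, S. Dyatlov, *Spectral gaps without the pressure condition*, Ann. of Math. (2) 187 (2018),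
  no. 3, 825–867, §2.4 and §3.2 (Lemma 3.2). [BourgainDyatlov2018]
-/

noncomputable section

open _root_.MeasureTheory Set Metric Filter _root_.Topology Real _root_.Complex
open scoped ENNReal FourierTransform

namespace Literature.Analysis.Fourier.SlitStrip


/-- Sub-mean-value property of `log ‖G‖` at the centre of a closed disc on a neighbourhood of which
`G` is analytic, `G c ≠ 0` (Jensen's formula: the counting term is nonnegative). [folklore] -/
theorem log_norm_le_circleAverage_of_analyticOnNhd {G : ℂ → ℂ} {c : ℂ} {R : ℝ} (hR : 0 < R)
    (hG : AnalyticOnNhd ℂ G (closedBall c |R|)) (hc : G c ≠ 0) :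
    Real.log ‖G c‖ ≤ circleAverage (fun z => Real.log ‖G z‖) c R := by
  rw [hG.circleAverage_log_norm hR.ne' hc]
  refine le_add_of_nonneg_left (finsum_nonneg fun u => ?_)
  by_cases hu : u ∈ closedBall c |R|
  · refine mul_nonneg (by exact_mod_cast MeromorphicOn.AnalyticOnNhd.divisor_nonneg hG u) ?_
    rcases eq_or_ne u c with rfl | huc
    · simp
    · apply Real.log_nonneg
      rw [mem_closedBall, dist_comm, dist_eq_norm, abs_of_pos hR] at hu
      rw [le_mul_inv_iff₀ (norm_pos_iff.2 (sub_ne_zero.2 huc.symm)), one_mul]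
      exact hu
  · simp [hu]

/-- `log ‖G c‖ ≤ ⨍ log (‖G‖ + ε)` over a circle around `c`, for `G` analytic on a neighbourhood of
the closed disc with `G c ≠ 0` and `ε > 0`. [folklore] -/
theorem log_norm_le_circleAverage_log_add {G : ℂ → ℂ} {c : ℂ} {R ε : ℝ} (hR : 0 < R)
    (hG : AnalyticOnNhd ℂ G (closedBall c |R|)) (hc : G c ≠ 0) (hε : 0 < ε) :
    Real.log ‖G c‖ ≤ circleAverage (fun z => Real.log (‖G z‖ + ε)) c R := by
  have h1 := log_norm_le_circleAverage_of_analyticOnNhd hR hG hc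
  -- modify `log ‖G‖` at the (discrete) zeros of `G`
  set g : ℂ → ℝ := fun z => if G z = 0 then Real.log ε else Real.log ‖G z‖ with hgdef
  have hcod : (fun z => Real.log ‖G z‖) =ᶠ[codiscreteWithin (sphere c |R|)] g := by
    have hmem : G ⁻¹' {0}ᶜ ∈ codiscreteWithin (closedBall c |R|) :=
      hG.preimage_zero_mem_codiscreteWithin hc (by simp)
        ((convex_closedBall c |R|).isConnected ⟨c, by simp⟩)
    have hmem' : G ⁻¹' {0}ᶜ ∈ codiscreteWithin (sphere c |R|) :=
      Filter.codiscreteWithin_mono sphere_subset_closedBall hmem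
    filter_upwards [hmem'] with z hz
    simp only [Set.mem_compl_iff, Set.mem_preimage, Set.mem_singleton_iff] at hz
    simp [hgdef, hz]
  have hci1 : CircleIntegrable (fun z => Real.log ‖G z‖) c R :=
    MeromorphicOn.circleIntegrable_log_norm fun z hz => (hG z (sphere_subset_closedBall hz)).meromorphicAt
  have hcig : CircleIntegrable g c R := hci1.congr_codiscreteWithin hcod
  have hcont : ContinuousOn (fun z => Real.log (‖G z‖ + ε)) (sphere c |R|) := by
    have hGc : ContinuousOn G (sphere c |R|) := hG.continuousOn.mono sphere_subset_closedBall
    refine ContinuousOn.log (hGc.norm.add continuousOn_const) fun z _ => ?_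
    have := norm_nonneg (G z); positivity
  have hci2 : CircleIntegrable (fun z => Real.log (‖G z‖ + ε)) c R := hcont.circleIntegrable'
  have h2 : circleAverage (fun z => Real.log ‖G z‖) c R = circleAverage g c R :=
    circleAverage_congr_codiscreteWithin hcod hR.ne'
  have h3 : circleAverage g c R ≤ circleAverage (fun z => Real.log (‖G z‖ + ε)) c R := by
    refine circleAverage_mono hcig hci2 fun z _ => ?_
    by_cases hz : G z = 0
    · simp [hgdef, hz]
    · simp only [hgdef, hz, if_false]
      exact Real.log_le_log (norm_pos_iff.2 hz) (by linarith)
  linarith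

/-- **Jensen's inequality at the centre of the unit disc, with a.e. boundary values.** Let `G` be
holomorphic and bounded on the open unit disc, `G 0 ≠ 0`, and suppose that at a.e. boundary point
`e^{iθ}` the function `G` has a limit `b θ` from inside the disc. Then for every `ε > 0`,
`log ‖G 0‖ ≤ (2π)⁻¹ ∫₀^{2π} log (‖b θ‖ + ε) dθ`. (Jensen's formula on the circles of radius
`ρ ↑ 1` and dominated convergence.) [folklore] -/
theorem log_norm_le_average_log_boundary {G : ℂ → ℂ} {b : ℝ → ℂ} {M ε : ℝ}
    (hG : DifferentiableOn ℂ G (ball 0 1)) (hM : ∀ z ∈ ball (0 : ℂ) 1, ‖G z‖ ≤ M)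
    (hlim : ∀ᵐ θ : ℝ, Tendsto G (𝓝[ball 0 1] (circleMap 0 1 θ)) (𝓝 (b θ)))
    (h0 : G 0 ≠ 0) (hε : 0 < ε) :
    Real.log ‖G 0‖ ≤ (2 * π)⁻¹ * ∫ θ in (0 : ℝ)..2 * π, Real.log (‖b θ‖ + ε) := by
  -- radii `ρ n = 1 - 1/(n+2) ∈ (0,1)`, `ρ n → 1`
  set ρ : ℕ → ℝ := fun n => 1 - 1 / ((n : ℝ) + 2) with hρdef
  have hρpos : ∀ n, 0 < ρ n := fun n => by
    have : (1 : ℝ) / ((n : ℝ) + 2) < 1 := by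
      rw [div_lt_one (by positivity)]; linarith [n.cast_nonneg (α := ℝ)]
    simp only [hρdef]; linarith
  have hρlt : ∀ n, ρ n < 1 := fun n => by
    have : 0 < (1 : ℝ) / ((n : ℝ) + 2) := by positivity
    simp only [hρdef]; linarith
  have hρlim : Tendsto ρ atTop (𝓝 1) := by
    have h1 : Tendsto (fun n : ℕ => (1 : ℝ) / ((n : ℝ) + 2)) atTop (𝓝 0) := by
      have h2 : Tendsto (fun n : ℕ => ((n : ℝ) + 2)) atTop atTop :=
        tendsto_atTop_add_const_right _ _ tendsto_natCast_atTop_atTop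
      have h3 := tendsto_inv_atTop_zero.comp h2
      refine h3.congr fun n => ?_
      simp [one_div]
    have : Tendsto (fun n : ℕ => 1 - (1 : ℝ) / ((n : ℝ) + 2)) atTop (𝓝 (1 - 0)) :=
      tendsto_const_nhds.sub h1
    simpa [hρdef] using this
  have hM0 : 0 ≤ M := (norm_nonneg _).trans (hM 0 (by simp))
  -- Step 1: Jensen on each circle of radius `ρ n`.
  have hstep : ∀ n, Real.log ‖G 0‖ ≤
      (2 * π)⁻¹ * ∫ θ in (0 : ℝ)..2 * π, Real.log (‖G (circleMap 0 (ρ n) θ)‖ + ε) := by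
    intro n
    have hsub : closedBall (0 : ℂ) |ρ n| ⊆ ball 0 1 := by
      rw [abs_of_pos (hρpos n)]
      exact closedBall_subset_ball (hρlt n)
    have hAn : AnalyticOnNhd ℂ G (closedBall 0 |ρ n|) := fun z hz =>
      hG.analyticAt (isOpen_ball.mem_nhds (hsub hz))
    have h1 := log_norm_le_circleAverage_log_add (hρpos n) hAn h0 hε
    rwa [circleAverage_def, smul_eq_mul] at h1
  -- Step 2: dominated convergence as `n → ∞`.
  have hlim2 : Tendsto (fun n => ∫ θ in (0 : ℝ)..2 * π, Real.log (‖G (circleMap 0 (ρ n) θ)‖ + ε))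
      atTop (𝓝 (∫ θ in (0 : ℝ)..2 * π, Real.log (‖b θ‖ + ε))) := by
    have hK : ∀ x : ℝ, 0 ≤ x → x ≤ M → |Real.log (x + ε)| ≤ |Real.log ε| + |Real.log (M + ε)| := by
      intro x hx hxM
      have hlo : Real.log ε ≤ Real.log (x + ε) := Real.log_le_log hε (by linarith)
      have hhi : Real.log (x + ε) ≤ Real.log (M + ε) := Real.log_le_log (by linarith) (by linarith)
      rw [abs_le]
      constructor
      · linarith [neg_abs_le (Real.log ε), abs_nonneg (Real.log (M + ε))]
      · linarith [le_abs_self (Real.log (M + ε)), abs_nonneg (Real.log ε)]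
    refine intervalIntegral.tendsto_integral_filter_of_dominated_convergence
      (fun _ => |Real.log ε| + |Real.log (M + ε)|) ?_ ?_ ?_ ?_
    · -- measurability
      refine Eventually.of_forall fun n => ?_
      have hsub : sphere (0 : ℂ) |ρ n| ⊆ ball 0 1 := by
        rw [abs_of_pos (hρpos n)]; exact sphere_subset_ball (hρlt n)
      have hcont : Continuous fun θ : ℝ => Real.log (‖G (circleMap 0 (ρ n) θ)‖ + ε) := by
        have hGc : ContinuousOn G (ball 0 1) := hG.continuousOn
        have h1 : Continuous fun θ : ℝ => G (circleMap 0 (ρ n) θ) :=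
          hGc.comp_continuous (continuous_circleMap 0 (ρ n))
            fun θ => hsub (circleMap_mem_sphere' 0 (ρ n) θ)
        refine Continuous.log (h1.norm.add continuous_const) fun θ => ?_
        have := norm_nonneg (G (circleMap 0 (ρ n) θ)); positivity
      exact hcont.aestronglyMeasurable
    · -- bound
      refine Eventually.of_forall fun n => ae_of_all _ fun θ _ => ?_
      have hsub : sphere (0 : ℂ) |ρ n| ⊆ ball 0 1 := by
        rw [abs_of_pos (hρpos n)]; exact sphere_subset_ball (hρlt n)
      rw [Real.norm_eq_abs]
      exact hK _ (norm_nonneg _) (hM _ (hsub (circleMap_mem_sphere' 0 (ρ n) θ)))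
    · exact intervalIntegrable_const
    · -- a.e. convergence
      have : ∀ᵐ θ : ℝ, Tendsto (fun n => Real.log (‖G (circleMap 0 (ρ n) θ)‖ + ε)) atTop
          (𝓝 (Real.log (‖b θ‖ + ε))) := by
        filter_upwards [hlim] with θ hθ
        have hpath : Tendsto (fun n => circleMap 0 (ρ n) θ) atTop (𝓝[ball 0 1] (circleMap 0 1 θ)) := by
          refine tendsto_nhdsWithin_iff.2 ⟨?_, Eventually.of_forall fun n => ?_⟩
          · have hc : Continuous fun s : ℝ => circleMap 0 s θ := by
              simp only [circleMap]; fun_prop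
            have := hc.tendsto 1
            exact this.comp hρlim
          · have : circleMap 0 (ρ n) θ ∈ sphere (0 : ℂ) |ρ n| := circleMap_mem_sphere' 0 (ρ n) θ
            rw [abs_of_pos (hρpos n)] at this
            exact sphere_subset_ball (hρlt n) this
        have hGlim : Tendsto (fun n => G (circleMap 0 (ρ n) θ)) atTop (𝓝 (b θ)) := hθ.comp hpath
        have hcont : ContinuousAt (fun w : ℂ => Real.log (‖w‖ + ε)) (b θ) := by
          refine ContinuousAt.log (by fun_prop) ?_
          have := norm_nonneg (b θ); positivity
        exact hcont.tendsto.comp hGlim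
      exact this.mono fun θ h _ => h
  have hlim3 : Tendsto (fun n => (2 * π)⁻¹ *
      ∫ θ in (0 : ℝ)..2 * π, Real.log (‖G (circleMap 0 (ρ n) θ)‖ + ε))
      atTop (𝓝 ((2 * π)⁻¹ * ∫ θ in (0 : ℝ)..2 * π, Real.log (‖b θ‖ + ε))) :=
    hlim2.const_mul _
  exact ge_of_tendsto' hlim3 fun n => hstep n


/-! ### From the circle to the line: the Cayley boundary parametrisation -/

/-- The point of the unit circle corresponding to `u ∈ ℝ = ∂ℍ` under the Cayley map
`w ↦ (w - i)/(w + i)`. [folklore] -/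
def cayBd (u : ℝ) : ℂ := ((u : ℂ) - I) / ((u : ℂ) + I)

/-- `u + i ≠ 0` for real `u`. [folklore] -/
theorem ofReal_add_I_ne_zero (u : ℝ) : (u : ℂ) + I ≠ 0 := by
  intro h
  have := congrArg Complex.im h
  simp at this

/-- `e^{iθ} = cayBd (tan ((θ - π)/2))` whenever `cos ((θ - π)/2) ≠ 0`. [folklore] -/
theorem circleMap_eq_cayBd {θ : ℝ} (h : Real.cos ((θ - π) / 2) ≠ 0) :
    circleMap 0 1 θ = cayBd (Real.tan ((θ - π) / 2)) := by
  set φ : ℝ := (θ - π) / 2 with hφ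
  have hθ : θ = 2 * φ + π := by rw [hφ]; ring
  have hc : (Real.cos φ : ℂ) ≠ 0 := by exact_mod_cast h
  have hE : cexp (θ * I) = -(cexp (φ * I)) ^ 2 := by
    rw [hθ]; push_cast
    rw [show (2 * (φ : ℂ) + π) * I = φ * I + φ * I + π * I by ring, Complex.exp_add,
      Complex.exp_add, Complex.exp_pi_mul_I]
    ring
  have h1 : (Real.sin φ : ℂ) - I * Real.cos φ = -I * cexp (φ * I) := by
    rw [Complex.exp_mul_I, ← Complex.ofReal_sin, ← Complex.ofReal_cos]
    ring_nf; rw [Complex.I_sq]; ring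
  have h2 : (Real.sin φ : ℂ) + I * Real.cos φ = I * cexp ((-φ) * I) := by
    rw [Complex.exp_mul_I, ← Complex.ofReal_neg, ← Complex.ofReal_sin, ← Complex.ofReal_cos,
      Real.sin_neg, Real.cos_neg]
    push_cast
    ring_nf; rw [Complex.I_sq]; ring
  simp only [circleMap, zero_add, Complex.ofReal_one, one_mul, cayBd]
  rw [Real.tan_eq_sin_div_cos, Complex.ofReal_div]
  rw [show (Real.sin φ : ℂ) / Real.cos φ - I = ((Real.sin φ : ℂ) - I * Real.cos φ) / Real.cos φ by
      field_simp,
    show (Real.sin φ : ℂ) / Real.cos φ + I = ((Real.sin φ : ℂ) + I * Real.cos φ) / Real.cos φ by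
      field_simp,
    div_div_div_cancel_right₀ hc, h1, h2, hE,
    show (-(φ : ℂ)) * I = -(φ * I) by ring, Complex.exp_neg]
  have he : cexp (↑φ * I) ≠ 0 := Complex.exp_ne_zero _
  field_simp

/-- The solutions of `tan φ = e` with `cos φ ≠ 0` form a countable set (they are
`arctan e + kπ`, `k ∈ ℤ`). [folklore] -/
theorem countable_setOf_tan_eq (e : ℝ) :
    Set.Countable {φ : ℝ | Real.cos φ ≠ 0 ∧ Real.tan φ = e} := by
  have hsub : {φ : ℝ | Real.cos φ ≠ 0 ∧ Real.tan φ = e} ⊆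
      Set.range (fun k : ℤ => Real.arctan e + k * π) := by
    rintro φ ⟨hc, ht⟩
    set k : ℤ := ⌊φ / π + 1 / 2⌋ with hk
    have h1 : (k : ℝ) ≤ φ / π + 1 / 2 := Int.floor_le _
    have h2 : φ / π + 1 / 2 < k + 1 := Int.lt_floor_add_one _
    set ψ : ℝ := φ - k * π with hψ
    have hψ1 : -(π / 2) ≤ ψ := by
      have : ((k : ℝ) - 1 / 2) * π ≤ φ := by
        have := mul_le_mul_of_nonneg_right (by linarith : (k : ℝ) - 1 / 2 ≤ φ / π) pi_pos.le
        rwa [div_mul_cancel₀ _ pi_pos.ne'] at this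
      rw [hψ]; nlinarith [pi_pos]
    have hψ2 : ψ < π / 2 := by
      have : φ < ((k : ℝ) + 1 / 2) * π := by
        have := mul_lt_mul_of_pos_right (by linarith : φ / π < (k : ℝ) + 1 / 2) pi_pos
        rwa [div_mul_cancel₀ _ pi_pos.ne'] at this
      rw [hψ]; nlinarith [pi_pos]
    have hcψ : Real.cos ψ ≠ 0 := by
      rw [hψ, Real.cos_sub_int_mul_pi]
      exact mul_ne_zero (zpow_ne_zero _ (by norm_num)) hc
    have hψ1' : -(π / 2) < ψ := by
      rcases hψ1.lt_or_eq with h | h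
      · exact h
      · exfalso; apply hcψ; rw [← h, Real.cos_neg, Real.cos_pi_div_two]
    have htψ : Real.tan ψ = e := by rw [hψ, Real.tan_sub_int_mul_pi, ht]
    have : Real.arctan e = ψ := by rw [← htψ, Real.arctan_tan hψ1' hψ2]
    exact ⟨k, by rw [this, hψ]; ring⟩
  exact (Set.countable_range _).mono hsub

/-- Change of variables `θ = π + 2 arctan u` from `(0, 2π)` to `ℝ`:
`∫₀^{2π} k(θ) dθ = ∫_ℝ 2(1+u²)⁻¹ k(π + 2 arctan u) du`. [folklore] -/
theorem integral_comp_two_arctan (k : ℝ → ℝ) :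
    ∫ θ in (0 : ℝ)..2 * π, k θ = ∫ u : ℝ, (2 * (1 + u ^ 2)⁻¹) * k (π + 2 * Real.arctan u) := by
  set f : ℝ → ℝ := fun u => π + 2 * Real.arctan u with hf
  have hderiv : ∀ u : ℝ, HasDerivAt f (2 * (1 + u ^ 2)⁻¹) u := fun u => by
    have := ((Real.hasDerivAt_arctan u).const_mul 2).const_add π
    simpa [hf, one_div] using this
  have hinj : Set.InjOn f Set.univ := by
    intro x _ y _ hxy
    simp only [hf] at hxy
    have : Real.arctan x = Real.arctan y := by linarith
    exact Real.arctan_injective this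
  have himage : f '' Set.univ = Set.Ioo 0 (2 * π) := by
    ext θ
    simp only [Set.image_univ, Set.mem_range, Set.mem_Ioo, hf]
    constructor
    · rintro ⟨u, rfl⟩
      constructor <;> nlinarith [Real.neg_pi_div_two_lt_arctan u, Real.arctan_lt_pi_div_two u]
    · rintro ⟨h0, h2⟩
      refine ⟨Real.tan ((θ - π) / 2), ?_⟩
      rw [Real.arctan_tan (by nlinarith [pi_pos]) (by nlinarith [pi_pos])]
      ring
  have := integral_image_eq_integral_abs_deriv_smul MeasurableSet.univ
    (fun u _ => (hderiv u).hasDerivWithinAt) hinj k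
  rw [himage, Measure.restrict_univ] at this
  rw [intervalIntegral.integral_of_le (by positivity), integral_Ioc_eq_integral_Ioo, this]
  refine integral_congr_ae (ae_of_all _ fun u => ?_)
  have hpos : 0 < 2 * (1 + u ^ 2)⁻¹ := by positivity
  simp only [abs_of_pos hpos, smul_eq_mul, hf]

/-- **Jensen's inequality at the centre, boundary values on the line.** `G` holomorphic and
bounded on the unit disc, `G 0 ≠ 0`; if for all `u ∈ ℝ` outside a countable set `G` tends to
`bF u` at the boundary point `cayBd u` from inside the disc, then for every `ε > 0`,
`log ‖G 0‖ ≤ ∫_ℝ π⁻¹ (1+u²)⁻¹ log (‖bF u‖ + ε) du` (the Poisson measure of `ℍ` at `i`, pulled back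
to the boundary line). [folklore] -/
theorem log_norm_le_integral_log_boundary {G : ℂ → ℂ} {bF : ℝ → ℂ} {M ε : ℝ} {E : Set ℝ}
    (hG : DifferentiableOn ℂ G (ball 0 1)) (hM : ∀ z ∈ ball (0 : ℂ) 1, ‖G z‖ ≤ M)
    (hE : E.Countable) (hlim : ∀ u, u ∉ E → Tendsto G (𝓝[ball 0 1] (cayBd u)) (𝓝 (bF u)))
    (h0 : G 0 ≠ 0) (hε : 0 < ε) :
    Real.log ‖G 0‖ ≤ ∫ u : ℝ, π⁻¹ * (1 + u ^ 2)⁻¹ * Real.log (‖bF u‖ + ε) := by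
  set b : ℝ → ℂ := fun θ => bF (Real.tan ((θ - π) / 2)) with hb
  -- the exceptional set of angles is countable
  set B : Set ℝ := {θ | Real.cos ((θ - π) / 2) = 0} ∪
    ⋃ e ∈ E, {θ | Real.cos ((θ - π) / 2) ≠ 0 ∧ Real.tan ((θ - π) / 2) = e} with hB
  have hBc : B.Countable := by
    have haff : ∀ (P : ℝ → Prop), {θ : ℝ | P ((θ - π) / 2)} = (fun φ => 2 * φ + π) '' {φ | P φ} := by
      intro P; ext θ; simp only [Set.mem_setOf_eq, Set.mem_image]
      constructor
      · intro h; exact ⟨(θ - π) / 2, h, by ring⟩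
      · rintro ⟨φ, hφ, rfl⟩; convert hφ using 2; ring
    refine Set.Countable.union ?_ (Set.Countable.biUnion hE fun e _ => ?_)
    · rw [haff (fun φ => Real.cos φ = 0)]
      refine Set.Countable.image ?_ _
      have : {φ : ℝ | Real.cos φ = 0} ⊆ Set.range (fun n : ℤ => (2 * n + 1) * π / 2) := by
        intro φ hφ
        obtain ⟨n, hn⟩ := Real.cos_eq_zero_iff.1 hφ
        exact ⟨n, hn.symm⟩
      exact (Set.countable_range _).mono this
    · rw [haff (fun φ => Real.cos φ ≠ 0 ∧ Real.tan φ = e)]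
      exact (countable_setOf_tan_eq e).image _
  have hae : ∀ᵐ θ : ℝ, Tendsto G (𝓝[ball 0 1] (circleMap 0 1 θ)) (𝓝 (b θ)) := by
    have : ∀ᵐ θ : ℝ, θ ∉ B := measure_eq_zero_iff_ae_notMem.1 (hBc.measure_zero volume)
    filter_upwards [this] with θ hθ
    simp only [hB, Set.mem_union, Set.mem_setOf_eq, Set.mem_iUnion, not_or, not_exists,
      exists_prop, not_and] at hθ
    obtain ⟨hcos, htan⟩ := hθ
    have hnot : Real.tan ((θ - π) / 2) ∉ E := fun hmem => htan _ hmem hcos rfl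
    rw [circleMap_eq_cayBd hcos]
    exact hlim _ hnot
  have hJ := log_norm_le_average_log_boundary hG hM hae h0 hε
  rw [integral_comp_two_arctan (fun θ => Real.log (‖b θ‖ + ε)), ← integral_const_mul] at hJ
  refine hJ.trans (le_of_eq (integral_congr_ae (ae_of_all _ fun u => ?_)))
  simp only [hb]
  rw [show (π + 2 * Real.arctan u - π) / 2 = Real.arctan u by ring, Real.tan_arctan]
  have hπ : (π : ℝ) ≠ 0 := pi_pos.ne'
  field_simp


/-! ### The explicit conformal map: unit disc → upper half-plane → slit strip -/

/-- Inverse Cayley map `ω ↦ i(1+ω)/(1-ω)`: unit disc → upper half-plane, `0 ↦ i`. [folklore] -/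
def cayInv (ω : ℂ) : ℂ := I * (1 + ω) / (1 - ω)

/-- `cayInv 0 = i`. [folklore] -/
@[simp] theorem cayInv_zero : cayInv 0 = I := by simp [cayInv]

/-- `1 - ω ≠ 0` on the open unit disc. [folklore] -/
theorem one_sub_ne_zero_of_mem_ball {ω : ℂ} (h : ω ∈ ball (0 : ℂ) 1) : 1 - ω ≠ 0 := by
  intro h0
  have : ω = 1 := by linear_combination -h0
  rw [this] at h; simp at h

/-- Imaginary part of the inverse Cayley map: `Im cayInv ω = (1 - |ω|²)/|1 - ω|²`. [folklore] -/
theorem cayInv_im (ω : ℂ) (h : 1 - ω ≠ 0) :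
    (cayInv ω).im = (1 - Complex.normSq ω) / Complex.normSq (1 - ω) := by
  have hn : Complex.normSq (1 - ω) ≠ 0 := by rwa [Ne, Complex.normSq_eq_zero]
  rw [cayInv, Complex.div_im, Complex.mul_re, Complex.mul_im]
  simp only [Complex.I_re, Complex.I_im, Complex.add_re, Complex.one_re, Complex.add_im,
    Complex.one_im, Complex.sub_re, Complex.sub_im, Complex.normSq_apply]
  field_simp
  ring

/-- The inverse Cayley map sends the unit disc into the upper half-plane. [folklore] -/
theorem cayInv_im_pos {ω : ℂ} (h : ω ∈ ball (0 : ℂ) 1) : 0 < (cayInv ω).im := by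
  rw [cayInv_im ω (one_sub_ne_zero_of_mem_ball h)]
  have h1 : Complex.normSq ω < 1 := by
    rw [mem_ball_zero_iff] at h
    rw [Complex.normSq_eq_norm_sq]
    nlinarith [norm_nonneg ω]
  have h2 : 0 < Complex.normSq (1 - ω) :=
    Complex.normSq_pos.2 (one_sub_ne_zero_of_mem_ball h)
  exact div_pos (by linarith) h2

/-- `cayInv` is holomorphic off `ω = 1`. [folklore] -/
theorem differentiableAt_cayInv {ω : ℂ} (h : 1 - ω ≠ 0) : DifferentiableAt ℂ cayInv ω := by
  unfold cayInv
  exact ((differentiableAt_const _).mul ((differentiableAt_const _).add differentiableAt_id)).div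
    ((differentiableAt_const _).sub differentiableAt_id) h

/-- `cayInv` is holomorphic on the unit disc. [folklore] -/
theorem differentiableOn_cayInv : DifferentiableOn ℂ cayInv (ball 0 1) := fun _ hω =>
  (differentiableAt_cayInv (one_sub_ne_zero_of_mem_ball hω)).differentiableWithinAt

/-- `1 - cayBd u = 2i/(u + i)`. [folklore] -/
theorem one_sub_cayBd (u : ℝ) : 1 - cayBd u = 2 * I / (u + I) := by
  rw [cayBd, eq_div_iff (ofReal_add_I_ne_zero u), sub_mul, div_mul_cancel₀ _ (ofReal_add_I_ne_zero u)]
  ring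

/-- `cayBd u ≠ 1`. [folklore] -/
theorem one_sub_cayBd_ne_zero (u : ℝ) : 1 - cayBd u ≠ 0 := by
  rw [one_sub_cayBd]
  exact div_ne_zero (mul_ne_zero two_ne_zero Complex.I_ne_zero) (ofReal_add_I_ne_zero u)

/-- `cayInv (cayBd u) = u`: the boundary correspondence circle → line. [folklore] -/
theorem cayInv_cayBd (u : ℝ) : cayInv (cayBd u) = u := by
  have h := ofReal_add_I_ne_zero u
  rw [cayInv, one_sub_cayBd, cayBd]
  field_simp
  ring_nf

/-- `cayBd u` lies on the unit circle. [folklore] -/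
theorem cayBd_mem_sphere (u : ℝ) : cayBd u ∈ sphere (0 : ℂ) 1 := by
  rw [mem_sphere_zero_iff_norm, cayBd, norm_div]
  have h1 : ‖(u : ℂ) - I‖ = ‖(u : ℂ) + I‖ := by
    have : (u : ℂ) - I = (starRingEnd ℂ) ((u : ℂ) + I) := by
      simp [Complex.ext_iff]
    rw [this, Complex.norm_conj]
  rw [h1, div_self]
  exact norm_ne_zero_iff.2 (ofReal_add_I_ne_zero u)

/-- `cayInv` tends to `u` within the upper half-plane at the boundary point `cayBd u`. [folklore] -/
theorem tendsto_cayInv_cayBd (u : ℝ) :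
    Tendsto cayInv (𝓝[ball 0 1] (cayBd u)) (𝓝[{w : ℂ | 0 < w.im}] (u : ℂ)) := by
  refine tendsto_nhdsWithin_iff.2 ⟨?_, ?_⟩
  · have := (differentiableAt_cayInv (one_sub_cayBd_ne_zero u)).continuousAt.tendsto
    rw [cayInv_cayBd] at this
    exact this.mono_left nhdsWithin_le_nhds
  · exact eventually_nhdsWithin_of_forall fun _ hω => cayInv_im_pos hω

/-- The map `Z(w) = (r/π) log (1 - a w²)`. [folklore] -/
def zmap (r a : ℝ) (w : ℂ) : ℂ := ((r / π : ℝ) : ℂ) * Complex.log (1 - a * w ^ 2)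

/-- `Im (1 - a w²) = -2a (Re w)(Im w)` for real `a`. [folklore] -/
theorem one_sub_mul_sq_im (a : ℝ) (w : ℂ) : ((1 : ℂ) - a * w ^ 2).im = -(2 * a * w.re * w.im) := by
  simp [sq, Complex.mul_im, Complex.mul_re]; ring

/-- `Re (1 - a w²) = 1 - a((Re w)² - (Im w)²)` for real `a`. [folklore] -/
theorem one_sub_mul_sq_re (a : ℝ) (w : ℂ) :
    ((1 : ℂ) - a * w ^ 2).re = 1 - a * (w.re ^ 2 - w.im ^ 2) := by
  simp [sq, Complex.mul_im, Complex.mul_re]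

/-- For `a > 0` and `Im w > 0`, `1 - a w²` avoids the closed negative real axis. [folklore] -/
theorem one_sub_mul_sq_mem_slitPlane {a : ℝ} (ha : 0 < a) {w : ℂ} (hw : 0 < w.im) :
    (1 : ℂ) - a * w ^ 2 ∈ Complex.slitPlane := by
  rw [Complex.mem_slitPlane_iff, one_sub_mul_sq_re, one_sub_mul_sq_im]
  by_cases hre : w.re = 0
  · left; rw [hre]; nlinarith [sq_nonneg w.im]
  · right
    intro h
    have : 2 * a * w.re * w.im = 0 := by linarith
    exact (mul_ne_zero (mul_ne_zero (mul_ne_zero two_ne_zero ha.ne') hre) hw.ne') this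

/-- `Im Z(w) = (r/π) arg (1 - a w²)`. [folklore] -/
theorem zmap_im (r a : ℝ) (w : ℂ) : (zmap r a w).im = r / π * Complex.arg (1 - a * w ^ 2) := by
  rw [zmap, Complex.im_ofReal_mul, Complex.log_im]

/-- `Z` maps the upper half-plane into the open strip `|Im z| < r`. [folklore] -/
theorem abs_zmap_im_lt {r a : ℝ} (hr : 0 < r) (ha : 0 < a) {w : ℂ} (hw : 0 < w.im) :
    |(zmap r a w).im| < r := by
  rw [zmap_im]
  have hslit := one_sub_mul_sq_mem_slitPlane ha hw
  set v : ℂ := 1 - a * w ^ 2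
  have h1 : -π < Complex.arg v := Complex.neg_pi_lt_arg v
  have h2 : Complex.arg v < π := by
    refine lt_of_le_of_ne (Complex.arg_le_pi v) fun h => ?_
    rw [Complex.arg_eq_pi_iff] at h
    rw [Complex.mem_slitPlane_iff] at hslit
    rcases hslit with h3 | h3
    · linarith [h.1]
    · exact h3 h.2
  rw [abs_lt]
  constructor
  · have : r / π * (-π) < r / π * Complex.arg v := mul_lt_mul_of_pos_left h1 (by positivity)
    calc -r = r / π * (-π) := by field_simp
      _ < _ := this
  · have : r / π * Complex.arg v < r / π * π := mul_lt_mul_of_pos_left h2 (by positivity)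
    calc _ < r / π * π := this
      _ = r := by field_simp

/-- `Z` is holomorphic on the upper half-plane. [folklore] -/
theorem differentiableAt_zmap {r a : ℝ} (ha : 0 < a) {w : ℂ} (hw : 0 < w.im) :
    DifferentiableAt ℂ (zmap r a) w := by
  unfold zmap
  refine (differentiableAt_const _).mul ?_
  refine ((differentiableAt_const _).sub ((differentiableAt_const _).mul (differentiableAt_pow 2))).clog ?_
  exact one_sub_mul_sq_mem_slitPlane ha hw

/-- `Z(i) = t` when `a = e^{πt/r} - 1`. [folklore] -/
theorem zmap_I {r t : ℝ} (hr : 0 < r) : zmap r (Real.exp (π * t / r) - 1) I = t := by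
  rw [zmap, Complex.I_sq]
  have : (1 : ℂ) - ((Real.exp (π * t / r) - 1 : ℝ) : ℂ) * -1 = ((Real.exp (π * t / r) : ℝ) : ℂ) := by
    push_cast; ring
  rw [this, ← Complex.ofReal_log (Real.exp_pos _).le, Real.log_exp]
  have hr' : (r : ℂ) ≠ 0 := by exact_mod_cast hr.ne'
  push_cast
  field_simp

/-- Boundary values of `zmap r a` on the real axis (approached from the upper half-plane). [folklore] -/
def zbd (r a u : ℝ) : ℂ :=
  if a * u ^ 2 < 1 then ((r / π * Real.log (1 - a * u ^ 2) : ℝ) : ℂ)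
  else if 0 < u then ((r / π * Real.log (a * u ^ 2 - 1) : ℝ) : ℂ) - r * I
  else ((r / π * Real.log (a * u ^ 2 - 1) : ℝ) : ℂ) + r * I

/-- `1 - a u²` for real `u`, as a real number cast to `ℂ`. [folklore] -/
theorem one_sub_mul_sq_ofReal (a u : ℝ) : (1 : ℂ) - a * (u : ℂ) ^ 2 = ((1 - a * u ^ 2 : ℝ) : ℂ) := by
  push_cast; ring

/-- The boundary limits of `zmap` from inside the upper half-plane. [folklore] -/
theorem tendsto_zmap_zbd {r a u : ℝ} (ha : 0 < a) (hu : a * u ^ 2 ≠ 1) :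
    Tendsto (zmap r a) (𝓝[{w : ℂ | 0 < w.im}] (u : ℂ)) (𝓝 (zbd r a u)) := by
  rcases lt_or_gt_of_ne hu with hlt | hgt
  · -- interior of the cut: `1 - a u² > 0`, `log` is continuous there
    have hv : 0 < 1 - a * u ^ 2 := by linarith
    have hslit : (1 : ℂ) - a * (u : ℂ) ^ 2 ∈ Complex.slitPlane := by
      rw [one_sub_mul_sq_ofReal]; exact Complex.ofReal_mem_slitPlane.2 hv
    have hcont : ContinuousAt (zmap r a) u := by
      unfold zmap
      refine continuousAt_const.mul (ContinuousAt.clog ?_ hslit)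
      fun_prop
    have hval : zmap r a u = zbd r a u := by
      rw [zbd, if_pos hlt, zmap, one_sub_mul_sq_ofReal, ← Complex.ofReal_log hv.le]
      push_cast; ring
    rw [← hval]
    exact hcont.tendsto.mono_left nhdsWithin_le_nhds
  · -- the edges: `1 - a u² < 0`, one-sided limits of `log`
    have hv : 1 - a * u ^ 2 < 0 := by linarith
    have hu0 : u ≠ 0 := by rintro rfl; simp at hgt; linarith
    have hre : (((1 - a * u ^ 2 : ℝ) : ℂ)).re < 0 := by rw [Complex.ofReal_re]; exact hv
    have him : (((1 - a * u ^ 2 : ℝ) : ℂ)).im = 0 := Complex.ofReal_im _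
    have hnorm : ‖((1 - a * u ^ 2 : ℝ) : ℂ)‖ = a * u ^ 2 - 1 := by
      rw [Complex.norm_real, Real.norm_eq_abs, abs_of_neg hv]; ring
    -- the inner map tends to `1 - a u²` within the correct half-plane
    set m : ℂ → ℂ := fun w => 1 - a * w ^ 2 with hm
    have hmc : Tendsto m (𝓝[{w : ℂ | 0 < w.im}] (u : ℂ)) (𝓝 (((1 - a * u ^ 2 : ℝ) : ℂ))) := by
      have : ContinuousAt m u := by simp only [hm]; fun_prop
      have h2 := this.tendsto
      rw [show m u = (((1 - a * u ^ 2 : ℝ) : ℂ)) from one_sub_mul_sq_ofReal a u] at h2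
      exact h2.mono_left nhdsWithin_le_nhds
    have hre_ev : ∀ᶠ w in 𝓝[{w : ℂ | 0 < w.im}] (u : ℂ), 0 < w.im ∧ (0 < u → 0 < w.re) ∧ (u < 0 → w.re < 0) := by
      have h1 : ∀ᶠ w in 𝓝[{w : ℂ | 0 < w.im}] (u : ℂ), 0 < w.im := self_mem_nhdsWithin
      have h2 : ∀ᶠ w in 𝓝 (u : ℂ), (0 < u → 0 < w.re) ∧ (u < 0 → w.re < 0) := by
        rcases lt_or_gt_of_ne hu0 with hneg | hpos
        · have : ∀ᶠ w in 𝓝 (u : ℂ), w.re < 0 := by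
            have := Complex.continuous_re.tendsto (u : ℂ)
            simp only [Complex.ofReal_re] at this
            exact this.eventually (gt_mem_nhds hneg)
          exact this.mono fun w hw => ⟨fun h => absurd hneg (not_lt.2 h.le), fun _ => hw⟩
        · have : ∀ᶠ w in 𝓝 (u : ℂ), 0 < w.re := by
            have := Complex.continuous_re.tendsto (u : ℂ)
            simp only [Complex.ofReal_re] at this
            exact this.eventually (lt_mem_nhds hpos)
          exact this.mono fun w hw => ⟨fun _ => hw, fun h => absurd hpos (not_lt.2 h.le)⟩
      exact h1.and (h2.filter_mono nhdsWithin_le_nhds)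
    rcases lt_or_gt_of_ne hu0 with hneg | hpos
    · -- `u < 0`: approach from `{im ≥ 0}`, limit `log |v| + iπ`
      have hmt : Tendsto m (𝓝[{w : ℂ | 0 < w.im}] (u : ℂ))
          (𝓝[{z : ℂ | 0 ≤ z.im}] (((1 - a * u ^ 2 : ℝ) : ℂ))) := by
        refine tendsto_nhdsWithin_iff.2 ⟨hmc, hre_ev.mono fun w hw => ?_⟩
        simp only [Set.mem_setOf_eq, hm, one_sub_mul_sq_im]
        have h5 : a * w.im * w.re < 0 := mul_neg_of_pos_of_neg (mul_pos ha hw.1) (hw.2.2 hneg)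
        have h6 : 2 * a * w.re * w.im = 2 * (a * w.im * w.re) := by ring
        rw [h6]; linarith
      have hlog := (Complex.tendsto_log_nhdsWithin_im_nonneg_of_re_neg_of_im_zero hre him).comp hmt
      have h3 : Tendsto (zmap r a) (𝓝[{w : ℂ | 0 < w.im}] (u : ℂ))
          (𝓝 (((r / π : ℝ) : ℂ) * (Real.log ‖((1 - a * u ^ 2 : ℝ) : ℂ)‖ + π * I))) :=
        hlog.const_mul _
      have hval : ((r / π : ℝ) : ℂ) * (Real.log ‖((1 - a * u ^ 2 : ℝ) : ℂ)‖ + π * I) = zbd r a u := by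
        rw [hnorm, zbd, if_neg (not_lt.2 hgt.le), if_neg (not_lt.2 hneg.le)]
        push_cast
        field_simp
      rw [← hval]; exact h3
    · -- `0 < u`: approach from `{im < 0}`, limit `log |v| - iπ`
      have hmt : Tendsto m (𝓝[{w : ℂ | 0 < w.im}] (u : ℂ))
          (𝓝[{z : ℂ | z.im < 0}] (((1 - a * u ^ 2 : ℝ) : ℂ))) := by
        refine tendsto_nhdsWithin_iff.2 ⟨hmc, hre_ev.mono fun w hw => ?_⟩
        simp only [Set.mem_setOf_eq, hm, one_sub_mul_sq_im]
        have h5 : 0 < a * w.im * w.re := mul_pos (mul_pos ha hw.1) (hw.2.1 hpos)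
        have h6 : 2 * a * w.re * w.im = 2 * (a * w.im * w.re) := by ring
        rw [h6]; linarith
      have hlog := (Complex.tendsto_log_nhdsWithin_im_neg_of_re_neg_of_im_zero hre him).comp hmt
      have h3 : Tendsto (zmap r a) (𝓝[{w : ℂ | 0 < w.im}] (u : ℂ))
          (𝓝 (((r / π : ℝ) : ℂ) * (Real.log ‖((1 - a * u ^ 2 : ℝ) : ℂ)‖ - π * I))) :=
        hlog.const_mul _
      have hval : ((r / π : ℝ) : ℂ) * (Real.log ‖((1 - a * u ^ 2 : ℝ) : ℂ)‖ - π * I) = zbd r a u := by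
        rw [hnorm, zbd, if_neg (not_lt.2 hgt.le), if_pos hpos]
        push_cast
        field_simp
      rw [← hval]; exact h3

/-- The composite `G = F ∘ Z ∘ cayInv` tends to `F (zbd r a u)` at the boundary point `cayBd u`. [folklore] -/
theorem tendsto_comp_zmap_cayInv {F : ℂ → ℂ} (hF : Continuous F) {r a u : ℝ} (ha : 0 < a)
    (hu : a * u ^ 2 ≠ 1) :
    Tendsto (fun ω => F (zmap r a (cayInv ω))) (𝓝[ball 0 1] (cayBd u)) (𝓝 (F (zbd r a u))) :=
  (hF.tendsto _).comp ((tendsto_zmap_zbd ha hu).comp (tendsto_cayInv_cayBd u))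



/-! ### Elementary inequalities -/

/-- `log y ≤ log m + y/m - 1` for `y, m > 0` (the tangent line of the concave `log` at `m`). [folklore] -/
theorem log_le_log_add_div_sub_one {y m : ℝ} (hy : 0 < y) (hm : 0 < m) :
    Real.log y ≤ Real.log m + y / m - 1 := by
  have h := Real.log_le_sub_one_of_pos (div_pos hy hm)
  rw [Real.log_div hy.ne' hm.ne'] at h
  linarith

/-- `(1/t)^t ≤ e^{1/e}` for `t > 0`, i.e. `-t log t ≤ 1/e`. [folklore] -/
theorem inv_rpow_self_le {t : ℝ} (ht : 0 < t) : (t⁻¹) ^ t ≤ Real.exp (Real.exp (-1)) := by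
  have h1 : Real.log t⁻¹ ≤ t⁻¹ * Real.exp (-1) := by
    have h := Real.log_le_sub_one_of_pos (show 0 < t⁻¹ * Real.exp (-1) by positivity)
    rw [Real.log_mul (inv_pos.2 ht).ne' (Real.exp_pos _).ne', Real.log_exp] at h
    linarith
  rw [Real.rpow_def_of_pos (inv_pos.2 ht), Real.exp_le_exp]
  calc Real.log t⁻¹ * t ≤ t⁻¹ * Real.exp (-1) * t := mul_le_mul_of_nonneg_right h1 ht.le
    _ = Real.exp (-1) := by field_simp

/-- **Tangent-line Jensen on two pieces.** For a weight `p ≥ 0` and `ε ≤ H ≤ K`: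
`∫ p log H ≤ 2k log (A/k) + (k'/2) log (B/k')` with `k = ∫_S p`, `k' = ∫_{Sᶜ} p`,
`A = ∫_S p √H`, `B = ∫_{Sᶜ} p H²`. [folklore] -/
theorem integral_mul_log_le_two_pieces {p H : ℝ → ℝ} {S : Set ℝ} {ε K : ℝ}
    (hS : MeasurableSet S) (hp : Integrable p) (hp0 : ∀ u, 0 ≤ p u) (hH : Measurable H)
    (hε : 0 < ε) (hHε : ∀ u, ε ≤ H u) (hHK : ∀ u, H u ≤ K)
    (hk : 0 < ∫ u in S, p u) (hk' : 0 < ∫ u in Sᶜ, p u) :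
    0 < ∫ u in S, p u * Real.sqrt (H u) ∧ 0 < ∫ u in Sᶜ, p u * H u ^ 2 ∧
    ∫ u, p u * Real.log (H u) ≤
      2 * (∫ u in S, p u) * Real.log ((∫ u in S, p u * Real.sqrt (H u)) / ∫ u in S, p u) +
      (∫ u in Sᶜ, p u) / 2 * Real.log ((∫ u in Sᶜ, p u * H u ^ 2) / ∫ u in Sᶜ, p u) := by
  set k := ∫ u in S, p u with hkdef
  set k' := ∫ u in Sᶜ, p u with hk'def
  set A := ∫ u in S, p u * Real.sqrt (H u) with hAdef
  set B := ∫ u in Sᶜ, p u * H u ^ 2 with hBdef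
  have hK : ε ≤ K := (hHε 0).trans (hHK 0)
  have hHpos : ∀ u, 0 < H u := fun u => hε.trans_le (hHε u)
  -- integrability of the various products (bounded measurable times integrable)
  have hint : ∀ (φ : ℝ → ℝ), Measurable φ → ∀ C, (∀ x, ε ≤ x → x ≤ K → |φ x| ≤ C) →
      Integrable fun u => p u * φ (H u) := by
    intro φ hφ C hC
    refine hp.mul_bdd (c := C) (hφ.comp hH).aestronglyMeasurable (ae_of_all _ fun u => ?_)
    rw [Real.norm_eq_abs]; exact hC _ (hHε u) (hHK u)
  have hlogint : Integrable fun u => p u * Real.log (H u) := by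
    refine hint Real.log Real.measurable_log (|Real.log ε| + |Real.log K|) fun x hx hxK => ?_
    have h1 : Real.log ε ≤ Real.log x := Real.log_le_log hε hx
    have h2 : Real.log x ≤ Real.log K := Real.log_le_log (hε.trans_le hx) hxK
    rw [abs_le]; constructor
    · linarith [neg_abs_le (Real.log ε), abs_nonneg (Real.log K)]
    · linarith [le_abs_self (Real.log K), abs_nonneg (Real.log ε)]
  have hsqrtint : Integrable fun u => p u * Real.sqrt (H u) := by
    refine hint Real.sqrt Real.continuous_sqrt.measurable (Real.sqrt K) fun x hx hxK => ?_
    rw [abs_of_nonneg (Real.sqrt_nonneg _)]; exact Real.sqrt_le_sqrt hxK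
  have hsqint : Integrable fun u => p u * H u ^ 2 := by
    refine hint (fun x => x ^ 2) (measurable_id.pow_const 2) (K ^ 2) fun x hx hxK => ?_
    rw [abs_of_nonneg (sq_nonneg _)]
    exact pow_le_pow_left₀ (hε.le.trans hx) hxK 2
  -- positivity of `A` and `B`
  have hA : 0 < A := by
    have : (∫ u in S, p u * Real.sqrt ε) ≤ A :=
      setIntegral_mono_on (hp.mul_const _).integrableOn hsqrtint.integrableOn hS fun u _ =>
        mul_le_mul_of_nonneg_left (Real.sqrt_le_sqrt (hHε u)) (hp0 u)
    rw [integral_mul_const] at this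
    exact lt_of_lt_of_le (mul_pos hk (Real.sqrt_pos.2 hε)) this
  have hB : 0 < B := by
    have : (∫ u in Sᶜ, p u * ε ^ 2) ≤ B :=
      setIntegral_mono_on (hp.mul_const _).integrableOn hsqint.integrableOn hS.compl fun u _ =>
        mul_le_mul_of_nonneg_left (pow_le_pow_left₀ hε.le (hHε u) 2) (hp0 u)
    rw [integral_mul_const] at this
    exact lt_of_lt_of_le (mul_pos hk' (by positivity)) this
  refine ⟨hA, hB, ?_⟩
  -- split the integral
  rw [← integral_add_compl hS hlogint]
  -- piece `S`: `log H = 2 log √H ≤ 2 (log m + √H/m - 1)`, `m = A/k`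
  have hmA : 0 < A / k := div_pos hA hk
  have hmB : 0 < B / k' := div_pos hB hk'
  set m := A / k with hmdef
  set m' := B / k' with hm'def
  have h1 : ∫ u in S, p u * Real.log (H u) ≤
      ∫ u in S, (2 * (Real.log m - 1)) * p u + (2 / m) * (p u * Real.sqrt (H u)) := by
    refine setIntegral_mono_on hlogint.integrableOn ?_ hS fun u _ => ?_
    · exact ((hp.const_mul _).add (hsqrtint.const_mul _)).integrableOn
    · have hsq : Real.log (H u) = 2 * Real.log (Real.sqrt (H u)) := by
        rw [Real.log_sqrt (hHpos u).le]; ring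
      have := log_le_log_add_div_sub_one (Real.sqrt_pos.2 (hHpos u)) hmA
      rw [hsq]
      have h3 := mul_le_mul_of_nonneg_left this (hp0 u)
      calc p u * (2 * Real.log (Real.sqrt (H u))) = 2 * (p u * Real.log (Real.sqrt (H u))) := by ring
        _ ≤ 2 * (p u * (Real.log m + Real.sqrt (H u) / m - 1)) := by linarith [h3]
        _ = _ := by ring
  have h1' : ∫ u in S, (2 * (Real.log m - 1)) * p u + (2 / m) * (p u * Real.sqrt (H u)) =
      2 * k * Real.log m := by
    rw [integral_add ((hp.const_mul _).integrableOn) ((hsqrtint.const_mul _).integrableOn),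
      integral_const_mul, integral_const_mul, ← hkdef, ← hAdef]
    have : A = m * k := by rw [hmdef]; field_simp
    rw [this]
    field_simp
    ring
  -- piece `Sᶜ`: `log H = (1/2) log H² ≤ (1/2) (log m + H²/m - 1)`, `m = B/k'`
  have h2 : ∫ u in Sᶜ, p u * Real.log (H u) ≤
      ∫ u in Sᶜ, ((Real.log m' - 1) / 2) * p u + (1 / (2 * m')) * (p u * H u ^ 2) := by
    refine setIntegral_mono_on hlogint.integrableOn ?_ hS.compl fun u _ => ?_
    · exact ((hp.const_mul _).add (hsqint.const_mul _)).integrableOn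
    · have hsq : Real.log (H u) = Real.log (H u ^ 2) / 2 := by
        rw [Real.log_pow]; push_cast; ring
      have := log_le_log_add_div_sub_one (pow_pos (hHpos u) 2) hmB
      rw [hsq]
      have h3 := mul_le_mul_of_nonneg_left this (hp0 u)
      calc p u * (Real.log (H u ^ 2) / 2) = (1 / 2) * (p u * Real.log (H u ^ 2)) := by ring
        _ ≤ (1 / 2) * (p u * (Real.log m' + H u ^ 2 / m' - 1)) := by linarith [h3]
        _ = _ := by ring
  have h2' : ∫ u in Sᶜ, ((Real.log m' - 1) / 2) * p u + (1 / (2 * m')) * (p u * H u ^ 2) =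
      k' / 2 * Real.log m' := by
    rw [integral_add ((hp.const_mul _).integrableOn) ((hsqint.const_mul _).integrableOn),
      integral_const_mul, integral_const_mul, ← hk'def, ← hBdef]
    have : B = m' * k' := by rw [hm'def]; field_simp
    rw [this]
    field_simp
    ring
  linarith

/-- Exponentiating: `2 log x ≤ 4k log a + k' log b` gives `x² ≤ a^{4k} b^{k'}`. [folklore] -/
theorem sq_le_of_two_log_le {x a b k k' : ℝ} (hx : 0 < x) (ha : 0 < a) (hb : 0 < b)
    (h : 2 * Real.log x ≤ 4 * k * Real.log a + k' * Real.log b) :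
    x ^ 2 ≤ a ^ (4 * k) * b ^ k' := by
  have : x ^ 2 = Real.exp (2 * Real.log x) := by
    rw [show (2 : ℝ) * Real.log x = (2 : ℕ) * Real.log x by norm_num, Real.exp_nat_mul,
      Real.exp_log hx]
  rw [this, Real.rpow_def_of_pos ha, Real.rpow_def_of_pos hb, ← Real.exp_add, Real.exp_le_exp]
  linarith [mul_comm (Real.log a) (4 * k), mul_comm (Real.log b) k']

/-- `(t⁻¹)^{c t} ≤ (e^{1/e})^c` for `t > 0` and a natural number `c`. [folklore] -/
theorem inv_rpow_mul_self_le {t : ℝ} (ht : 0 < t) (c : ℕ) :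
    (t⁻¹) ^ ((c : ℝ) * t) ≤ Real.exp (Real.exp (-1)) ^ c := by
  rw [mul_comm, Real.rpow_mul (inv_nonneg.2 ht.le), Real.rpow_natCast]
  exact pow_le_pow_left₀ (Real.rpow_nonneg (inv_nonneg.2 ht.le) _) (inv_rpow_self_le ht) c

/-- `(A/k)^{4k} (B/k')^{k'} ≤ (e^{1/e})^5 · A^{4k} B^{k'}` for `A, B ≥ 0`, `k, k' > 0`. [folklore] -/
theorem div_rpow_mul_div_rpow_le {A B k k' : ℝ} (hA : 0 ≤ A) (hB : 0 ≤ B) (hk : 0 < k)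
    (hk' : 0 < k') :
    (A / k) ^ (4 * k) * (B / k') ^ k' ≤
      Real.exp (Real.exp (-1)) ^ 5 * (A ^ (4 * k) * B ^ k') := by
  rw [div_eq_mul_inv, Real.mul_rpow hA (inv_nonneg.2 hk.le), div_eq_mul_inv,
    Real.mul_rpow hB (inv_nonneg.2 hk'.le)]
  have h1 : (k⁻¹) ^ (4 * k) ≤ Real.exp (Real.exp (-1)) ^ 4 := by
    have := inv_rpow_mul_self_le hk 4
    norm_num at this ⊢
    exact this
  have h2 : (k'⁻¹) ^ k' ≤ Real.exp (Real.exp (-1)) ^ 1 := by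
    have := inv_rpow_mul_self_le hk' 1
    norm_num at this ⊢
    exact this
  have hAk : 0 ≤ A ^ (4 * k) := Real.rpow_nonneg hA _
  have hBk : 0 ≤ B ^ k' := Real.rpow_nonneg hB _
  have hE : 0 ≤ Real.exp (Real.exp (-1)) := (Real.exp_pos _).le
  calc A ^ (4 * k) * k⁻¹ ^ (4 * k) * (B ^ k' * k'⁻¹ ^ k')
      ≤ A ^ (4 * k) * Real.exp (Real.exp (-1)) ^ 4 * (B ^ k' * Real.exp (Real.exp (-1)) ^ 1) := by
        gcongr
    _ = Real.exp (Real.exp (-1)) ^ 5 * (A ^ (4 * k) * B ^ k') := by ring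

/-- `A^{4k} B^{1-k} ≤ (A⁴)^κ (A⁴ + B)^{1-κ}` for `0 < κ ≤ k ≤ 1`, `A, B ≥ 0`. [folklore] -/
theorem rpow_mul_rpow_le_of_le {A B k κ : ℝ} (hA : 0 ≤ A) (hB : 0 ≤ B) (hκ : 0 ≤ κ)
    (hκk : κ ≤ k) (hk1 : k ≤ 1) :
    A ^ (4 * k) * B ^ (1 - k) ≤ (A ^ 4) ^ κ * (A ^ 4 + B) ^ (1 - κ) := by
  have hA4 : 0 ≤ A ^ 4 := by positivity
  have hAB : A ^ 4 ≤ A ^ 4 + B := by linarith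
  have hB' : B ≤ A ^ 4 + B := by linarith
  have h1 : A ^ (4 * k) = (A ^ 4) ^ κ * (A ^ 4) ^ (k - κ) := by
    rw [← Real.rpow_add_of_nonneg hA4 hκ (by linarith), show κ + (k - κ) = k by ring,
      show (4 : ℝ) * k = ((4 : ℕ) : ℝ) * k by norm_num, Real.rpow_natCast_mul hA]
  rw [h1]
  calc (A ^ 4) ^ κ * (A ^ 4) ^ (k - κ) * B ^ (1 - k)
      ≤ (A ^ 4) ^ κ * (A ^ 4 + B) ^ (k - κ) * (A ^ 4 + B) ^ (1 - k) := by
        gcongr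
    _ = (A ^ 4) ^ κ * (A ^ 4 + B) ^ (1 - κ) := by
        rw [mul_assoc, ← Real.rpow_add_of_nonneg (by positivity) (by linarith) (by linarith)]
        ring_nf



/-! ### The boundary correspondence in coordinates

`Xc r a u = (r/π) log (1 - a u²)` is the abscissa of the cut point with boundary parameter `u`
(`a u² < 1`), `Xe r a u = (r/π) log (a u² - 1)` that of the edge point (`a u² > 1`); their
inverses on `u ≥ 0` are `Ucut r a x = √((1 - e^{πx/r})/a)` (`x < 0`) and
`Vedge r a x = √((1 + e^{πx/r})/a)`. -/

/-- Abscissa of the cut point with boundary parameter `u` (`a u² < 1`). [folklore] -/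
def Xc (r a u : ℝ) : ℝ := r / π * Real.log (1 - a * u ^ 2)

/-- Abscissa of the edge point with boundary parameter `u` (`a u² > 1`). [folklore] -/
def Xe (r a u : ℝ) : ℝ := r / π * Real.log (a * u ^ 2 - 1)

/-- Inverse of `Xc r a` on `u ≥ 0`. [folklore] -/
def Ucut (r a x : ℝ) : ℝ := Real.sqrt ((1 - Real.exp (π * x / r)) / a)

/-- Inverse of `Xe r a` on `u ≥ 0`. [folklore] -/
def Vedge (r a x : ℝ) : ℝ := Real.sqrt ((1 + Real.exp (π * x / r)) / a)

variable {r a : ℝ}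

/-- `Xc` is even in `u`. [folklore] -/
theorem Xc_neg (r a u : ℝ) : Xc r a (-u) = Xc r a u := by simp [Xc]

/-- `Xe` is even in `u`. [folklore] -/
theorem Xe_neg (r a u : ℝ) : Xe r a (-u) = Xe r a u := by simp [Xe]

/-- `e^{πx/r} < 1` for `x < 0 < r`. [folklore] -/
theorem exp_lt_one_of_neg (hr : 0 < r) {x : ℝ} (hx : x < 0) : Real.exp (π * x / r) < 1 := by
  rw [Real.exp_lt_one_iff]
  exact div_neg_of_neg_of_pos (mul_neg_of_pos_of_neg pi_pos hx) hr

/-- `Ucut ≥ 0`. [folklore] -/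
theorem Ucut_nonneg (r a x : ℝ) : 0 ≤ Ucut r a x := Real.sqrt_nonneg _

/-- `Vedge ≥ 0`. [folklore] -/
theorem Vedge_nonneg (r a x : ℝ) : 0 ≤ Vedge r a x := Real.sqrt_nonneg _

/-- `Ucut(x)² = (1 - e^{πx/r})/a` for `x < 0`. [folklore] -/
theorem Ucut_sq (hr : 0 < r) (ha : 0 < a) {x : ℝ} (hx : x < 0) :
    Ucut r a x ^ 2 = (1 - Real.exp (π * x / r)) / a := by
  rw [Ucut, Real.sq_sqrt]
  exact div_nonneg (by linarith [exp_lt_one_of_neg hr hx]) ha.le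

/-- `Vedge(x)² = (1 + e^{πx/r})/a`. [folklore] -/
theorem Vedge_sq (ha : 0 < a) (x : ℝ) :
    Vedge r a x ^ 2 = (1 + Real.exp (π * x / r)) / a := by
  rw [Vedge, Real.sq_sqrt]
  exact div_nonneg (by positivity) ha.le

/-- `Ucut(x) > 0` for `x < 0`. [folklore] -/
theorem Ucut_pos (hr : 0 < r) (ha : 0 < a) {x : ℝ} (hx : x < 0) : 0 < Ucut r a x := by
  rw [Ucut]; apply Real.sqrt_pos.2
  exact div_pos (by linarith [exp_lt_one_of_neg hr hx]) ha

/-- `Vedge(x) > 0`. [folklore] -/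
theorem Vedge_pos (ha : 0 < a) (x : ℝ) : 0 < Vedge r a x := by
  rw [Vedge]; apply Real.sqrt_pos.2; positivity

/-- `1 - a Ucut(x)² = e^{πx/r}`. [folklore] -/
theorem one_sub_mul_Ucut_sq (hr : 0 < r) (ha : 0 < a) {x : ℝ} (hx : x < 0) :
    1 - a * Ucut r a x ^ 2 = Real.exp (π * x / r) := by
  rw [Ucut_sq hr ha hx]; field_simp; ring

/-- `a Vedge(x)² - 1 = e^{πx/r}`. [folklore] -/
theorem mul_Vedge_sq_sub_one (ha : 0 < a) (x : ℝ) :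
    a * Vedge r a x ^ 2 - 1 = Real.exp (π * x / r) := by
  rw [Vedge_sq ha]; field_simp; ring

/-- `Xc ∘ Ucut = id` on `x < 0`. [folklore] -/
theorem Xc_Ucut (hr : 0 < r) (ha : 0 < a) {x : ℝ} (hx : x < 0) : Xc r a (Ucut r a x) = x := by
  rw [Xc, one_sub_mul_Ucut_sq hr ha hx, Real.log_exp]
  field_simp

/-- `Xe ∘ Vedge = id`. [folklore] -/
theorem Xe_Vedge (hr : 0 < r) (ha : 0 < a) (x : ℝ) : Xe r a (Vedge r a x) = x := by
  rw [Xe, mul_Vedge_sq_sub_one ha, Real.log_exp]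
  field_simp

/-- `e^{π Xc(u)/r} = 1 - a u²` for `a u² < 1`. [folklore] -/
theorem exp_Xc (hr : 0 < r) {u : ℝ} (hu : a * u ^ 2 < 1) :
    Real.exp (π * Xc r a u / r) = 1 - a * u ^ 2 := by
  rw [Xc, show π * (r / π * Real.log (1 - a * u ^ 2)) / r = Real.log (1 - a * u ^ 2) by
    field_simp, Real.exp_log (by linarith)]

/-- `e^{π Xe(u)/r} = a u² - 1` for `a u² > 1`. [folklore] -/
theorem exp_Xe (hr : 0 < r) {u : ℝ} (hu : 1 < a * u ^ 2) :
    Real.exp (π * Xe r a u / r) = a * u ^ 2 - 1 := by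
  rw [Xe, show π * (r / π * Real.log (a * u ^ 2 - 1)) / r = Real.log (a * u ^ 2 - 1) by
    field_simp, Real.exp_log (by linarith)]

/-- `Ucut (Xc u) = |u|` for `a u² < 1`. [folklore] -/
theorem Ucut_Xc (hr : 0 < r) (ha : 0 < a) {u : ℝ} (hu : a * u ^ 2 < 1) :
    Ucut r a (Xc r a u) = |u| := by
  rw [Ucut, exp_Xc hr hu, show (1 - (1 - a * u ^ 2)) / a = u ^ 2 by field_simp; ring,
    Real.sqrt_sq_eq_abs]

/-- `Vedge (Xe u) = |u|` for `a u² > 1`. [folklore] -/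
theorem Vedge_Xe (hr : 0 < r) (ha : 0 < a) {u : ℝ} (hu : 1 < a * u ^ 2) :
    Vedge r a (Xe r a u) = |u| := by
  rw [Vedge, exp_Xe hr hu, show (1 + (a * u ^ 2 - 1)) / a = u ^ 2 by field_simp; ring,
    Real.sqrt_sq_eq_abs]

/-- `Xc u ≤ 0` for `a u² < 1`. [folklore] -/
theorem Xc_nonpos (hr : 0 < r) (ha : 0 ≤ a) {u : ℝ} (hu : a * u ^ 2 < 1) : Xc r a u ≤ 0 := by
  rw [Xc]
  refine mul_nonpos_of_nonneg_of_nonpos (by positivity) (Real.log_nonpos (by linarith) ?_)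
  nlinarith [sq_nonneg u]

/-- `Xc u < 0` for `a u² < 1`, `u ≠ 0`. [folklore] -/
theorem Xc_lt_zero (hr : 0 < r) (ha : 0 < a) {u : ℝ} (hu : a * u ^ 2 < 1) (hu0 : u ≠ 0) :
    Xc r a u < 0 := by
  rw [Xc]
  refine mul_neg_of_pos_of_neg (by positivity) (Real.log_neg (by linarith) ?_)
  have : 0 < a * u ^ 2 := by positivity
  linarith

/-! #### Derivatives and injectivity -/

/-- Derivative of `x ↦ e^{πx/r}`. [folklore] -/
theorem hasDerivAt_exp_mul_div (r x : ℝ) :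
    HasDerivAt (fun x => Real.exp (π * x / r)) (π / r * Real.exp (π * x / r)) x := by
  have h1 : HasDerivAt (fun x => π * x / r) (π / r) x := by
    have := ((hasDerivAt_id x).const_mul π).div_const r
    simpa using this
  convert h1.exp using 1; ring

/-- Derivative of `Ucut` on `x < 0`. [folklore] -/
theorem hasDerivAt_Ucut (hr : 0 < r) (ha : 0 < a) {x : ℝ} (hx : x < 0) :
    HasDerivAt (Ucut r a) (-(π / r * Real.exp (π * x / r) / a) / (2 * Ucut r a x)) x := by
  have hg : HasDerivAt (fun x => (1 - Real.exp (π * x / r)) / a)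
      (-(π / r * Real.exp (π * x / r)) / a) x :=
    ((hasDerivAt_exp_mul_div r x).const_sub 1).div_const a
  have hne : (1 - Real.exp (π * x / r)) / a ≠ 0 :=
    (div_pos (by linarith [exp_lt_one_of_neg hr hx]) ha).ne'
  have := hg.sqrt hne
  have e : Ucut r a = fun y => Real.sqrt ((1 - Real.exp (π * y / r)) / a) := rfl
  rw [e]
  convert this using 1
  simp only [neg_div]

/-- Derivative of `Vedge`. [folklore] -/
theorem hasDerivAt_Vedge (ha : 0 < a) (x : ℝ) :
    HasDerivAt (Vedge r a) ((π / r * Real.exp (π * x / r) / a) / (2 * Vedge r a x)) x := by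
  have hg : HasDerivAt (fun x => (1 + Real.exp (π * x / r)) / a)
      ((π / r * Real.exp (π * x / r)) / a) x := by
    have := ((hasDerivAt_exp_mul_div r x).const_add 1).div_const a
    simpa using this
  have hne : (1 + Real.exp (π * x / r)) / a ≠ 0 := (div_pos (by positivity) ha).ne'
  have := hg.sqrt hne
  have e : Vedge r a = fun y => Real.sqrt ((1 + Real.exp (π * y / r)) / a) := rfl
  rw [e]
  exact this

/-- Derivative of `Xc` where `a u² < 1`. [folklore] -/
theorem hasDerivAt_Xc (r : ℝ) {a u : ℝ} (hu : a * u ^ 2 < 1) :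
    HasDerivAt (Xc r a) (r / π * (-(2 * a * u) / (1 - a * u ^ 2))) u := by
  have hg : HasDerivAt (fun u => 1 - a * u ^ 2) (-(2 * a * u)) u := by
    have h1 : HasDerivAt (fun u : ℝ => u ^ 2) (2 * u) u := by simpa using hasDerivAt_pow 2 u
    have h2 : HasDerivAt (fun u : ℝ => 1 - a * u ^ 2) (0 - a * (2 * u)) u :=
      (hasDerivAt_const u 1).sub (h1.const_mul a)
    rwa [show (0 : ℝ) - a * (2 * u) = -(2 * a * u) by ring] at h2
  have := (hg.log (by linarith)).const_mul (r / π)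
  have e : Xc r a = fun y => r / π * Real.log (1 - a * y ^ 2) := rfl
  rw [e]
  convert this using 1

/-- `Ucut` is injective on `x < 0`. [folklore] -/
theorem injOn_Ucut (hr : 0 < r) (ha : 0 < a) : InjOn (Ucut r a) (Iio 0) := by
  intro x hx y hy h
  have := congrArg (Xc r a) h
  rwa [Xc_Ucut hr ha hx, Xc_Ucut hr ha hy] at this

/-- `-Ucut` is injective on `x < 0`. [folklore] -/
theorem injOn_neg_Ucut (hr : 0 < r) (ha : 0 < a) : InjOn (fun x => -Ucut r a x) (Iio 0) :=
  fun _ hx _ hy h => injOn_Ucut hr ha hx hy (neg_injective h)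

/-- `Vedge` is injective. [folklore] -/
theorem injective_Vedge (hr : 0 < r) (ha : 0 < a) : Function.Injective (Vedge r a) := by
  intro x y h
  have := congrArg (Xe r a) h
  rwa [Xe_Vedge hr ha, Xe_Vedge hr ha] at this

/-- `-Vedge` is injective. [folklore] -/
theorem injective_neg_Vedge (hr : 0 < r) (ha : 0 < a) :
    Function.Injective (fun x => -Vedge r a x) := fun _ _ h =>
  injective_Vedge hr ha (neg_injective h)

/-- `Xc` is injective on `{u > 0, a u² < 1}`. [folklore] -/
theorem injOn_Xc_pos (hr : 0 < r) (ha : 0 < a) : InjOn (Xc r a) {u | 0 < u ∧ a * u ^ 2 < 1} := by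
  intro x hx y hy h
  have := congrArg (Ucut r a) h
  rwa [Ucut_Xc hr ha hx.2, Ucut_Xc hr ha hy.2, abs_of_pos hx.1, abs_of_pos hy.1] at this

/-- `Xc` is injective on `{u < 0, a u² < 1}`. [folklore] -/
theorem injOn_Xc_neg (hr : 0 < r) (ha : 0 < a) : InjOn (Xc r a) {u | u < 0 ∧ a * u ^ 2 < 1} := by
  intro x hx y hy h
  have := congrArg (Ucut r a) h
  rw [Ucut_Xc hr ha hx.2, Ucut_Xc hr ha hy.2, abs_of_neg hx.1, abs_of_neg hy.1] at this
  linarith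

/-! #### Images -/

/-- `a u² < 1 ↔ |u| < 1/√a` (`a > 0`). [folklore] -/
theorem sq_lt_inv_iff (ha : 0 < a) {u : ℝ} : a * u ^ 2 < 1 ↔ |u| < Real.sqrt a⁻¹ := by
  rw [← Real.sqrt_sq_eq_abs, Real.sqrt_lt_sqrt_iff (sq_nonneg _), inv_eq_one_div,
    lt_div_iff₀ ha, mul_comm]

/-- `1 < a u² ↔ 1/√a < |u|` (`a > 0`). [folklore] -/
theorem one_lt_sq_iff (ha : 0 < a) {u : ℝ} : 1 < a * u ^ 2 ↔ Real.sqrt a⁻¹ < |u| := by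
  rw [← Real.sqrt_sq_eq_abs, Real.sqrt_lt_sqrt_iff (inv_nonneg.2 ha.le), inv_lt_iff_one_lt_mul₀ ha]
  rw [mul_comm]

/-- `[U(-ℓ), 1/√a) ⊆ U(( -∞, -ℓ ])`. [folklore] -/
theorem Ico_subset_image_Ucut (hr : 0 < r) (ha : 0 < a) {ℓ : ℝ} (hℓ : 0 < ℓ) :
    Ico (Ucut r a (-ℓ)) (Real.sqrt a⁻¹) ⊆ Ucut r a '' Iic (-ℓ) := by
  intro u ⟨h1, h2⟩
  have hu0 : 0 ≤ u := (Ucut_nonneg r a _).trans h1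
  have hu1 : a * u ^ 2 < 1 := (sq_lt_inv_iff ha).2 (by rwa [abs_of_nonneg hu0])
  refine ⟨Xc r a u, ?_, by rw [Ucut_Xc hr ha hu1, abs_of_nonneg hu0]⟩
  -- `Xc u ≤ -ℓ` iff `1 - a u² ≤ e^{-πℓ/r}` iff `u ≥ U(-ℓ)`
  simp only [mem_Iic, Xc]
  have hπr : 0 < r / π := by positivity
  rw [← le_div_iff₀' hπr, Real.log_le_iff_le_exp (by linarith)]
  have h3 : Ucut r a (-ℓ) ^ 2 ≤ u ^ 2 := pow_le_pow_left₀ (Ucut_nonneg _ _ _) h1 2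
  rw [Ucut_sq hr ha (by linarith), div_le_iff₀ ha] at h3
  have : π * -ℓ / r = -ℓ / (r / π) := by field_simp
  rw [this] at h3
  linarith

/-- `(-1/√a, -U(-ℓ)] ⊆ (-U)((-∞, -ℓ])`. [folklore] -/
theorem Ioc_subset_image_neg_Ucut (hr : 0 < r) (ha : 0 < a) {ℓ : ℝ} (hℓ : 0 < ℓ) :
    Ioc (-Real.sqrt a⁻¹) (-Ucut r a (-ℓ)) ⊆ (fun x => -Ucut r a x) '' Iic (-ℓ) := by
  intro u ⟨h1, h2⟩
  have hmem : -u ∈ Ico (Ucut r a (-ℓ)) (Real.sqrt a⁻¹) := ⟨by linarith, by linarith⟩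
  obtain ⟨x, hx, hxu⟩ := Ico_subset_image_Ucut hr ha hℓ hmem
  exact ⟨x, hx, by simp only [hxu]; ring⟩

/-- `(1/√a, ∞) ⊆ range Vedge`. [folklore] -/
theorem Ioi_subset_range_Vedge (hr : 0 < r) (ha : 0 < a) :
    Ioi (Real.sqrt a⁻¹) ⊆ range (Vedge r a) := by
  intro u hu
  have hu0 : 0 < u := (Real.sqrt_nonneg _).trans_lt hu
  have hu1 : 1 < a * u ^ 2 := (one_lt_sq_iff ha).2 (by rwa [abs_of_pos hu0])
  exact ⟨Xe r a u, by rw [Vedge_Xe hr ha hu1, abs_of_pos hu0]⟩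

/-- `(-∞, -1/√a) ⊆ range (-Vedge)`. [folklore] -/
theorem Iio_subset_range_neg_Vedge (hr : 0 < r) (ha : 0 < a) :
    Iio (-Real.sqrt a⁻¹) ⊆ range (fun x => -Vedge r a x) := by
  intro u hu
  obtain ⟨x, hx⟩ := Ioi_subset_range_Vedge hr ha (show Real.sqrt a⁻¹ < -u by rw [mem_Iio] at hu; linarith)
  exact ⟨x, by simp only [hx]; ring⟩

/-- `a U(-ℓ)² = 1 - e^{-πℓ/r}`. [folklore] -/
theorem mul_Ucut_neg_sq (hr : 0 < r) (ha : 0 < a) {ℓ : ℝ} (hℓ : 0 < ℓ) :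
    a * Ucut r a (-ℓ) ^ 2 = 1 - Real.exp (-(π * ℓ / r)) := by
  rw [Ucut_sq hr ha (by linarith)]; field_simp

/-- `Xc u ∈ [-ℓ, 0]` when `|u| < U(-ℓ)`. [folklore] -/
theorem Xc_mem_Icc (hr : 0 < r) (ha : 0 < a) {ℓ : ℝ} (hℓ : 0 < ℓ) {u : ℝ}
    (hu : |u| < Ucut r a (-ℓ)) : Xc r a u ∈ Icc (-ℓ) 0 := by
  have h1 : a * u ^ 2 < a * Ucut r a (-ℓ) ^ 2 := by
    have : u ^ 2 < Ucut r a (-ℓ) ^ 2 := by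
      rw [← sq_abs u]; exact pow_lt_pow_left₀ hu (abs_nonneg u) two_ne_zero
    exact mul_lt_mul_of_pos_left this ha
  rw [mul_Ucut_neg_sq hr ha hℓ] at h1
  have hexp : 0 < Real.exp (-(π * ℓ / r)) := Real.exp_pos _
  have hu1 : a * u ^ 2 < 1 := by linarith
  refine ⟨?_, Xc_nonpos hr ha.le hu1⟩
  rw [Xc]
  have hπr : 0 < r / π := by positivity
  have : -ℓ = r / π * (-(π * ℓ / r)) := by field_simp
  rw [this]
  refine mul_le_mul_of_nonneg_left ?_ hπr.le
  rw [Real.le_log_iff_exp_le (by linarith)]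
  linarith

/-- `Xc((0, U(-ℓ))) ⊆ [-ℓ, 0]`. [folklore] -/
theorem image_Xc_Ioo_subset (hr : 0 < r) (ha : 0 < a) {ℓ : ℝ} (hℓ : 0 < ℓ) :
    Xc r a '' Ioo 0 (Ucut r a (-ℓ)) ⊆ Icc (-ℓ) 0 := by
  rintro _ ⟨u, ⟨hu0, hu1⟩, rfl⟩
  exact Xc_mem_Icc hr ha hℓ (by rwa [abs_of_pos hu0])

/-- `Xc((-U(-ℓ), 0)) ⊆ [-ℓ, 0]`. [folklore] -/
theorem image_Xc_Ioo_neg_subset (hr : 0 < r) (ha : 0 < a) {ℓ : ℝ} (hℓ : 0 < ℓ) :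
    Xc r a '' Ioo (-Ucut r a (-ℓ)) 0 ⊆ Icc (-ℓ) 0 := by
  rintro _ ⟨u, ⟨hu0, hu1⟩, rfl⟩
  exact Xc_mem_Icc hr ha hℓ (by rw [abs_of_neg hu1]; linarith)


/-! ### Substitution inequalities (Lebesgue integrals) -/

open scoped ENNReal

/-- The Poisson density of the upper half-plane at `i`, on the boundary line. [folklore] -/
def pfun (u : ℝ) : ℝ := π⁻¹ * (1 + u ^ 2)⁻¹

/-- The Poisson density is positive. [folklore] -/
theorem pfun_pos (u : ℝ) : 0 < pfun u := by unfold pfun; positivity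

/-- The Poisson density is even. [folklore] -/
theorem pfun_neg (u : ℝ) : pfun (-u) = pfun u := by simp [pfun]

/-- The Poisson density is at most `1/π`. [folklore] -/
theorem pfun_le (u : ℝ) : pfun u ≤ π⁻¹ := by
  unfold pfun
  refine mul_le_of_le_one_right (by positivity) ?_
  exact inv_le_one_of_one_le₀ (by nlinarith [sq_nonneg u])

/-- The Poisson density is measurable. [folklore] -/
theorem measurable_pfun : Measurable pfun := by unfold pfun; fun_prop

/-- Derivative of `Xc r a`. [folklore] -/
def XcD (r a u : ℝ) : ℝ := r / π * (-(2 * a * u) / (1 - a * u ^ 2))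
/-- Derivative of `Ucut r a`. [folklore] -/
def UD (r a x : ℝ) : ℝ := -(π / r * Real.exp (π * x / r) / a) / (2 * Ucut r a x)
/-- Derivative of `Vedge r a`. [folklore] -/
def VD (r a x : ℝ) : ℝ := (π / r * Real.exp (π * x / r) / a) / (2 * Vedge r a x)

/-- If `T ⊆ f '' s` with `f` injective and differentiable on the measurable set `s`, then
`∫⁻_T ψ ≤ ∫⁻_s |f'| · ψ ∘ f`. [folklore] -/
theorem lintegral_le_of_subset_image {f f' : ℝ → ℝ} {s T : Set ℝ} (hs : MeasurableSet s)
    (hf' : ∀ x ∈ s, HasDerivWithinAt f (f' x) s x) (hf : InjOn f s) (hT : T ⊆ f '' s)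
    (ψ : ℝ → ℝ≥0∞) : ∫⁻ u in T, ψ u ≤ ∫⁻ x in s, ENNReal.ofReal |f' x| * ψ (f x) := by
  calc ∫⁻ u in T, ψ u ≤ ∫⁻ u in f '' s, ψ u := lintegral_mono_set hT
    _ = _ := lintegral_image_eq_lintegral_abs_deriv_mul hs hf' hf ψ

/-- **Edge piece, `u > 1/√a`.** [folklore] -/
theorem lintegral_edge_le (hr : 0 < r) (ha : 0 < a) (Φ : ℝ → ℝ≥0∞) :
    ∫⁻ u in Ioi (Real.sqrt a⁻¹), ENNReal.ofReal (pfun u) * Φ (Xe r a u) ≤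
      ∫⁻ x, ENNReal.ofReal (|VD r a x| * pfun (Vedge r a x)) * Φ x := by
  have h := lintegral_le_of_subset_image (T := Ioi (Real.sqrt a⁻¹)) MeasurableSet.univ
    (fun x _ => (hasDerivAt_Vedge (r := r) ha x).hasDerivWithinAt) (injective_Vedge hr ha).injOn
    (fun u hu => by rw [image_univ]; exact Ioi_subset_range_Vedge hr ha hu)
    (fun u => ENNReal.ofReal (pfun u) * Φ (Xe r a u))
  rw [Measure.restrict_univ] at h
  refine h.trans (le_of_eq (lintegral_congr fun x => ?_))
  rw [Xe_Vedge hr ha, ENNReal.ofReal_mul (abs_nonneg _), mul_assoc]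
  rfl

/-- **Edge piece, `u < -1/√a`.** [folklore] -/
theorem lintegral_edge_neg_le (hr : 0 < r) (ha : 0 < a) (Φ : ℝ → ℝ≥0∞) :
    ∫⁻ u in Iio (-Real.sqrt a⁻¹), ENNReal.ofReal (pfun u) * Φ (Xe r a u) ≤
      ∫⁻ x, ENNReal.ofReal (|VD r a x| * pfun (Vedge r a x)) * Φ x := by
  have h := lintegral_le_of_subset_image (T := Iio (-Real.sqrt a⁻¹)) MeasurableSet.univ
    (fun x _ => ((hasDerivAt_Vedge (r := r) ha x).neg).hasDerivWithinAt)
    (injective_neg_Vedge hr ha).injOn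
    (fun u hu => by rw [image_univ]; exact Iio_subset_range_neg_Vedge hr ha hu)
    (fun u => ENNReal.ofReal (pfun u) * Φ (Xe r a u))
  rw [Measure.restrict_univ] at h
  refine h.trans (le_of_eq (lintegral_congr fun x => ?_))
  simp only [Pi.neg_apply, Xe_neg, Xe_Vedge hr ha, pfun_neg, abs_neg]
  rw [ENNReal.ofReal_mul (abs_nonneg _), mul_assoc]
  rfl

/-- **Far part of the cut, `U(-ℓ) ≤ u < 1/√a`.** [folklore] -/
theorem lintegral_farcut_le (hr : 0 < r) (ha : 0 < a) {ℓ : ℝ} (hℓ : 0 < ℓ) (Φ : ℝ → ℝ≥0∞) :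
    ∫⁻ u in Ico (Ucut r a (-ℓ)) (Real.sqrt a⁻¹), ENNReal.ofReal (pfun u) * Φ (Xc r a u) ≤
      ∫⁻ x in Iic (-ℓ), ENNReal.ofReal (|UD r a x| * pfun (Ucut r a x)) * Φ x := by
  have hsub : Iic (-ℓ) ⊆ Iio (0 : ℝ) := fun x hx => lt_of_le_of_lt (mem_Iic.1 hx) (neg_lt_zero.2 hℓ)
  have h := lintegral_le_of_subset_image measurableSet_Iic
    (fun x hx => (hasDerivAt_Ucut hr ha (hsub hx)).hasDerivWithinAt)
    ((injOn_Ucut hr ha).mono hsub) (Ico_subset_image_Ucut hr ha hℓ)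
    (fun u => ENNReal.ofReal (pfun u) * Φ (Xc r a u))
  refine h.trans (le_of_eq (setLIntegral_congr_fun measurableSet_Iic fun x hx => ?_))
  rw [Xc_Ucut hr ha (hsub hx), ENNReal.ofReal_mul (abs_nonneg _), mul_assoc]
  rfl

/-- **Far part of the cut, `-1/√a < u ≤ -U(-ℓ)`.** [folklore] -/
theorem lintegral_farcut_neg_le (hr : 0 < r) (ha : 0 < a) {ℓ : ℝ} (hℓ : 0 < ℓ) (Φ : ℝ → ℝ≥0∞) :
    ∫⁻ u in Ioc (-Real.sqrt a⁻¹) (-Ucut r a (-ℓ)), ENNReal.ofReal (pfun u) * Φ (Xc r a u) ≤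
      ∫⁻ x in Iic (-ℓ), ENNReal.ofReal (|UD r a x| * pfun (Ucut r a x)) * Φ x := by
  have hsub : Iic (-ℓ) ⊆ Iio (0 : ℝ) := fun x hx => lt_of_le_of_lt (mem_Iic.1 hx) (neg_lt_zero.2 hℓ)
  have h := lintegral_le_of_subset_image measurableSet_Iic
    (fun x hx => ((hasDerivAt_Ucut hr ha (hsub hx)).neg).hasDerivWithinAt)
    ((injOn_neg_Ucut hr ha).mono hsub) (Ioc_subset_image_neg_Ucut hr ha hℓ)
    (fun u => ENNReal.ofReal (pfun u) * Φ (Xc r a u))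
  refine h.trans (le_of_eq (setLIntegral_congr_fun measurableSet_Iic fun x hx => ?_))
  simp only [Pi.neg_apply, Xc_neg, Xc_Ucut hr ha (hsub hx), pfun_neg, abs_neg]
  rw [ENNReal.ofReal_mul (abs_nonneg _), mul_assoc]
  rfl

/-- **Near part of the cut, `0 < u < U(-ℓ)`:** `∫⁻ |Xc'| Φ ∘ Xc ≤ ∫⁻_{[-ℓ,0]} Φ`. [folklore] -/
theorem lintegral_nearcut_le (hr : 0 < r) (ha : 0 < a) {ℓ : ℝ} (hℓ : 0 < ℓ) (Φ : ℝ → ℝ≥0∞) :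
    ∫⁻ u in Ioo 0 (Ucut r a (-ℓ)), ENNReal.ofReal |XcD r a u| * Φ (Xc r a u) ≤
      ∫⁻ x in Icc (-ℓ) 0, Φ x := by
  have hlt1 : ∀ u ∈ Ioo 0 (Ucut r a (-ℓ)), a * u ^ 2 < 1 := by
    intro u ⟨hu0, hu1⟩
    have h1 : a * u ^ 2 < a * Ucut r a (-ℓ) ^ 2 :=
      mul_lt_mul_of_pos_left (pow_lt_pow_left₀ hu1 hu0.le two_ne_zero) ha
    rw [mul_Ucut_neg_sq hr ha hℓ] at h1
    linarith [Real.exp_pos (-(π * ℓ / r))]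
  have hsub : Ioo 0 (Ucut r a (-ℓ)) ⊆ {u | 0 < u ∧ a * u ^ 2 < 1} := fun u hu => ⟨hu.1, hlt1 u hu⟩
  have hD : ∀ u ∈ Ioo 0 (Ucut r a (-ℓ)), HasDerivWithinAt (Xc r a) (XcD r a u) (Ioo 0 (Ucut r a (-ℓ))) u :=
    fun u hu => (hasDerivAt_Xc r (hlt1 u hu)).hasDerivWithinAt
  rw [← lintegral_image_eq_lintegral_abs_deriv_mul measurableSet_Ioo hD ((injOn_Xc_pos hr ha).mono hsub) Φ]
  exact lintegral_mono_set (image_Xc_Ioo_subset hr ha hℓ)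

/-- **Near part of the cut, `-U(-ℓ) < u < 0`:** `∫⁻ |Xc'| Φ ∘ Xc ≤ ∫⁻_{[-ℓ,0]} Φ`. [folklore] -/
theorem lintegral_nearcut_neg_le (hr : 0 < r) (ha : 0 < a) {ℓ : ℝ} (hℓ : 0 < ℓ) (Φ : ℝ → ℝ≥0∞) :
    ∫⁻ u in Ioo (-Ucut r a (-ℓ)) 0, ENNReal.ofReal |XcD r a u| * Φ (Xc r a u) ≤
      ∫⁻ x in Icc (-ℓ) 0, Φ x := by
  have hlt1 : ∀ u ∈ Ioo (-Ucut r a (-ℓ)) 0, a * u ^ 2 < 1 := by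
    intro u ⟨hu0, hu1⟩
    have h1 : a * u ^ 2 < a * Ucut r a (-ℓ) ^ 2 := by
      refine mul_lt_mul_of_pos_left ?_ ha
      have : u ^ 2 = (-u) ^ 2 := by ring
      rw [this]
      exact pow_lt_pow_left₀ (by linarith) (by linarith) two_ne_zero
    rw [mul_Ucut_neg_sq hr ha hℓ] at h1
    linarith [Real.exp_pos (-(π * ℓ / r))]
  have hsub : Ioo (-Ucut r a (-ℓ)) 0 ⊆ {u | u < 0 ∧ a * u ^ 2 < 1} := fun u hu => ⟨hu.2, hlt1 u hu⟩
  have hD : ∀ u ∈ Ioo (-Ucut r a (-ℓ)) 0, HasDerivWithinAt (Xc r a) (XcD r a u) (Ioo (-Ucut r a (-ℓ)) 0) u :=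
    fun u hu => (hasDerivAt_Xc r (hlt1 u hu)).hasDerivWithinAt
  rw [← lintegral_image_eq_lintegral_abs_deriv_mul measurableSet_Ioo hD ((injOn_Xc_neg hr ha).mono hsub) Φ]
  exact lintegral_mono_set (image_Xc_Ioo_neg_subset hr ha hℓ)


/-! #### The near part of the cut: Hölder with exponents `4` and `4/3` -/

/-- `|Xc'(u)| ≥ (2ra/π) u > 0` for `0 < u`, `a u² < 1`. [folklore] -/
theorem abs_XcD_ge (hr : 0 < r) (ha : 0 < a) {u : ℝ} (hu0 : 0 < u) (hu1 : a * u ^ 2 < 1) :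
    2 * r * a / π * u ≤ |XcD r a u| ∧ 0 < |XcD r a u| := by
  have hpos : 0 < 2 * r * a / π * u := by positivity
  have h1 : XcD r a u = -(2 * r * a / π * u / (1 - a * u ^ 2)) := by
    rw [XcD]; field_simp
  have h2 : 0 < 1 - a * u ^ 2 := by linarith
  have h3 : 1 - a * u ^ 2 ≤ 1 := by nlinarith [sq_nonneg u]
  rw [h1, abs_neg, abs_of_pos (div_pos hpos h2)]
  refine ⟨?_, div_pos hpos h2⟩
  rw [le_div_iff₀ h2]
  nlinarith

/-- `Xc` is measurable. [folklore] -/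
theorem measurable_Xc (r a : ℝ) : Measurable (Xc r a) := by
  unfold Xc; fun_prop

/-- `Xc'` is measurable. [folklore] -/
theorem measurable_XcD (r a : ℝ) : Measurable (XcD r a) := by
  unfold XcD; fun_prop

/-- `∫⁻_{(0,U)} (c u)^{-1/3} du = c^{-1/3} (3/2) U^{2/3}`. [folklore] -/
theorem lintegral_rpow_neg_third (c U : ℝ) (hc : 0 < c) (hU : 0 ≤ U) :
    ∫⁻ u in Ioo 0 U, ENNReal.ofReal ((c * u) ^ (-(1 / 3) : ℝ)) =
      ENNReal.ofReal (c ^ (-(1 / 3) : ℝ) * (3 / 2 * U ^ (2 / 3 : ℝ))) := by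
  have hint : IntegrableOn (fun u : ℝ => u ^ (-(1 / 3) : ℝ)) (Ioo 0 U) := by
    have := (intervalIntegral.intervalIntegrable_rpow' (a := 0) (b := U)
      (show (-1 : ℝ) < -(1 / 3) by norm_num)).1
    exact this.mono_set Ioo_subset_Ioc_self
  have hint2 : IntegrableOn (fun u : ℝ => c ^ (-(1 / 3) : ℝ) * u ^ (-(1 / 3) : ℝ)) (Ioo 0 U) :=
    hint.const_mul _
  have heq : ∀ u ∈ Ioo 0 U, (c * u) ^ (-(1 / 3) : ℝ) = c ^ (-(1 / 3) : ℝ) * u ^ (-(1 / 3) : ℝ) :=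
    fun u hu => Real.mul_rpow hc.le hu.1.le
  rw [← ofReal_integral_eq_lintegral_ofReal]
  · congr 1
    rw [setIntegral_congr_fun measurableSet_Ioo heq, integral_const_mul, ← integral_Ioc_eq_integral_Ioo,
      ← intervalIntegral.integral_of_le hU, integral_rpow (Or.inl (by norm_num))]
    rw [Real.zero_rpow (by norm_num)]
    norm_num
    left; ring
  · exact hint2.congr_fun (fun u hu => (heq u hu).symm) measurableSet_Ioo
  · filter_upwards [ae_restrict_mem measurableSet_Ioo] with u hu
    exact Real.rpow_nonneg (mul_nonneg hc.le hu.1.le) _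

/-- **Near part of the cut, Hölder step.** For measurable `Φ ≥ 0`:
`∫⁻_{(0,U(-ℓ))} Φ(Xc u)^{1/4} du ≤ (∫⁻_{[-ℓ,0]} Φ)^{1/4} · K^{3/4}` with
`K = (2ra/π)^{-1/3} (3/2) U(-ℓ)^{2/3}`. [folklore] -/
theorem lintegral_rpow_quarter_le (hr : 0 < r) (ha : 0 < a) {ℓ : ℝ} (hℓ : 0 < ℓ) {Φ : ℝ → ℝ≥0∞}
    (hΦ : Measurable Φ) :
    ∫⁻ u in Ioo 0 (Ucut r a (-ℓ)), Φ (Xc r a u) ^ (1 / 4 : ℝ) ≤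
      (∫⁻ x in Icc (-ℓ) 0, Φ x) ^ (1 / 4 : ℝ) *
        ENNReal.ofReal ((2 * r * a / π) ^ (-(1 / 3) : ℝ) *
          (3 / 2 * Ucut r a (-ℓ) ^ (2 / 3 : ℝ))) ^ (3 / 4 : ℝ) := by
  set U := Ucut r a (-ℓ) with hUdef
  have hlt1 : ∀ u ∈ Ioo 0 U, a * u ^ 2 < 1 := by
    intro u ⟨hu0, hu1⟩
    have h1 : a * u ^ 2 < a * U ^ 2 :=
      mul_lt_mul_of_pos_left (pow_lt_pow_left₀ hu1 hu0.le two_ne_zero) ha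
    rw [hUdef, mul_Ucut_neg_sq hr ha hℓ] at h1
    linarith [Real.exp_pos (-(π * ℓ / r))]
  -- the two Hölder factors
  set f : ℝ → ℝ≥0∞ := fun u => ENNReal.ofReal (|XcD r a u| ^ (1 / 4 : ℝ)) * Φ (Xc r a u) ^ (1 / 4 : ℝ)
    with hfdef
  set g : ℝ → ℝ≥0∞ := fun u => ENNReal.ofReal (|XcD r a u| ^ (-(1 / 4) : ℝ)) with hgdef
  have hf : AEMeasurable f (volume.restrict (Ioo 0 U)) := by
    refine Measurable.aemeasurable ?_
    simp only [hfdef]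
    exact (((measurable_XcD r a).norm).pow_const _).ennreal_ofReal.mul
      ((hΦ.comp (measurable_Xc r a)).pow_const _)
  have hg : AEMeasurable g (volume.restrict (Ioo 0 U)) := by
    refine Measurable.aemeasurable ?_
    simp only [hgdef]
    exact (((measurable_XcD r a).norm).pow_const _).ennreal_ofReal
  have hpq : (4 : ℝ).HolderConjugate (4 / 3) := Real.holderConjugate_iff.2 ⟨by norm_num, by norm_num⟩
  have hH := ENNReal.lintegral_mul_le_Lp_mul_Lq (volume.restrict (Ioo 0 U)) hpq hf hg
  -- identify `f * g` with the integrand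
  have hfg : ∀ u ∈ Ioo 0 U, (f * g) u = Φ (Xc r a u) ^ (1 / 4 : ℝ) := by
    intro u hu
    have hX := (abs_XcD_ge hr ha hu.1 (hlt1 u hu)).2
    simp only [Pi.mul_apply, hfdef, hgdef]
    rw [mul_comm, ← mul_assoc, ← ENNReal.ofReal_mul (Real.rpow_nonneg (abs_nonneg _) _),
      ← Real.rpow_add hX]
    norm_num
  -- identify `f ^ 4`
  have hf4 : ∀ u ∈ Ioo 0 U, f u ^ (4 : ℝ) = ENNReal.ofReal |XcD r a u| * Φ (Xc r a u) := by
    intro u _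
    simp only [hfdef]
    rw [ENNReal.mul_rpow_of_nonneg _ _ (by norm_num), ← ENNReal.rpow_mul,
      ENNReal.ofReal_rpow_of_nonneg (Real.rpow_nonneg (abs_nonneg _) _) (by norm_num),
      ← Real.rpow_mul (abs_nonneg _)]
    norm_num
  -- identify `g ^ (4/3)`
  have hg43 : ∀ u ∈ Ioo 0 U, g u ^ (4 / 3 : ℝ) = ENNReal.ofReal (|XcD r a u| ^ (-(1 / 3) : ℝ)) := by
    intro u _
    simp only [hgdef]
    rw [ENNReal.ofReal_rpow_of_nonneg (Real.rpow_nonneg (abs_nonneg _) _) (by norm_num),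
      ← Real.rpow_mul (abs_nonneg _)]
    norm_num
  -- bound `∫⁻ g^(4/3)`
  have hgint : ∫⁻ u in Ioo 0 U, g u ^ (4 / 3 : ℝ) ≤
      ENNReal.ofReal ((2 * r * a / π) ^ (-(1 / 3) : ℝ) * (3 / 2 * U ^ (2 / 3 : ℝ))) := by
    rw [setLIntegral_congr_fun measurableSet_Ioo hg43,
      ← lintegral_rpow_neg_third _ _ (by positivity) (Ucut_nonneg _ _ _)]
    refine setLIntegral_mono' measurableSet_Ioo fun u hu => ENNReal.ofReal_le_ofReal ?_
    have hX := abs_XcD_ge hr ha hu.1 (hlt1 u hu)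
    exact Real.rpow_le_rpow_of_nonpos (by have := hu.1; positivity) hX.1 (by norm_num)
  -- bound `∫⁻ f^4`
  have hfint : ∫⁻ u in Ioo 0 U, f u ^ (4 : ℝ) ≤ ∫⁻ x in Icc (-ℓ) 0, Φ x := by
    rw [setLIntegral_congr_fun measurableSet_Ioo hf4]
    exact lintegral_nearcut_le hr ha hℓ Φ
  calc ∫⁻ u in Ioo 0 U, Φ (Xc r a u) ^ (1 / 4 : ℝ)
      = ∫⁻ u in Ioo 0 U, (f * g) u := (setLIntegral_congr_fun measurableSet_Ioo hfg).symm
    _ ≤ (∫⁻ u in Ioo 0 U, f u ^ (4 : ℝ)) ^ (1 / 4 : ℝ) *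
          (∫⁻ u in Ioo 0 U, g u ^ (4 / 3 : ℝ)) ^ (1 / (4 / 3) : ℝ) := hH
    _ ≤ (∫⁻ x in Icc (-ℓ) 0, Φ x) ^ (1 / 4 : ℝ) *
          ENNReal.ofReal ((2 * r * a / π) ^ (-(1 / 3) : ℝ) * (3 / 2 * U ^ (2 / 3 : ℝ))) ^ (3 / 4 : ℝ) := by
        rw [show (1 / (4 / 3) : ℝ) = 3 / 4 by norm_num]
        gcongr


/-- Reflection `u ↦ -u` for set integrals over `(-U, 0)`. [folklore] -/
theorem setLIntegral_Ioo_neg (U : ℝ) (ψ : ℝ → ℝ≥0∞) :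
    ∫⁻ u in Ioo (-U) 0, ψ u = ∫⁻ u in Ioo 0 U, ψ (-u) := by
  have himg : (fun x : ℝ => -x) '' Ioo 0 U = Ioo (-U) 0 := by
    have : (fun x : ℝ => -x) = Neg.neg := rfl
    rw [this, Set.image_neg_Ioo, neg_zero]
  rw [← himg, lintegral_image_eq_lintegral_abs_deriv_mul measurableSet_Ioo
    (fun x _ => (hasDerivAt_neg x).hasDerivWithinAt) neg_injective.injOn ψ]
  simp

/-! ### Density estimates -/

section Density

variable {t₀ t ℓ : ℝ}

/-- `1 ≤ π/(2r)` for `0 < r ≤ 1`. [folklore] -/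
theorem one_le_pi_div_two_mul (hr : 0 < r) (hr1 : r ≤ 1) : 1 ≤ π / (2 * r) := by
  rw [le_div_iff₀ (by positivity)]
  nlinarith [Real.two_le_pi]

/-- `a = e^{πt/r} - 1` satisfies `c_t² e^{πt/r} ≤ a ≤ e^{πt/r}`, `c_t² = 1 - e^{-πt₀}`. [folklore] -/
theorem apar_bounds (hr : 0 < r) (hr1 : r ≤ 1) (ht₀ : 0 < t₀) (ht : t₀ ≤ t) :
    (1 - Real.exp (-(π * t₀))) * Real.exp (π * t / r) ≤ Real.exp (π * t / r) - 1 ∧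
      Real.exp (π * t / r) - 1 ≤ Real.exp (π * t / r) ∧ 0 < Real.exp (π * t / r) - 1 ∧
      0 < 1 - Real.exp (-(π * t₀)) := by
  have h1 : Real.exp (-(π * t₀)) * Real.exp (π * t / r) ≥ 1 := by
    rw [← Real.exp_add, ge_iff_le, Real.one_le_exp_iff]
    have : π * t₀ ≤ π * t / r := by
      rw [le_div_iff₀ hr]
      have h0 : 0 ≤ π * t₀ := by positivity
      calc π * t₀ * r ≤ π * t₀ * 1 := by gcongr
        _ ≤ π * t := by rw [mul_one]; gcongr
    linarith
  have h2 : Real.exp (-(π * t₀)) < 1 := by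
    rw [Real.exp_lt_one_iff]; nlinarith [pi_pos]
  have h3 : 1 < Real.exp (π * t / r) := by
    rw [Real.one_lt_exp_iff]; exact div_pos (mul_pos pi_pos (ht₀.trans_le ht)) hr
  refine ⟨by nlinarith, by linarith, by linarith, by linarith⟩

/-- **Edge density.** With `a = e^{πt/r} - 1`, `0 < r ≤ 1`, `0 < t₀ ≤ t`:
`|V'(x)| p(V(x)) ≤ (2 c_t r)⁻¹ e^{-|x - t|}`, `c_t = √(1 - e^{-πt₀})`. [folklore] -/
theorem edge_density_le (hr : 0 < r) (hr1 : r ≤ 1) (ht₀ : 0 < t₀) (ht : t₀ ≤ t) (x : ℝ) :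
    |VD r (Real.exp (π * t / r) - 1) x| * pfun (Vedge r (Real.exp (π * t / r) - 1) x) ≤
      (2 * Real.sqrt (1 - Real.exp (-(π * t₀))) * r)⁻¹ * Real.exp (-|x - t|) := by
  obtain ⟨ha1, ha2, ha, hct⟩ := apar_bounds hr hr1 ht₀ ht
  set a := Real.exp (π * t / r) - 1 with hadef
  set ct := Real.sqrt (1 - Real.exp (-(π * t₀))) with hct_def
  have hct0 : 0 < ct := Real.sqrt_pos.2 hct
  have hct1 : ct ≤ 1 := by
    rw [hct_def, Real.sqrt_le_one]; linarith [Real.exp_pos (-(π * t₀))]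
  have hctsq : ct ^ 2 = 1 - Real.exp (-(π * t₀)) := Real.sq_sqrt hct.le
  set V := Vedge r a x with hVdef
  have hV : 0 < V := Vedge_pos ha x
  have hVsq : a * V ^ 2 = 1 + Real.exp (π * x / r) := by
    have := mul_Vedge_sq_sub_one (r := r) ha x; rw [← hVdef] at this; linarith
  set E := Real.exp (π * x / r) with hEdef
  have hE : 0 < E := Real.exp_pos _
  have hπr := one_le_pi_div_two_mul hr hr1
  have haV : 0 < a * V := mul_pos ha hV
  -- the density in closed form
  have hD : |VD r a x| * pfun V = E / (2 * r * (a * V) * (1 + V ^ 2)) := by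
    rw [VD, ← hVdef, ← hEdef, abs_of_pos (by positivity), pfun]
    field_simp
  rw [hD]
  rcases le_or_gt t x with hxt | hxt
  · -- case `x ≥ t`: `D ≤ 1/(2rV)` and `V ≥ e^{x-t} ≥ c_t e^{x-t}`
    have habs : |x - t| = x - t := abs_of_nonneg (by linarith)
    have h1 : E / (2 * r * (a * V) * (1 + V ^ 2)) ≤ 1 / (2 * r * V) := by
      rw [div_le_div_iff₀ (by positivity) (by positivity)]
      have key : 2 * r * (a * V) * (1 + V ^ 2) = 2 * r * a * V + 2 * r * V * (a * V ^ 2) := by ring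
      rw [one_mul, key, hVsq]
      nlinarith [mul_pos hr hV, mul_pos (mul_pos hr ha) hV]
    have h2 : Real.exp (x - t) ≤ V := by
      have hV2 : Real.exp (x - t) ^ 2 ≤ V ^ 2 := by
        rw [← Real.exp_nat_mul]
        push_cast
        have : Real.exp (π * (x - t) / r) ≤ V ^ 2 := by
          rw [show V ^ 2 = (1 + E) / a by rw [← hVsq]; field_simp, le_div_iff₀ ha]
          calc Real.exp (π * (x - t) / r) * a ≤ Real.exp (π * (x - t) / r) * Real.exp (π * t / r) :=
                mul_le_mul_of_nonneg_left ha2 (Real.exp_pos _).le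
            _ = E := by rw [hEdef, ← Real.exp_add]; congr 1; ring
            _ ≤ 1 + E := by linarith
        refine le_trans (Real.exp_le_exp.2 ?_) this
        rw [le_div_iff₀ hr]
        have h0 : 0 ≤ x - t := by linarith
        calc 2 * (x - t) * r = (x - t) * (2 * r) := by ring
          _ ≤ (x - t) * π := by gcongr; nlinarith [Real.two_le_pi]
          _ = π * (x - t) := by ring
      exact (pow_le_pow_iff_left₀ (Real.exp_pos _).le hV.le two_ne_zero).1 hV2
    have h3 : 1 / (2 * r * V) ≤ (2 * ct * r)⁻¹ * Real.exp (-|x - t|) := by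
      have hctV : ct * Real.exp (x - t) ≤ V :=
        h2.trans' (mul_le_of_le_one_left (Real.exp_pos _).le hct1)
      rw [habs, Real.exp_neg, div_le_iff₀ (by positivity)]
      -- goal: `1 ≤ (2 ct r)⁻¹ (e^{x-t})⁻¹ (2 r V)`
      have hpos : 0 < 2 * ct * r * Real.exp (x - t) := by positivity
      rw [← mul_inv, ← div_eq_inv_mul, le_div_iff₀ hpos]
      nlinarith [hctV, hr]
    exact h1.trans h3
  · -- case `x < t`: `D ≤ E/(2r aV)` and `aV ≥ c_t e^{π(x+t)/(2r)}`
    have habs : |x - t| = t - x := by rw [abs_sub_comm]; exact abs_of_pos (by linarith)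
    have h1 : E / (2 * r * (a * V) * (1 + V ^ 2)) ≤ E / (2 * r * (a * V)) := by
      refine div_le_div_of_nonneg_left hE.le (by positivity) ?_
      have : 0 ≤ 2 * r * (a * V) * V ^ 2 := by positivity
      nlinarith
    have h4 : ct * Real.exp (π * (x + t) / (2 * r)) ≤ a * V := by
      have hsq : (ct * Real.exp (π * (x + t) / (2 * r))) ^ 2 ≤ (a * V) ^ 2 := by
        rw [mul_pow, ← Real.exp_nat_mul, hctsq]
        push_cast
        rw [show (2 : ℝ) * (π * (x + t) / (2 * r)) = π * t / r + π * x / r by field_simp; ring,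
          Real.exp_add, ← hEdef, show (a * V) ^ 2 = a * (a * V ^ 2) by ring, hVsq]
        calc (1 - Real.exp (-(π * t₀))) * (Real.exp (π * t / r) * E)
            = ((1 - Real.exp (-(π * t₀))) * Real.exp (π * t / r)) * E := by ring
          _ ≤ a * E := mul_le_mul_of_nonneg_right ha1 hE.le
          _ ≤ a * (1 + E) := by nlinarith
      exact (pow_le_pow_iff_left₀ (by positivity) haV.le two_ne_zero).1 hsq
    have h5 : E / (2 * r * (a * V)) ≤ E / (2 * r * (ct * Real.exp (π * (x + t) / (2 * r)))) :=
      div_le_div_of_nonneg_left hE.le (by positivity) (by gcongr)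
    have h6 : E / (2 * r * (ct * Real.exp (π * (x + t) / (2 * r)))) =
        (2 * ct * r)⁻¹ * Real.exp (π * (x - t) / (2 * r)) := by
      rw [hEdef, eq_inv_mul_iff_mul_eq₀ (by positivity)]
      field_simp
      rw [← Real.exp_add]
      congr 1; field_simp; ring
    have h7 : Real.exp (π * (x - t) / (2 * r)) ≤ Real.exp (-|x - t|) := by
      rw [habs, Real.exp_le_exp]
      have h0 : 0 < t - x := by linarith
      have : (t - x) * 1 ≤ (t - x) * (π / (2 * r)) := mul_le_mul_of_nonneg_left hπr h0.le
      have e1 : π * (x - t) / (2 * r) = -((t - x) * (π / (2 * r))) := by field_simp; ring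
      rw [e1]; linarith
    calc E / (2 * r * (a * V) * (1 + V ^ 2)) ≤ E / (2 * r * (a * V)) := h1
      _ ≤ _ := h5
      _ = _ := h6
      _ ≤ (2 * ct * r)⁻¹ * Real.exp (-|x - t|) :=
          mul_le_mul_of_nonneg_left h7 (by positivity)


/-- **Far-cut density.** With `a = e^{πt/r} - 1`, `0 < r ≤ 1`, `0 < t₀ ≤ t`, `x ≤ -ℓ < 0`:
`|U'(x)| p(U(x)) ≤ (2 c_t c_ℓ r)⁻¹ e^{-|x - t|}`, `c_ℓ = √(1 - e^{-πℓ})`. [folklore] -/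
theorem cut_density_le (hr : 0 < r) (hr1 : r ≤ 1) (ht₀ : 0 < t₀) (ht : t₀ ≤ t) (hℓ : 0 < ℓ)
    {x : ℝ} (hx : x ≤ -ℓ) :
    |UD r (Real.exp (π * t / r) - 1) x| * pfun (Ucut r (Real.exp (π * t / r) - 1) x) ≤
      (2 * Real.sqrt (1 - Real.exp (-(π * t₀))) * Real.sqrt (1 - Real.exp (-(π * ℓ))) * r)⁻¹ *
        Real.exp (-|x - t|) := by
  obtain ⟨ha1, ha2, ha, hct⟩ := apar_bounds hr hr1 ht₀ ht
  set a := Real.exp (π * t / r) - 1 with hadef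
  set ct := Real.sqrt (1 - Real.exp (-(π * t₀))) with hct_def
  set cl := Real.sqrt (1 - Real.exp (-(π * ℓ))) with hcl_def
  have hcl2 : 0 < 1 - Real.exp (-(π * ℓ)) := by
    have : Real.exp (-(π * ℓ)) < 1 := by rw [Real.exp_lt_one_iff]; nlinarith [pi_pos]
    linarith
  have hct0 : 0 < ct := Real.sqrt_pos.2 hct
  have hcl0 : 0 < cl := Real.sqrt_pos.2 hcl2
  have hctsq : ct ^ 2 = 1 - Real.exp (-(π * t₀)) := Real.sq_sqrt hct.le
  have hclsq : cl ^ 2 = 1 - Real.exp (-(π * ℓ)) := Real.sq_sqrt hcl2.le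
  have hx0 : x < 0 := by linarith
  set U := Ucut r a x with hUdef
  have hU : 0 < U := Ucut_pos hr ha hx0
  have hUsq : 1 - a * U ^ 2 = Real.exp (π * x / r) := by
    have := one_sub_mul_Ucut_sq hr ha hx0; rwa [← hUdef] at this
  set E := Real.exp (π * x / r) with hEdef
  have hE : 0 < E := Real.exp_pos _
  have hπr := one_le_pi_div_two_mul hr hr1
  have haU : 0 < a * U := mul_pos ha hU
  -- `E ≤ e^{-πℓ}` (as `x ≤ -ℓ` and `r ≤ 1`)
  have hEle : E ≤ Real.exp (-(π * ℓ)) := by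
    rw [hEdef, Real.exp_le_exp, div_le_iff₀ hr]
    have h1 : π * x ≤ π * (-ℓ) := by gcongr
    have h2 : (π * ℓ) * r ≤ (π * ℓ) * 1 := mul_le_mul_of_nonneg_left hr1 (by positivity)
    linarith
  -- closed form bound of the density: `≤ E/(2 r a U)`
  have hD : |UD r a x| * pfun U ≤ E / (2 * r * (a * U)) := by
    rw [UD, ← hUdef, ← hEdef, show -(π / r * E / a) / (2 * U) = -((π / r * E / a) / (2 * U)) by ring,
      abs_neg, abs_of_pos (by positivity)]
    calc π / r * E / a / (2 * U) * pfun U ≤ π / r * E / a / (2 * U) * π⁻¹ :=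
          mul_le_mul_of_nonneg_left (pfun_le U) (by positivity)
      _ = E / (2 * r * (a * U)) := by field_simp
  -- `a U ≥ c_t c_ℓ e^{πt/(2r)}`
  have h4 : ct * cl * Real.exp (π * t / (2 * r)) ≤ a * U := by
    have hsq : (ct * cl * Real.exp (π * t / (2 * r))) ^ 2 ≤ (a * U) ^ 2 := by
      rw [mul_pow, mul_pow, ← Real.exp_nat_mul, hctsq, hclsq]
      push_cast
      rw [show (2 : ℝ) * (π * t / (2 * r)) = π * t / r by field_simp,
        show (a * U) ^ 2 = a * (1 - (1 - a * U ^ 2)) by ring, hUsq]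
      have h5 : 1 - Real.exp (-(π * ℓ)) ≤ 1 - E := by linarith
      calc (1 - Real.exp (-(π * t₀))) * (1 - Real.exp (-(π * ℓ))) * Real.exp (π * t / r)
          = ((1 - Real.exp (-(π * t₀))) * Real.exp (π * t / r)) * (1 - Real.exp (-(π * ℓ))) := by ring
        _ ≤ a * (1 - Real.exp (-(π * ℓ))) := mul_le_mul_of_nonneg_right ha1 hcl2.le
        _ ≤ a * (1 - E) := mul_le_mul_of_nonneg_left h5 ha.le
    exact (pow_le_pow_iff_left₀ (by positivity) haU.le two_ne_zero).1 hsq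
  have h5 : E / (2 * r * (a * U)) ≤ E / (2 * r * (ct * cl * Real.exp (π * t / (2 * r)))) :=
    div_le_div_of_nonneg_left hE.le (by positivity) (by gcongr)
  have h6 : E / (2 * r * (ct * cl * Real.exp (π * t / (2 * r)))) =
      (2 * ct * cl * r)⁻¹ * Real.exp (π * x / r - π * t / (2 * r)) := by
    rw [hEdef, eq_inv_mul_iff_mul_eq₀ (by positivity), Real.exp_sub]
    field_simp
  have h7 : Real.exp (π * x / r - π * t / (2 * r)) ≤ Real.exp (-|x - t|) := by
    have habs : |x - t| = t - x := by
      rw [abs_sub_comm]; exact abs_of_pos (by linarith [ht₀.trans_le ht])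
    rw [habs, Real.exp_le_exp]
    have ht' : 0 < t := ht₀.trans_le ht
    have e1 : π * x / r ≤ x := by
      rw [div_le_iff₀ hr]
      have : x * π ≤ x * r := by nlinarith [Real.two_le_pi]
      linarith
    have e2 : t ≤ π * t / (2 * r) := by
      have := mul_le_mul_of_nonneg_left hπr ht'.le
      rw [mul_one] at this
      calc t ≤ t * (π / (2 * r)) := this
        _ = π * t / (2 * r) := by ring
    linarith
  calc |UD r a x| * pfun U ≤ E / (2 * r * (a * U)) := hD
    _ ≤ _ := h5
    _ = _ := h6
    _ ≤ (2 * ct * cl * r)⁻¹ * Real.exp (-|x - t|) := mul_le_mul_of_nonneg_left h7 (by positivity)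

/-! ### The mass of the slit -/

/-- `arctan m ≥ m/2` for `0 ≤ m ≤ 1`. [folklore] -/
theorem half_le_arctan {m : ℝ} (hm0 : 0 ≤ m) (hm1 : m ≤ 1) : m / 2 ≤ Real.arctan m := by
  have h := integral_inv_one_add_sq (a := (0 : ℝ)) (b := m)
  rw [Real.arctan_zero, sub_zero] at h
  rw [← h]
  have hmono : ∫ x in (0 : ℝ)..m, (1 / 2 : ℝ) ≤ ∫ x in (0 : ℝ)..m, (1 + x ^ 2)⁻¹ := by
    refine intervalIntegral.integral_mono_on hm0 intervalIntegrable_const ?_ fun x hx => ?_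
    · refine Continuous.intervalIntegrable (Continuous.inv₀ (by fun_prop) fun x => ?_) _ _
      positivity
    · have hx2 : 0 < 1 + x ^ 2 := by positivity
      rw [one_div, inv_le_inv₀ (by norm_num) hx2]
      nlinarith [hx.1, hx.2]
  rw [intervalIntegral.integral_const, smul_eq_mul, sub_zero] at hmono
  linarith

/-- The Poisson mass of `(-U, U)`: `∫_{(-U,U)} p = (2/π) arctan U`. [folklore] -/
theorem integral_pfun_Ioo (U : ℝ) (hU : 0 ≤ U) :
    ∫ u in Ioo (-U) U, pfun u = 2 / π * Real.arctan U := by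
  rw [← integral_Ioc_eq_integral_Ioo, ← intervalIntegral.integral_of_le (by linarith)]
  simp only [pfun]
  rw [intervalIntegral.integral_const_mul, integral_inv_one_add_sq, Real.arctan_neg]
  ring

/-- The Poisson density has total mass `1`: `∫ π⁻¹ (1+u²)⁻¹ du = 1`. [folklore] -/
theorem integral_pfun : ∫ u, pfun u = 1 := by
  simp only [pfun]
  rw [integral_const_mul, integral_univ_inv_one_add_sq]
  field_simp

/-- The Poisson density is integrable. [folklore] -/
theorem integrable_pfun : Integrable pfun := by
  have : Integrable fun u : ℝ => π⁻¹ * (1 + u ^ 2)⁻¹ := integrable_inv_one_add_sq.const_mul _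
  exact this

/-- Lower bound for the slit mass: with `a = e^{πt/r} - 1`, `t ≤ 1`, `r ≤ 1`,
`(2/π) arctan U(-ℓ) ≥ e^{-C/r}` for `C = π/2 + log (π / c_ℓ)`. [folklore] -/
theorem slit_mass_ge (hr : 0 < r) (hr1 : r ≤ 1) (ht : 0 < t) (ht1 : t ≤ 1) (hℓ : 0 < ℓ) :
    Real.exp (-((π / 2 + Real.log (π / Real.sqrt (1 - Real.exp (-(π * ℓ))))) / r)) ≤
      2 / π * Real.arctan (Ucut r (Real.exp (π * t / r) - 1) (-ℓ)) := by
  set a := Real.exp (π * t / r) - 1 with hadef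
  set cl := Real.sqrt (1 - Real.exp (-(π * ℓ))) with hcl_def
  have hcl2 : 0 < 1 - Real.exp (-(π * ℓ)) := by
    have : Real.exp (-(π * ℓ)) < 1 := by rw [Real.exp_lt_one_iff]; nlinarith [pi_pos]
    linarith
  have hcl0 : 0 < cl := Real.sqrt_pos.2 hcl2
  have hcl1 : cl < 1 := by
    rw [hcl_def, Real.sqrt_lt' one_pos]; linarith [Real.exp_pos (-(π * ℓ))]
  have hclsq : cl ^ 2 = 1 - Real.exp (-(π * ℓ)) := Real.sq_sqrt hcl2.le
  have ha : 0 < a := by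
    have : 1 < Real.exp (π * t / r) := by
      rw [Real.one_lt_exp_iff]; positivity
    simp only [hadef]; linarith
  have ha2 : a ≤ Real.exp (π / r) := by
    have : Real.exp (π * t / r) ≤ Real.exp (π / r) := by
      rw [Real.exp_le_exp, div_le_div_iff_of_pos_right hr]; nlinarith [pi_pos]
    simp only [hadef]; linarith [Real.exp_pos (π * t / r)]
  set U := Ucut r a (-ℓ) with hUdef
  have hU0 : 0 ≤ U := Ucut_nonneg _ _ _
  -- `m₀ := c_ℓ e^{-π/(2r)} ≤ min U 1`
  set m₀ := cl * Real.exp (-(π / (2 * r))) with hm₀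
  have hm₀pos : 0 < m₀ := by positivity
  have hm₀1 : m₀ ≤ 1 := by
    have : Real.exp (-(π / (2 * r))) ≤ 1 := by
      rw [Real.exp_le_one_iff]; have := pi_pos; apply neg_nonpos.2; positivity
    calc m₀ ≤ 1 * 1 := mul_le_mul hcl1.le this (Real.exp_pos _).le zero_le_one
      _ = 1 := by ring
  have hm₀U : m₀ ≤ U := by
    have hsq : m₀ ^ 2 ≤ U ^ 2 := by
      rw [hUdef, Ucut_sq hr ha (by linarith), hm₀, mul_pow, ← Real.exp_nat_mul, hclsq]
      push_cast
      rw [show (2 : ℝ) * -(π / (2 * r)) = -(π / r) by field_simp, le_div_iff₀ ha]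
      have h1 : Real.exp (-(π * ℓ)) ≥ Real.exp (π * -ℓ / r) := by
        rw [ge_iff_le, Real.exp_le_exp, div_le_iff₀ hr]
        have : (π * ℓ) * r ≤ (π * ℓ) * 1 := mul_le_mul_of_nonneg_left hr1 (by positivity)
        linarith
      calc (1 - Real.exp (-(π * ℓ))) * Real.exp (-(π / r)) * a
          ≤ (1 - Real.exp (-(π * ℓ))) * Real.exp (-(π / r)) * Real.exp (π / r) := by gcongr
        _ = 1 - Real.exp (-(π * ℓ)) := by rw [mul_assoc, ← Real.exp_add]; simp
        _ ≤ 1 - Real.exp (π * -ℓ / r) := by linarith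
    exact (pow_le_pow_iff_left₀ hm₀pos.le hU0 two_ne_zero).1 hsq
  -- `arctan U ≥ arctan (min U 1) ≥ min U 1 / 2 ≥ m₀ / 2`
  have h1 : m₀ / 2 ≤ Real.arctan U := by
    have hmin : Real.arctan (min U 1) ≤ Real.arctan U :=
      Real.arctan_strictMono.monotone (min_le_left _ _)
    have := half_le_arctan (le_min hU0 zero_le_one) (min_le_right _ _)
    have h3 : m₀ ≤ min U 1 := le_min hm₀U hm₀1
    linarith
  -- compare with `e^{-C/r}`
  have h2 : Real.exp (-((π / 2 + Real.log (π / cl)) / r)) ≤ m₀ / π := by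
    have hlogpos : 0 < Real.log (π / cl) := by
      apply Real.log_pos; rw [lt_div_iff₀ hcl0]; nlinarith [Real.two_le_pi]
    have e1 : -((π / 2 + Real.log (π / cl)) / r) = -(π / (2 * r)) + -(Real.log (π / cl) / r) := by
      field_simp; ring
    rw [e1, Real.exp_add, hm₀]
    have e2 : Real.exp (-(Real.log (π / cl) / r)) ≤ cl / π := by
      have : Real.exp (-(Real.log (π / cl) / r)) ≤ Real.exp (-Real.log (π / cl)) := by
        rw [Real.exp_le_exp, neg_le_neg_iff, le_div_iff₀ hr]
        nlinarith
      refine this.trans (le_of_eq ?_)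
      rw [Real.exp_neg, Real.exp_log (by positivity), inv_div]
    calc Real.exp (-(π / (2 * r))) * Real.exp (-(Real.log (π / cl) / r))
        ≤ Real.exp (-(π / (2 * r))) * (cl / π) :=
          mul_le_mul_of_nonneg_left e2 (Real.exp_pos _).le
      _ = cl * Real.exp (-(π / (2 * r))) / π := by ring
  calc Real.exp (-((π / 2 + Real.log (π / cl)) / r)) ≤ m₀ / π := h2
    _ = 2 / π * (m₀ / 2) := by ring
    _ ≤ 2 / π * Real.arctan U := mul_le_mul_of_nonneg_left h1 (by positivity)

end Density



/-! ### Assembly of the pointwise estimate -/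

section Pointwise

/-- On the cut (`a u² < 1`) the boundary point is `Xc u`. [folklore] -/
theorem zbd_of_lt {r a u : ℝ} (h : a * u ^ 2 < 1) : zbd r a u = ((Xc r a u : ℝ) : ℂ) := by
  rw [zbd, if_pos h]; rfl

/-- On the lower edge (`a u² > 1`, `u > 0`) the boundary point is `Xe u - ir`. [folklore] -/
theorem zbd_of_gt_pos {r a u : ℝ} (h : 1 < a * u ^ 2) (hu : 0 < u) :
    zbd r a u = ((Xe r a u : ℝ) : ℂ) - r * I := by
  rw [zbd, if_neg (not_lt.2 h.le), if_pos hu]; rfl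

/-- On the upper edge (`a u² > 1`, `u < 0`) the boundary point is `Xe u + ir`. [folklore] -/
theorem zbd_of_gt_neg {r a u : ℝ} (h : 1 < a * u ^ 2) (hu : u < 0) :
    zbd r a u = ((Xe r a u : ℝ) : ℂ) + r * I := by
  rw [zbd, if_neg (not_lt.2 h.le), if_neg (not_lt.2 hu.le)]; rfl

/-- Boundary points lie in the closed strip `|Im z| ≤ r`. [folklore] -/
theorem abs_zbd_im_le {r a : ℝ} (hr : 0 ≤ r) (u : ℝ) : |(zbd r a u).im| ≤ r := by
  unfold zbd
  split_ifs <;> simp [abs_of_nonneg hr, hr]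

/-- The boundary parametrisation `zbd` is measurable. [folklore] -/
theorem measurable_zbd (r a : ℝ) : Measurable (zbd r a) := by
  unfold zbd
  refine Measurable.ite (measurableSet_lt (by fun_prop) measurable_const) ?_ ?_
  · exact Complex.measurable_ofReal.comp (measurable_const.mul (Real.measurable_log.comp (by fun_prop)))
  refine Measurable.ite (measurableSet_lt measurable_const measurable_id) ?_ ?_
  · exact (Complex.measurable_ofReal.comp
      (measurable_const.mul (Real.measurable_log.comp (by fun_prop)))).sub measurable_const
  · exact (Complex.measurable_ofReal.comp
      (measurable_const.mul (Real.measurable_log.comp (by fun_prop)))).add measurable_const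

/-- The exceptional set `{u : a u² = 1}` (at most two points) is countable. [folklore] -/
theorem countable_setOf_mul_sq_eq_one (a : ℝ) : {u : ℝ | a * u ^ 2 = 1}.Countable := by
  apply Set.Finite.countable
  refine ((Set.finite_singleton (-Real.sqrt a⁻¹)).insert (Real.sqrt a⁻¹)).subset fun u hu => ?_
  simp only [Set.mem_setOf_eq] at hu
  have ha : 0 < a := by
    by_contra h
    have : a * u ^ 2 ≤ 0 := mul_nonpos_of_nonpos_of_nonneg (not_lt.1 h) (sq_nonneg u)
    linarith
  have hu2 : u * u = Real.sqrt a⁻¹ * Real.sqrt a⁻¹ := by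
    rw [Real.mul_self_sqrt (inv_nonneg.2 ha.le)]
    calc u * u = a * u ^ 2 / a := by field_simp
      _ = a⁻¹ := by rw [hu, one_div]
  rcases mul_self_eq_mul_self_iff.1 hu2 with h | h
  · exact Or.inl h
  · exact Or.inr h

/-- `a = e^{πt/r} - 1 > 0` for `r, t > 0`. [folklore] -/
theorem apar_pos {r t : ℝ} (hr : 0 < r) (ht : 0 < t) : 0 < Real.exp (π * t / r) - 1 := by
  have : 1 < Real.exp (π * t / r) := by rw [Real.one_lt_exp_iff]; positivity
  linarith

/-- **Step J for the slit strip.** For `F` entire, bounded on the strip `|Im z| ≤ r`, `F t ≠ 0`: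
`log ‖F t‖ ≤ ∫ p(u) log (‖F (zbd u)‖ + ε) du`. [folklore] -/
theorem log_norm_le_integral_pfun_log {F : ℂ → ℂ} (hF : Differentiable ℂ F) {M r t : ℝ}
    (hr : 0 < r) (ht : 0 < t) (hM : ∀ z : ℂ, |z.im| ≤ r → ‖F z‖ ≤ M) (h0 : F t ≠ 0)
    {ε : ℝ} (hε : 0 < ε) :
    Real.log ‖F t‖ ≤
      ∫ u, pfun u * Real.log (‖F (zbd r (Real.exp (π * t / r) - 1) u)‖ + ε) := by
  have ha := apar_pos hr ht
  set a := Real.exp (π * t / r) - 1 with hadef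
  set G : ℂ → ℂ := fun ω => F (zmap r a (cayInv ω)) with hGdef
  have hG : DifferentiableOn ℂ G (ball 0 1) := fun ω hω =>
    ((hF _).comp ω ((differentiableAt_zmap ha (cayInv_im_pos hω)).comp ω
      (differentiableAt_cayInv (one_sub_ne_zero_of_mem_ball hω)))).differentiableWithinAt
  have hGM : ∀ ω ∈ ball (0 : ℂ) 1, ‖G ω‖ ≤ M := fun ω hω =>
    hM _ (abs_zmap_im_lt hr ha (cayInv_im_pos hω)).le
  have hG0 : G 0 = F t := by
    simp only [hGdef, cayInv_zero]
    rw [hadef, zmap_I hr]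
  have hlim : ∀ u, u ∉ {u : ℝ | a * u ^ 2 = 1} →
      Tendsto G (𝓝[ball 0 1] (cayBd u)) (𝓝 (F (zbd r a u))) := fun u hu =>
    tendsto_comp_zmap_cayInv hF.continuous ha hu
  have hJ := log_norm_le_integral_log_boundary hG hGM (countable_setOf_mul_sq_eq_one a) hlim
    (by rwa [hG0]) hε
  rw [hG0] at hJ
  refine hJ.trans (le_of_eq (integral_congr_ae (ae_of_all _ fun u => ?_)))
  simp only [pfun]

/-- A bounded measurable function is integrable against the Poisson density. [folklore] -/
theorem integrable_pfun_mul {f : ℝ → ℝ} (hf : Measurable f) {C : ℝ} (hC : ∀ u, |f u| ≤ C) :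
    Integrable fun u => pfun u * f u :=
  integrable_pfun.mul_bdd (c := C) hf.aestronglyMeasurable (ae_of_all _ fun u => by
    rw [Real.norm_eq_abs]; exact hC u)

/-- `√(x + y) ≤ √x + √y`. [folklore] -/
theorem sqrt_add_le_sqrt_add_sqrt {x y : ℝ} (hx : 0 ≤ x) (hy : 0 ≤ y) :
    Real.sqrt (x + y) ≤ Real.sqrt x + Real.sqrt y := by
  rw [Real.sqrt_le_left (by positivity)]
  nlinarith [Real.sq_sqrt hx, Real.sq_sqrt hy, Real.sqrt_nonneg x, Real.sqrt_nonneg y]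

/-- `(a, b)ᶜ ⊆ (-∞, a] ∪ [b, ∞)`. [folklore] -/
theorem compl_Ioo_subset (a b : ℝ) : (Ioo a b)ᶜ ⊆ Iic a ∪ Ici b := by
  intro u hu
  simp only [mem_compl_iff, mem_Ioo, not_and_or, not_lt] at hu
  rcases hu with h | h
  · exact Or.inl h
  · exact Or.inr h

/-- **Two-pieces estimate in the limit `ε → 0`.** With `a = e^{πt/r} - 1`, `U = U(-ℓ)`,
`k = (2/π) arctan U`, `A₀ = ∫_{(-U,U)} p √‖F ∘ zbd‖`, `B₀ = ∫_{(-U,U)ᶜ} p ‖F ∘ zbd‖²`: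
`‖F t‖² ≤ (e^{1/e})^5 A₀^{4k} (2B₀)^{1-k}`. [folklore] -/
theorem sq_norm_le_A_B {F : ℂ → ℂ} (hF : Differentiable ℂ F) {M r t ℓ : ℝ}
    (hr : 0 < r) (ht : 0 < t) (hℓ : 0 < ℓ) (hM : ∀ z : ℂ, |z.im| ≤ r → ‖F z‖ ≤ M)
    (a U : ℝ) (hadef : a = Real.exp (π * t / r) - 1) (hUdef : U = Ucut r a (-ℓ)) :
    ‖F t‖ ^ 2 ≤ Real.exp (Real.exp (-1)) ^ 5 *
      ((∫ u in Ioo (-U) U, pfun u * Real.sqrt ‖F (zbd r a u)‖) ^ (4 * (2 / π * Real.arctan U)) *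
        (2 * ∫ u in (Ioo (-U) U)ᶜ, pfun u * ‖F (zbd r a u)‖ ^ 2) ^ (1 - 2 / π * Real.arctan U)) := by
  have ha : 0 < a := by rw [hadef]; exact apar_pos hr ht
  have hU : 0 < U := by rw [hUdef]; exact Ucut_pos hr ha (by linarith)
  set k := 2 / π * Real.arctan U with hkdef
  have hk0 : 0 < k := by
    have : 0 < Real.arctan U := by
      rw [← Real.arctan_zero]; exact Real.arctan_strictMono hU
    positivity
  have hk1 : k < 1 := by
    have h1 : Real.arctan U < π / 2 := Real.arctan_lt_pi_div_two U
    have : 2 / π * Real.arctan U < 2 / π * (π / 2) := mul_lt_mul_of_pos_left h1 (by positivity)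
    rw [hkdef]; convert this using 1; field_simp
  set S := Ioo (-U) U with hSdef
  have hkS : ∫ u in S, pfun u = k := integral_pfun_Ioo U hU.le
  have hkSc : ∫ u in Sᶜ, pfun u = 1 - k := by
    have := integral_add_compl (measurableSet_Ioo (a := -U) (b := U)) integrable_pfun (μ := volume)
    rw [integral_pfun, ← hSdef, hkS] at this
    linarith
  set bF : ℝ → ℂ := fun u => F (zbd r a u) with hbFdef
  have hbFm : Measurable bF := hF.continuous.measurable.comp (measurable_zbd r a)
  have hM0 : 0 ≤ M := (norm_nonneg _).trans (hM t (by simp [hr.le]))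
  have hbFM : ∀ u, ‖bF u‖ ≤ M := fun u => hM _ (abs_zbd_im_le hr.le u)
  set A₀ := ∫ u in S, pfun u * Real.sqrt ‖bF u‖ with hA₀
  set B₀ := ∫ u in Sᶜ, pfun u * ‖bF u‖ ^ 2 with hB₀
  have hA₀0 : 0 ≤ A₀ :=
    setIntegral_nonneg measurableSet_Ioo fun u _ => mul_nonneg (pfun_pos u).le (Real.sqrt_nonneg _)
  have hB₀0 : 0 ≤ B₀ :=
    setIntegral_nonneg measurableSet_Ioo.compl fun u _ => mul_nonneg (pfun_pos u).le (sq_nonneg _)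
  by_cases h0 : F t = 0
  · rw [h0, norm_zero]
    have : (0 : ℝ) ^ 2 = 0 := by norm_num
    rw [this]; positivity
  -- integrability facts
  have hint_sqrt : Integrable fun u => pfun u * Real.sqrt ‖bF u‖ :=
    integrable_pfun_mul hbFm.norm.sqrt (C := Real.sqrt M)
      fun u => by rw [abs_of_nonneg (Real.sqrt_nonneg _)]; exact Real.sqrt_le_sqrt (hbFM u)
  have hint_sq : Integrable fun u => pfun u * ‖bF u‖ ^ 2 :=
    integrable_pfun_mul (hbFm.norm.pow_const 2) (C := M ^ 2)
      fun u => by rw [abs_of_nonneg (sq_nonneg _)]; exact pow_le_pow_left₀ (norm_nonneg _) (hbFM u) 2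
  -- the estimate for fixed `ε ∈ (0, 1]`
  have hε_est : ∀ ε : ℝ, 0 < ε → ε ≤ 1 →
      ‖F t‖ ^ 2 ≤ ((A₀ + Real.sqrt ε) / k) ^ (4 * k) * ((2 * B₀ + 2 * ε ^ 2) / (1 - k)) ^ (1 - k) := by
    intro ε hε hε1
    have hH : Measurable fun u => ‖bF u‖ + ε := hbFm.norm.add_const ε
    obtain ⟨hAε, hBε, hI⟩ := integral_mul_log_le_two_pieces (S := S) (K := M + ε) measurableSet_Ioo
      integrable_pfun (fun u => (pfun_pos u).le) hH hε (fun u => by linarith [norm_nonneg (bF u)])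
      (fun u => by linarith [hbFM u]) (by rw [hkS]; exact hk0) (by rw [hkSc]; linarith)
    rw [hkS, hkSc] at hI
    set Aε := ∫ u in S, pfun u * Real.sqrt (‖bF u‖ + ε) with hAεdef
    set Bε := ∫ u in Sᶜ, pfun u * (‖bF u‖ + ε) ^ 2 with hBεdef
    have hJ := log_norm_le_integral_pfun_log hF hr ht hM h0 hε
    rw [← hadef] at hJ
    have h2 : 2 * Real.log ‖F t‖ ≤ 4 * k * Real.log (Aε / k) + (1 - k) * Real.log (Bε / (1 - k)) := by
      linarith
    have h3 := sq_le_of_two_log_le (norm_pos_iff.2 h0) (div_pos hAε hk0) (div_pos hBε (by linarith)) h2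
    -- compare `Aε ≤ A₀ + √ε`, `Bε ≤ 2 B₀ + 2 ε²`
    have hA_le : Aε ≤ A₀ + Real.sqrt ε := by
      have h4 : Aε ≤ ∫ u in S, pfun u * Real.sqrt ‖bF u‖ + Real.sqrt ε * pfun u := by
        refine setIntegral_mono_on ?_ ?_ measurableSet_Ioo fun u _ => ?_
        · exact (integrable_pfun_mul hH.sqrt (C := Real.sqrt (M + 1))
            fun u => by
              rw [abs_of_nonneg (Real.sqrt_nonneg _)]
              exact Real.sqrt_le_sqrt (by linarith [hbFM u])).integrableOn
        · exact (hint_sqrt.add (integrable_pfun.const_mul _)).integrableOn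
        · have := sqrt_add_le_sqrt_add_sqrt (norm_nonneg (bF u)) hε.le
          have hp := (pfun_pos u).le
          nlinarith
      rw [integral_add hint_sqrt.integrableOn (integrable_pfun.const_mul _).integrableOn,
        integral_const_mul, hkS] at h4
      have : Real.sqrt ε * k ≤ Real.sqrt ε := mul_le_of_le_one_right (Real.sqrt_nonneg _) hk1.le
      linarith
    have hB_le : Bε ≤ 2 * B₀ + 2 * ε ^ 2 := by
      have h4 : Bε ≤ ∫ u in Sᶜ, 2 * (pfun u * ‖bF u‖ ^ 2) + 2 * ε ^ 2 * pfun u := by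
        refine setIntegral_mono_on ?_ ?_ measurableSet_Ioo.compl fun u _ => ?_
        · exact (integrable_pfun_mul (hH.pow_const 2) (C := (M + 1) ^ 2) fun u => by
            rw [abs_of_nonneg (sq_nonneg _)]
            exact pow_le_pow_left₀ (by positivity) (by linarith [hbFM u]) 2).integrableOn
        · exact ((hint_sq.const_mul 2).add (integrable_pfun.const_mul _)).integrableOn
        · have hp := (pfun_pos u).le
          have : (‖bF u‖ + ε) ^ 2 ≤ 2 * ‖bF u‖ ^ 2 + 2 * ε ^ 2 := by
            nlinarith [sq_nonneg (‖bF u‖ - ε)]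
          nlinarith
      rw [integral_add (hint_sq.const_mul 2).integrableOn (integrable_pfun.const_mul _).integrableOn,
        integral_const_mul, integral_const_mul, hkSc] at h4
      have : 2 * ε ^ 2 * (1 - k) ≤ 2 * ε ^ 2 := mul_le_of_le_one_right (by positivity) (by linarith)
      linarith
    refine h3.trans (mul_le_mul ?_ ?_ (Real.rpow_nonneg (div_pos hBε (by linarith)).le _)
      (Real.rpow_nonneg (by positivity) _))
    · exact Real.rpow_le_rpow (div_pos hAε hk0).le (div_le_div_of_nonneg_right hA_le hk0.le)
        (by linarith)
    · exact Real.rpow_le_rpow (div_pos hBε (by linarith)).le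
        (div_le_div_of_nonneg_right hB_le (by linarith)) (by linarith)
  -- pass to the limit `ε → 0⁺`
  set f : ℝ → ℝ := fun ε =>
    ((A₀ + Real.sqrt ε) / k) ^ (4 * k) * ((2 * B₀ + 2 * ε ^ 2) / (1 - k)) ^ (1 - k) with hfdef
  have hfc : Continuous f := by
    simp only [hfdef]
    refine Continuous.mul ?_ ?_
    · exact Continuous.rpow_const (by fun_prop) fun x => Or.inr (by linarith)
    · exact Continuous.rpow_const (by fun_prop) fun x => Or.inr (by linarith)
  have hlim : Tendsto f (𝓝[>] 0) (𝓝 (f 0)) := (hfc.tendsto 0).mono_left nhdsWithin_le_nhds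
  have hev : ∀ᶠ ε in 𝓝[>] (0 : ℝ), ‖F t‖ ^ 2 ≤ f ε := by
    filter_upwards [Ioo_mem_nhdsGT (zero_lt_one' ℝ)] with ε hε
    exact hε_est ε hε.1 hε.2.le
  have hle : ‖F t‖ ^ 2 ≤ f 0 := ge_of_tendsto hlim hev
  have hf0 : f 0 = (A₀ / k) ^ (4 * k) * ((2 * B₀) / (1 - k)) ^ (1 - k) := by
    simp [hfdef]
  rw [hf0] at hle
  refine hle.trans ?_
  have := div_rpow_mul_div_rpow_le hA₀0 (by positivity : (0 : ℝ) ≤ 2 * B₀) hk0 (by linarith : 0 < 1 - k)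
  simpa using this


/-! #### The bound on `A₀` -/

/-- `a u² < 1` when `|u| < U(-ℓ)`. [folklore] -/
theorem mul_sq_lt_one_of_abs_lt (hr : 0 < r) (ha : 0 < a) {ℓ : ℝ} (hℓ : 0 < ℓ) {u : ℝ}
    (hu : |u| < Ucut r a (-ℓ)) : a * u ^ 2 < 1 := by
  have h1 : a * u ^ 2 < a * Ucut r a (-ℓ) ^ 2 := by
    have : u ^ 2 < Ucut r a (-ℓ) ^ 2 := by
      rw [← sq_abs u]; exact pow_lt_pow_left₀ hu (abs_nonneg u) two_ne_zero
    exact mul_lt_mul_of_pos_left this ha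
  rw [mul_Ucut_neg_sq hr ha hℓ] at h1
  linarith [Real.exp_pos (-(π * ℓ / r))]

/-- `U(-ℓ) ≤ 1/√a`. [folklore] -/
theorem Ucut_le_sqrt_inv (hr : 0 < r) (ha : 0 < a) {ℓ : ℝ} (hℓ : 0 < ℓ) :
    Ucut r a (-ℓ) ≤ Real.sqrt a⁻¹ := by
  have h := mul_Ucut_neg_sq hr ha hℓ
  have h2 : a * Ucut r a (-ℓ) ^ 2 < 1 := by rw [h]; linarith [Real.exp_pos (-(π * ℓ / r))]
  have := (sq_lt_inv_iff ha).1 h2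
  rw [abs_of_nonneg (Ucut_nonneg _ _ _)] at this
  exact this.le

/-- `ofReal (√y) = ofReal (y²)^{1/4}` in `ℝ≥0∞` for `y ≥ 0`. [folklore] -/
theorem ofReal_sqrt_eq_rpow (y : ℝ) (hy : 0 ≤ y) :
    ENNReal.ofReal (Real.sqrt y) = ENNReal.ofReal (y ^ 2) ^ (1 / 4 : ℝ) := by
  rw [ENNReal.ofReal_rpow_of_nonneg (sq_nonneg _) (by norm_num), ← Real.rpow_natCast_mul hy,
    Real.sqrt_eq_rpow]
  norm_num

/-- `A₀ ≤ (2/π) Q^{1/4} K^{3/4}`. [folklore] -/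
theorem A0_le {F : ℂ → ℂ} (hF : Continuous F) {M r a ℓ : ℝ} (hr : 0 < r) (ha : 0 < a) (hℓ : 0 < ℓ)
    (hM : ∀ x : ℝ, ‖F x‖ ≤ M) :
    ∫ u in Ioo (-Ucut r a (-ℓ)) (Ucut r a (-ℓ)), pfun u * Real.sqrt ‖F (zbd r a u)‖ ≤
      2 / π * (∫ x in Icc (-ℓ) 0, ‖F x‖ ^ 2) ^ (1 / 4 : ℝ) *
        ((2 * r * a / π) ^ (-(1 / 3) : ℝ) * (3 / 2 * Ucut r a (-ℓ) ^ (2 / 3 : ℝ))) ^ (3 / 4 : ℝ) := by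
  set U := Ucut r a (-ℓ) with hUdef
  set S := Ioo (-U) U with hSdef
  set Q := ∫ x in Icc (-ℓ) 0, ‖F x‖ ^ 2 with hQdef
  set Kc := (2 * r * a / π) ^ (-(1 / 3) : ℝ) * (3 / 2 * U ^ (2 / 3 : ℝ)) with hKcdef
  have hU0 : 0 ≤ U := Ucut_nonneg _ _ _
  have hM0 : 0 ≤ M := (norm_nonneg _).trans (hM 0)
  have hQ0 : 0 ≤ Q := setIntegral_nonneg measurableSet_Icc fun x _ => sq_nonneg _
  have hKc0 : 0 ≤ Kc := by positivity
  -- on `S`, `zbd u = Xc u`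
  have hzbd : ∀ u ∈ S, zbd r a u = ((Xc r a u : ℝ) : ℂ) := fun u hu =>
    zbd_of_lt (mul_sq_lt_one_of_abs_lt hr ha hℓ (abs_lt.2 ⟨hu.1, hu.2⟩))
  set g : ℝ → ℝ := fun u => Real.sqrt ‖F (Xc r a u)‖ with hgdef
  have hgm : Measurable g := (hF.measurable.comp (Complex.measurable_ofReal.comp (measurable_Xc r a))).norm.sqrt
  have hgb : ∀ u, |g u| ≤ Real.sqrt M := fun u => by
    rw [hgdef, abs_of_nonneg (Real.sqrt_nonneg _)]; exact Real.sqrt_le_sqrt (hM _)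
  have hg0 : ∀ u, 0 ≤ g u := fun u => Real.sqrt_nonneg _
  have hSfin : volume S < ⊤ := by rw [hSdef, Real.volume_Ioo]; exact ENNReal.ofReal_lt_top
  have hgint : IntegrableOn g S := IntegrableOn.of_bound hSfin hgm.aestronglyMeasurable (Real.sqrt M)
    (ae_of_all _ fun u => by rw [Real.norm_eq_abs]; exact hgb u)
  -- Step 1: `A₀ ≤ π⁻¹ ∫_S g`
  have h1 : ∫ u in S, pfun u * Real.sqrt ‖F (zbd r a u)‖ ≤ ∫ u in S, π⁻¹ * g u := by
    refine setIntegral_mono_on ?_ (hgint.const_mul _) measurableSet_Ioo fun u hu => ?_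
    · have : IntegrableOn (fun u => pfun u * g u) S :=
        (integrable_pfun_mul hgm hgb).integrableOn
      refine this.congr_fun (fun u hu => ?_) measurableSet_Ioo
      simp only [hgdef, hzbd u hu]
    · rw [hzbd u hu]
      exact mul_le_mul_of_nonneg_right (pfun_le u) (hg0 u)
  rw [integral_const_mul] at h1
  -- Step 2: `∫_S g ≤ 2 Q^{1/4} Kc^{3/4}` through the Lebesgue integral
  set Φ : ℝ → ℝ≥0∞ := fun x => ENNReal.ofReal (‖F x‖ ^ 2) with hΦdef
  have hΦm : Measurable Φ := ((hF.measurable.comp Complex.measurable_ofReal).norm.pow_const 2).ennreal_ofReal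
  have hgΦ : ∀ u, ENNReal.ofReal (g u) = Φ (Xc r a u) ^ (1 / 4 : ℝ) := fun u =>
    ofReal_sqrt_eq_rpow _ (norm_nonneg _)
  have hΦQ : ∫⁻ x in Icc (-ℓ) 0, Φ x = ENNReal.ofReal Q := by
    rw [hQdef, ofReal_integral_eq_lintegral_ofReal]
    · exact (Continuous.integrableOn_Icc (by fun_prop))
    · exact ae_of_all _ fun x => sq_nonneg _
  have hhalf : ∫⁻ u in Ioo 0 U, ENNReal.ofReal (g u) ≤
      ENNReal.ofReal Q ^ (1 / 4 : ℝ) * ENNReal.ofReal Kc ^ (3 / 4 : ℝ) := by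
    simp_rw [hgΦ]
    have := lintegral_rpow_quarter_le hr ha hℓ hΦm
    rwa [hΦQ] at this
  have hhalf' : ∫⁻ u in Ioo (-U) 0, ENNReal.ofReal (g u) ≤
      ENNReal.ofReal Q ^ (1 / 4 : ℝ) * ENNReal.ofReal Kc ^ (3 / 4 : ℝ) := by
    rw [setLIntegral_Ioo_neg]
    simp_rw [hgdef, Xc_neg]
    exact hhalf
  have h2 : ∫⁻ u in S, ENNReal.ofReal (g u) ≤ ENNReal.ofReal (2 * Q ^ (1 / 4 : ℝ) * Kc ^ (3 / 4 : ℝ)) := by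
    have hcover : S ⊆ Ioo (-U) 0 ∪ Ico 0 U := by
      intro u hu
      rcases lt_or_ge u 0 with h | h
      · exact Or.inl ⟨hu.1, h⟩
      · exact Or.inr ⟨h, hu.2⟩
    have hIco : ∫⁻ u in Ico 0 U, ENNReal.ofReal (g u) = ∫⁻ u in Ioo 0 U, ENNReal.ofReal (g u) :=
      setLIntegral_congr Ioo_ae_eq_Ico.symm
    calc ∫⁻ u in S, ENNReal.ofReal (g u) ≤ ∫⁻ u in Ioo (-U) 0 ∪ Ico 0 U, ENNReal.ofReal (g u) :=
          lintegral_mono_set hcover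
      _ ≤ (∫⁻ u in Ioo (-U) 0, ENNReal.ofReal (g u)) + ∫⁻ u in Ico 0 U, ENNReal.ofReal (g u) :=
          lintegral_union_le _ _ _
      _ ≤ ENNReal.ofReal Q ^ (1 / 4 : ℝ) * ENNReal.ofReal Kc ^ (3 / 4 : ℝ) +
            ENNReal.ofReal Q ^ (1 / 4 : ℝ) * ENNReal.ofReal Kc ^ (3 / 4 : ℝ) := by
          rw [hIco]; exact add_le_add hhalf' hhalf
      _ = ENNReal.ofReal (2 * Q ^ (1 / 4 : ℝ) * Kc ^ (3 / 4 : ℝ)) := by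
          rw [← two_mul, ENNReal.ofReal_rpow_of_nonneg hQ0 (by norm_num),
            ENNReal.ofReal_rpow_of_nonneg hKc0 (by norm_num), ENNReal.ofReal_mul (by positivity),
            ENNReal.ofReal_mul (by positivity), ENNReal.ofReal_ofNat]
          ring
  have h3 : ∫ u in S, g u ≤ 2 * Q ^ (1 / 4 : ℝ) * Kc ^ (3 / 4 : ℝ) := by
    rw [integral_eq_lintegral_of_nonneg_ae (ae_of_all _ hg0) hgint.aestronglyMeasurable]
    exact ENNReal.toReal_le_of_le_ofReal (by positivity) h2
  calc ∫ u in S, pfun u * Real.sqrt ‖F (zbd r a u)‖ ≤ π⁻¹ * ∫ u in S, g u := h1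
    _ ≤ π⁻¹ * (2 * Q ^ (1 / 4 : ℝ) * Kc ^ (3 / 4 : ℝ)) := mul_le_mul_of_nonneg_left h3 (by positivity)
    _ = _ := by ring

/-- `A₀⁴ ≤ 27/(π³ r a²) · Q`. [folklore] -/
theorem A0_pow_four_le {F : ℂ → ℂ} (hF : Continuous F) {M r a ℓ : ℝ} (hr : 0 < r) (ha : 0 < a)
    (hℓ : 0 < ℓ) (hM : ∀ x : ℝ, ‖F x‖ ≤ M) :
    (∫ u in Ioo (-Ucut r a (-ℓ)) (Ucut r a (-ℓ)), pfun u * Real.sqrt ‖F (zbd r a u)‖) ^ 4 ≤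
      27 / (π ^ 3 * r * a ^ 2) * ∫ x in Icc (-ℓ) 0, ‖F x‖ ^ 2 := by
  have h := A0_le hF hr ha hℓ hM
  set U := Ucut r a (-ℓ) with hUdef
  set Q := ∫ x in Icc (-ℓ) 0, ‖F x‖ ^ 2 with hQdef
  set c := 2 * r * a / π with hcdef
  have hc : 0 < c := by positivity
  set Kc := c ^ (-(1 / 3) : ℝ) * (3 / 2 * U ^ (2 / 3 : ℝ)) with hKcdef
  have hU0 : 0 ≤ U := Ucut_nonneg _ _ _
  have hQ0 : 0 ≤ Q := setIntegral_nonneg measurableSet_Icc fun x _ => sq_nonneg _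
  have hKc0 : 0 ≤ Kc := by positivity
  have hA0 : 0 ≤ ∫ u in Ioo (-U) U, pfun u * Real.sqrt ‖F (zbd r a u)‖ :=
    setIntegral_nonneg measurableSet_Ioo fun u _ => mul_nonneg (pfun_pos u).le (Real.sqrt_nonneg _)
  -- `Kc³ = c⁻¹ (27/8) U²` and `U² ≤ a⁻¹`
  have hKc3 : Kc ^ 4 = Kc * (c⁻¹ * (27 / 8 * U ^ 2)) := by
    have e1 : (c ^ (-(1 / 3) : ℝ)) ^ 3 = c⁻¹ := by
      rw [← Real.rpow_natCast, ← Real.rpow_mul hc.le]; norm_num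
      exact Real.rpow_neg_one c
    have e2 : (U ^ (2 / 3 : ℝ)) ^ 3 = U ^ 2 := by
      rw [← Real.rpow_natCast, ← Real.rpow_mul hU0]; norm_num
    calc Kc ^ 4 = Kc * Kc ^ 3 := by ring
      _ = Kc * ((c ^ (-(1 / 3) : ℝ)) ^ 3 * ((3 / 2) ^ 3 * (U ^ (2 / 3 : ℝ)) ^ 3)) := by
          rw [hKcdef]; ring
      _ = _ := by rw [e1, e2]; ring
  have hU2 : U ^ 2 ≤ a⁻¹ := by
    have := Ucut_le_sqrt_inv hr ha hℓ
    rw [← hUdef] at this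
    calc U ^ 2 ≤ Real.sqrt a⁻¹ ^ 2 := pow_le_pow_left₀ hU0 this 2
      _ = a⁻¹ := Real.sq_sqrt (inv_nonneg.2 ha.le)
  -- raise `h` to the fourth power
  have h4 : (∫ u in Ioo (-U) U, pfun u * Real.sqrt ‖F (zbd r a u)‖) ^ 4 ≤
      (2 / π * Q ^ (1 / 4 : ℝ) * Kc ^ (3 / 4 : ℝ)) ^ 4 := pow_le_pow_left₀ hA0 h 4
  have e3 : (2 / π * Q ^ (1 / 4 : ℝ) * Kc ^ (3 / 4 : ℝ)) ^ 4 = (2 / π) ^ 4 * Q * Kc ^ 3 := by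
    have q1 : (Q ^ (1 / 4 : ℝ)) ^ 4 = Q := by
      rw [← Real.rpow_natCast, ← Real.rpow_mul hQ0]; norm_num
    have q2 : (Kc ^ (3 / 4 : ℝ)) ^ 4 = Kc ^ 3 := by
      rw [← Real.rpow_natCast, ← Real.rpow_mul hKc0]; norm_num
    rw [mul_pow, mul_pow, q1, q2]
  rw [e3] at h4
  refine h4.trans ?_
  have hKc3' : Kc ^ 3 ≤ c⁻¹ * (27 / 8 * a⁻¹) := by
    have : Kc ^ 3 = c⁻¹ * (27 / 8 * U ^ 2) := by
      by_cases hK : Kc = 0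
      · -- then `U = 0`
        have hU' : U ^ (2 / 3 : ℝ) = 0 := by
          rw [hKcdef] at hK
          rcases mul_eq_zero.1 hK with h1 | h1
          · exact absurd h1 (Real.rpow_pos_of_pos hc _).ne'
          · linarith
        have hUz : U = 0 := by
          rcases (Real.rpow_eq_zero_iff_of_nonneg hU0).1 hU' with ⟨h1, _⟩
          exact h1
        rw [hK, hUz]; ring
      · have := hKc3
        rw [pow_succ'] at this
        exact mul_left_cancel₀ hK this
    rw [this]; gcongr
  calc (2 / π) ^ 4 * Q * Kc ^ 3 ≤ (2 / π) ^ 4 * Q * (c⁻¹ * (27 / 8 * a⁻¹)) := by gcongr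
    _ = 27 / (π ^ 3 * r * a ^ 2) * Q := by rw [hcdef]; field_simp; ring


/-! #### The bound on `B₀` -/

/-- `e^{-|y|} ≤ 2/(1 + y²)` (from `1 + |y| + y²/2 ≤ e^{|y|}`). [folklore] -/
theorem exp_neg_abs_le (y : ℝ) : Real.exp (-|y|) ≤ 2 * (1 + y ^ 2)⁻¹ := by
  have h := Real.quadratic_le_exp_of_nonneg (abs_nonneg y)
  rw [sq_abs] at h
  have h2 : (1 + y ^ 2) / 2 ≤ Real.exp |y| := by nlinarith [abs_nonneg y]
  calc Real.exp (-|y|) = (Real.exp |y|)⁻¹ := Real.exp_neg _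
    _ ≤ ((1 + y ^ 2) / 2)⁻¹ := inv_anti₀ (by positivity) h2
    _ = 2 * (1 + y ^ 2)⁻¹ := by rw [inv_div]; ring

/-- `x ↦ e^{-|x - t|}` is integrable. [folklore] -/
theorem integrable_exp_neg_abs_sub (t : ℝ) : Integrable fun x : ℝ => Real.exp (-|x - t|) := by
  refine Integrable.mono' ((integrable_inv_one_add_sq.comp_sub_right t).const_mul 2)
    (by fun_prop) (ae_of_all _ fun x => ?_)
  rw [Real.norm_eq_abs, abs_of_pos (Real.exp_pos _)]
  exact exp_neg_abs_le (x - t)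

/-- A bounded measurable function is integrable against `e^{-|x - t|}`. [folklore] -/
theorem integrable_expw_mul {f : ℝ → ℝ} (hf : Measurable f) {C : ℝ} (hC : ∀ x, |f x| ≤ C) (t : ℝ) :
    Integrable fun x => Real.exp (-|x - t|) * f x :=
  (integrable_exp_neg_abs_sub t).mul_bdd (c := C) hf.aestronglyMeasurable
    (ae_of_all _ fun x => by rw [Real.norm_eq_abs]; exact hC x)

/-- Common final step of the four boundary pieces: a Lebesgue integral against a density bounded by
`(C/r) e^{-|x-t|}` on the relevant set is at most `ofReal ((C/r) ∫ e^{-|x-t|} φ)`. [folklore] -/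
theorem lintegral_density_le {D φ : ℝ → ℝ} {s : Set ℝ} {C r t B : ℝ} (hs : MeasurableSet s)
    (hD : ∀ x ∈ s, D x ≤ C / r * Real.exp (-|x - t|)) (hC : 0 ≤ C / r)
    (hφm : Measurable φ) (hφ0 : ∀ x, 0 ≤ φ x) (hφB : ∀ x, φ x ≤ B) :
    ∫⁻ x in s, ENNReal.ofReal (D x) * ENNReal.ofReal (φ x) ≤
      ENNReal.ofReal (C / r * ∫ x, Real.exp (-|x - t|) * φ x) := by
  have hint : Integrable fun x => Real.exp (-|x - t|) * φ x :=
    integrable_expw_mul hφm (C := B) (fun x => by rw [abs_of_nonneg (hφ0 x)]; exact hφB x) t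
  calc ∫⁻ x in s, ENNReal.ofReal (D x) * ENNReal.ofReal (φ x)
      ≤ ∫⁻ x in s, ENNReal.ofReal (C / r * Real.exp (-|x - t|)) * ENNReal.ofReal (φ x) :=
        setLIntegral_mono' hs fun x hx => mul_le_mul' (ENNReal.ofReal_le_ofReal (hD x hx)) le_rfl
    _ ≤ ∫⁻ x, ENNReal.ofReal (C / r * Real.exp (-|x - t|)) * ENNReal.ofReal (φ x) :=
        setLIntegral_le_lintegral _ _
    _ = ∫⁻ x, ENNReal.ofReal (C / r * (Real.exp (-|x - t|) * φ x)) := by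
        refine lintegral_congr fun x => ?_
        rw [← ENNReal.ofReal_mul (by positivity)]; ring_nf
    _ = ENNReal.ofReal (∫ x, C / r * (Real.exp (-|x - t|) * φ x)) := by
        rw [ofReal_integral_eq_lintegral_ofReal (hint.const_mul _)
          (ae_of_all _ fun x => by have := hφ0 x; positivity)]
    _ = _ := by rw [integral_const_mul]

/-- **The bound on `B₀`.** [folklore] -/
theorem B0_le {F : ℂ → ℂ} (hF : Continuous F) {M r t t₀ ℓ : ℝ} (hr : 0 < r) (hr1 : r ≤ 1)
    (ht₀ : 0 < t₀) (ht : t₀ ≤ t) (hℓ : 0 < ℓ) (hM : ∀ z : ℂ, |z.im| ≤ r → ‖F z‖ ≤ M)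
    (a : ℝ) (hadef : a = Real.exp (π * t / r) - 1) :
    ∫ u in (Ioo (-Ucut r a (-ℓ)) (Ucut r a (-ℓ)))ᶜ, pfun u * ‖F (zbd r a u)‖ ^ 2 ≤
      (2 * (2 * Real.sqrt (1 - Real.exp (-(π * t₀))) * Real.sqrt (1 - Real.exp (-(π * ℓ))))⁻¹ +
        (2 * Real.sqrt (1 - Real.exp (-(π * t₀))))⁻¹) / r *
      ∫ x, Real.exp (-|x - t|) * (‖F x‖ ^ 2 + ‖F (x + r * I)‖ ^ 2 + ‖F (x - r * I)‖ ^ 2) := by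
  have ht' : 0 < t := ht₀.trans_le ht
  have ha : 0 < a := by rw [hadef]; exact apar_pos hr ht'
  set U := Ucut r a (-ℓ) with hUdef
  set us := Real.sqrt a⁻¹ with husdef
  set S := Ioo (-U) U with hSdef
  set ct := Real.sqrt (1 - Real.exp (-(π * t₀))) with hct
  set cl := Real.sqrt (1 - Real.exp (-(π * ℓ))) with hcl
  obtain ⟨_, _, _, hct2⟩ := apar_bounds hr hr1 ht₀ ht
  have hcl2 : 0 < 1 - Real.exp (-(π * ℓ)) := by
    have : Real.exp (-(π * ℓ)) < 1 := by rw [Real.exp_lt_one_iff]; nlinarith [pi_pos]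
    linarith
  have hct0 : 0 < ct := Real.sqrt_pos.2 hct2
  have hcl0 : 0 < cl := Real.sqrt_pos.2 hcl2
  set Cc := (2 * ct * cl)⁻¹ with hCc
  set Ce := (2 * ct)⁻¹ with hCe
  have hCc0 : 0 < Cc := by positivity
  have hCe0 : 0 < Ce := by positivity
  have hUus : U ≤ us := Ucut_le_sqrt_inv hr ha hℓ
  have hU0 : 0 < U := Ucut_pos hr ha (by linarith)
  have hus0 : 0 < us := hU0.trans_le hUus
  have hM0 : 0 ≤ M := (norm_nonneg _).trans (hM 0 (by simp [hr.le]))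
  -- the densities
  have hDc : ∀ x ∈ Iic (-ℓ), |UD r a x| * pfun (Ucut r a x) ≤ Cc / r * Real.exp (-|x - t|) := by
    intro x hx
    have := cut_density_le hr hr1 ht₀ ht hℓ (mem_Iic.1 hx)
    rw [← hadef] at this
    convert this using 2
    rw [hCc, div_eq_mul_inv, ← mul_inv]
  have hDe : ∀ x ∈ (univ : Set ℝ), |VD r a x| * pfun (Vedge r a x) ≤ Ce / r * Real.exp (-|x - t|) := by
    intro x _
    have := edge_density_le hr hr1 ht₀ ht x
    rw [← hadef] at this
    convert this using 2
    rw [hCe, div_eq_mul_inv, ← mul_inv]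
  -- the boundary functions
  set φ₁ : ℝ → ℝ := fun x => ‖F x‖ ^ 2 with hφ₁
  set φ₃ : ℝ → ℝ := fun x => ‖F (x - r * I)‖ ^ 2 with hφ₃
  set φ₄ : ℝ → ℝ := fun x => ‖F (x + r * I)‖ ^ 2 with hφ₄
  have hφ₁m : Measurable φ₁ := (hF.measurable.comp Complex.measurable_ofReal).norm.pow_const 2
  have hφ₃m : Measurable φ₃ :=
    (hF.measurable.comp (Complex.measurable_ofReal.sub_const _)).norm.pow_const 2
  have hφ₄m : Measurable φ₄ :=
    (hF.measurable.comp (Complex.measurable_ofReal.add_const _)).norm.pow_const 2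
  have hφ₁B : ∀ x, φ₁ x ≤ M ^ 2 := fun x =>
    pow_le_pow_left₀ (norm_nonneg _) (hM _ (by simp [hr.le])) 2
  have hφ₃B : ∀ x, φ₃ x ≤ M ^ 2 := fun x =>
    pow_le_pow_left₀ (norm_nonneg _) (hM _ (by simp [abs_of_pos hr])) 2
  have hφ₄B : ∀ x, φ₄ x ≤ M ^ 2 := fun x =>
    pow_le_pow_left₀ (norm_nonneg _) (hM _ (by simp [abs_of_pos hr])) 2
  set W₀ := ∫ x, Real.exp (-|x - t|) * φ₁ x with hW₀
  set W₃ := ∫ x, Real.exp (-|x - t|) * φ₃ x with hW₃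
  set W₄ := ∫ x, Real.exp (-|x - t|) * φ₄ x with hW₄
  have hWnn : ∀ (φ : ℝ → ℝ), (∀ x, 0 ≤ φ x) → 0 ≤ ∫ x, Real.exp (-|x - t|) * φ x := fun φ hφ =>
    integral_nonneg fun x => mul_nonneg (Real.exp_pos _).le (hφ x)
  have hW₀0 : 0 ≤ W₀ := hWnn φ₁ fun x => sq_nonneg _
  have hW₃0 : 0 ≤ W₃ := hWnn φ₃ fun x => sq_nonneg _
  have hW₄0 : 0 ≤ W₄ := hWnn φ₄ fun x => sq_nonneg _
  -- the integrand
  set ψ : ℝ → ℝ≥0∞ := fun u => ENNReal.ofReal (pfun u * ‖F (zbd r a u)‖ ^ 2) with hψ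
  -- piece 1: `Ico U us`
  have hP1 : ∫⁻ u in Ico U us, ψ u ≤ ENNReal.ofReal (Cc / r * W₀) := by
    have hcongr : ∀ u ∈ Ico U us, ψ u = ENNReal.ofReal (pfun u) * ENNReal.ofReal (φ₁ (Xc r a u)) := by
      intro u hu
      have hu0 : 0 ≤ u := hU0.le.trans hu.1
      have hlt : a * u ^ 2 < 1 := (sq_lt_inv_iff ha).2 (by rw [abs_of_nonneg hu0]; exact hu.2)
      simp only [hψ, hφ₁, zbd_of_lt hlt]
      rw [ENNReal.ofReal_mul (pfun_pos u).le]
    rw [setLIntegral_congr_fun measurableSet_Ico hcongr]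
    refine (lintegral_farcut_le hr ha hℓ (fun x => ENNReal.ofReal (φ₁ x))).trans ?_
    exact lintegral_density_le measurableSet_Iic hDc (by positivity) hφ₁m (fun x => sq_nonneg _) hφ₁B
  -- piece 2: `Ioc (-us) (-U)`
  have hP2 : ∫⁻ u in Ioc (-us) (-U), ψ u ≤ ENNReal.ofReal (Cc / r * W₀) := by
    have hcongr : ∀ u ∈ Ioc (-us) (-U), ψ u = ENNReal.ofReal (pfun u) * ENNReal.ofReal (φ₁ (Xc r a u)) := by
      intro u hu
      have hu0 : u < 0 := lt_of_le_of_lt hu.2 (by linarith)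
      have hlt : a * u ^ 2 < 1 := (sq_lt_inv_iff ha).2 (by rw [abs_of_neg hu0]; linarith [hu.1])
      simp only [hψ, hφ₁, zbd_of_lt hlt]
      rw [ENNReal.ofReal_mul (pfun_pos u).le]
    rw [setLIntegral_congr_fun measurableSet_Ioc hcongr]
    refine (lintegral_farcut_neg_le hr ha hℓ (fun x => ENNReal.ofReal (φ₁ x))).trans ?_
    exact lintegral_density_le measurableSet_Iic hDc (by positivity) hφ₁m (fun x => sq_nonneg _) hφ₁B
  -- piece 3: `Ioi us`
  have hP3 : ∫⁻ u in Ioi us, ψ u ≤ ENNReal.ofReal (Ce / r * W₃) := by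
    have hcongr : ∀ u ∈ Ioi us, ψ u = ENNReal.ofReal (pfun u) * ENNReal.ofReal (φ₃ (Xe r a u)) := by
      intro u hu
      have hu0 : 0 < u := hus0.trans hu
      have hgt : 1 < a * u ^ 2 := (one_lt_sq_iff ha).2 (by rw [abs_of_pos hu0]; exact hu)
      simp only [hψ, hφ₃, zbd_of_gt_pos hgt hu0]
      rw [ENNReal.ofReal_mul (pfun_pos u).le]
    rw [setLIntegral_congr_fun measurableSet_Ioi hcongr]
    refine (lintegral_edge_le hr ha (fun x => ENNReal.ofReal (φ₃ x))).trans ?_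
    rw [← setLIntegral_univ]
    exact lintegral_density_le MeasurableSet.univ hDe (by positivity) hφ₃m (fun x => sq_nonneg _) hφ₃B
  -- piece 4: `Iio (-us)`
  have hP4 : ∫⁻ u in Iio (-us), ψ u ≤ ENNReal.ofReal (Ce / r * W₄) := by
    have hcongr : ∀ u ∈ Iio (-us), ψ u = ENNReal.ofReal (pfun u) * ENNReal.ofReal (φ₄ (Xe r a u)) := by
      intro u hu
      have hu0 : u < 0 := by rw [mem_Iio] at hu; linarith
      have hgt : 1 < a * u ^ 2 := (one_lt_sq_iff ha).2 (by rw [abs_of_neg hu0]; rw [mem_Iio] at hu; linarith)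
      simp only [hψ, hφ₄, zbd_of_gt_neg hgt hu0]
      rw [ENNReal.ofReal_mul (pfun_pos u).le]
    rw [setLIntegral_congr_fun measurableSet_Iio hcongr]
    refine (lintegral_edge_neg_le hr ha (fun x => ENNReal.ofReal (φ₄ x))).trans ?_
    rw [← setLIntegral_univ]
    exact lintegral_density_le MeasurableSet.univ hDe (by positivity) hφ₄m (fun x => sq_nonneg _) hφ₄B
  -- covering `Sᶜ`
  have hcov1 : Sᶜ ⊆ Iic (-U) ∪ Ici U := compl_Ioo_subset _ _
  have hcov2 : Ici U ⊆ Ico U us ∪ Ici us := fun u hu => by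
    rcases lt_or_ge u us with h | h
    · exact Or.inl ⟨hu, h⟩
    · exact Or.inr h
  have hcov3 : Iic (-U) ⊆ Iic (-us) ∪ Ioc (-us) (-U) := fun u hu => by
    rcases le_or_gt u (-us) with h | h
    · exact Or.inl h
    · exact Or.inr ⟨h, hu⟩
  have htot : ∫⁻ u in Sᶜ, ψ u ≤ ENNReal.ofReal (Ce / r * W₄) + ENNReal.ofReal (Cc / r * W₀) +
      (ENNReal.ofReal (Cc / r * W₀) + ENNReal.ofReal (Ce / r * W₃)) := by
    calc ∫⁻ u in Sᶜ, ψ u ≤ ∫⁻ u in Iic (-U) ∪ Ici U, ψ u := lintegral_mono_set hcov1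
      _ ≤ (∫⁻ u in Iic (-U), ψ u) + ∫⁻ u in Ici U, ψ u := lintegral_union_le _ _ _
      _ ≤ (∫⁻ u in Iic (-us) ∪ Ioc (-us) (-U), ψ u) + ∫⁻ u in Ico U us ∪ Ici us, ψ u :=
          add_le_add (lintegral_mono_set hcov3) (lintegral_mono_set hcov2)
      _ ≤ ((∫⁻ u in Iic (-us), ψ u) + ∫⁻ u in Ioc (-us) (-U), ψ u) +
            ((∫⁻ u in Ico U us, ψ u) + ∫⁻ u in Ici us, ψ u) :=
          add_le_add (lintegral_union_le _ _ _) (lintegral_union_le _ _ _)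
      _ = ((∫⁻ u in Iio (-us), ψ u) + ∫⁻ u in Ioc (-us) (-U), ψ u) +
            ((∫⁻ u in Ico U us, ψ u) + ∫⁻ u in Ioi us, ψ u) := by
          rw [setLIntegral_congr (Iio_ae_eq_Iic (a := -us)).symm,
            setLIntegral_congr (Ioi_ae_eq_Ici (a := us)).symm]
      _ ≤ _ := add_le_add (add_le_add hP4 hP2) (add_le_add hP1 hP3)
  -- back to real numbers
  have hB0 : ∫ u in Sᶜ, pfun u * ‖F (zbd r a u)‖ ^ 2 = (∫⁻ u in Sᶜ, ψ u).toReal := by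
    rw [integral_eq_lintegral_of_nonneg_ae]
    · exact ae_of_all _ fun u => mul_nonneg (pfun_pos u).le (sq_nonneg _)
    · exact (measurable_pfun.mul
        ((hF.measurable.comp (measurable_zbd r a)).norm.pow_const 2)).aestronglyMeasurable
  rw [hB0]
  have hsum_nonneg : 0 ≤ Ce / r * W₄ + Cc / r * W₀ + (Cc / r * W₀ + Ce / r * W₃) := by positivity
  refine ENNReal.toReal_le_of_le_ofReal (by positivity) (htot.trans ?_)
  rw [← ENNReal.ofReal_add (by positivity) (by positivity), ← ENNReal.ofReal_add (by positivity) (by positivity),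
    ← ENNReal.ofReal_add (by positivity) (by positivity)]
  refine ENNReal.ofReal_le_ofReal ?_
  -- `W = W₀ + W₄ + W₃`
  have hint : ∀ (φ : ℝ → ℝ), Measurable φ → (∀ x, 0 ≤ φ x) → (∀ x, φ x ≤ M ^ 2) →
      Integrable fun x => Real.exp (-|x - t|) * φ x := fun φ hφm hφ0 hφB =>
    integrable_expw_mul hφm (C := M ^ 2) (fun x => by rw [abs_of_nonneg (hφ0 x)]; exact hφB x) t
  have hW : ∫ x, Real.exp (-|x - t|) * (‖F x‖ ^ 2 + ‖F (x + r * I)‖ ^ 2 + ‖F (x - r * I)‖ ^ 2) =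
      W₀ + W₄ + W₃ := by
    have e : ∀ x, Real.exp (-|x - t|) * (‖F x‖ ^ 2 + ‖F (x + r * I)‖ ^ 2 + ‖F (x - r * I)‖ ^ 2) =
        Real.exp (-|x - t|) * φ₁ x + Real.exp (-|x - t|) * φ₄ x + Real.exp (-|x - t|) * φ₃ x := by
      intro x; simp only [hφ₁, hφ₃, hφ₄]; ring
    simp_rw [e]
    rw [integral_add, integral_add]
    · exact hint φ₁ hφ₁m (fun x => sq_nonneg _) hφ₁B
    · exact hint φ₄ hφ₄m (fun x => sq_nonneg _) hφ₄B
    · exact (hint φ₁ hφ₁m (fun x => sq_nonneg _) hφ₁B).add (hint φ₄ hφ₄m (fun x => sq_nonneg _) hφ₄B)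
    · exact hint φ₃ hφ₃m (fun x => sq_nonneg _) hφ₃B
  rw [hW]
  have hr' : 0 < r⁻¹ := inv_pos.2 hr
  have e2 : Ce / r * W₄ + Cc / r * W₀ + (Cc / r * W₀ + Ce / r * W₃) =
      r⁻¹ * (2 * Cc * W₀ + Ce * W₄ + Ce * W₃) := by field_simp; ring
  have e3 : (2 * Cc + Ce) / r * (W₀ + W₄ + W₃) = r⁻¹ * ((2 * Cc + Ce) * (W₀ + W₄ + W₃)) := by
    field_simp
  rw [e2, e3]
  refine mul_le_mul_of_nonneg_left ?_ hr'.le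
  nlinarith [mul_nonneg hCc0.le hW₄0, mul_nonneg hCc0.le hW₃0, mul_nonneg hCe0.le hW₀0]


/-! #### `Q ≤ e² W₀` and the final algebra -/

/-- `∫_{[-ℓ,0]} ‖F‖² ≤ e² W₀(t)` for `ℓ, t ≤ 1` (the weight `e^{-|x-t|}` is at least `e^{-2}` on the slit). [folklore] -/
theorem Q_le {F : ℂ → ℂ} (hF : Continuous F) {M t ℓ : ℝ} (hℓ1 : ℓ ≤ 1) (ht : 0 < t)
    (ht1 : t ≤ 1) (hM : ∀ x : ℝ, ‖F x‖ ≤ M) :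
    ∫ x in Icc (-ℓ) 0, ‖F x‖ ^ 2 ≤ Real.exp 2 * ∫ x, Real.exp (-|x - t|) * ‖F x‖ ^ 2 := by
  have hM0 : 0 ≤ M := (norm_nonneg _).trans (hM 0)
  have hφm : Measurable fun x : ℝ => ‖F x‖ ^ 2 :=
    (hF.measurable.comp Complex.measurable_ofReal).norm.pow_const 2
  have hint : Integrable fun x => Real.exp (-|x - t|) * ‖F x‖ ^ 2 :=
    integrable_expw_mul hφm (C := M ^ 2)
      (fun x => by rw [abs_of_nonneg (sq_nonneg _)]; exact pow_le_pow_left₀ (norm_nonneg _) (hM x) 2) t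
  have h1 : ∫ x in Icc (-ℓ) 0, ‖F x‖ ^ 2 ≤
      ∫ x in Icc (-ℓ) 0, Real.exp 2 * (Real.exp (-|x - t|) * ‖F x‖ ^ 2) := by
    refine setIntegral_mono_on (Continuous.integrableOn_Icc (by fun_prop))
      ((hint.const_mul _).integrableOn) measurableSet_Icc fun x hx => ?_
    have habs : |x - t| ≤ 2 := by
      rw [abs_le]; constructor <;> linarith [hx.1, hx.2]
    have : 1 ≤ Real.exp 2 * Real.exp (-|x - t|) := by
      rw [← Real.exp_add]; apply Real.one_le_exp; linarith
    nlinarith [sq_nonneg ‖F x‖]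
  refine h1.trans ?_
  rw [integral_const_mul]
  refine mul_le_mul_of_nonneg_left ?_ (Real.exp_pos _).le
  exact setIntegral_le_integral hint (ae_of_all _ fun x => mul_nonneg (Real.exp_pos _).le (sq_nonneg _))

/-- `x^s ≤ max 1 x` for `x ≥ 0`, `0 ≤ s ≤ 1`. [folklore] -/
theorem rpow_le_max_one {x s : ℝ} (hx : 0 ≤ x) (hs0 : 0 ≤ s) (hs1 : s ≤ 1) : x ^ s ≤ max 1 x := by
  rcases le_or_gt x 1 with h | h
  · exact (Real.rpow_le_one hx h hs0).trans (le_max_left _ _)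
  · refine (Real.rpow_le_rpow_of_exponent_le h.le hs1).trans ?_
    rw [Real.rpow_one]; exact le_max_right _ _

/-- Bookkeeping of constants: from `A⁴ ≤ C_A Q`, `B ≤ (C_B/r) W`, `Q ≤ e² W` and `κ ≤ k ≤ 1` to `A^{4k} (2B)^{1-k} ≤ (C/r) Q^κ W^{1-κ}`. [folklore] -/
theorem final_algebra {A B Q W CA CB κ k r : ℝ} (hA : 0 ≤ A) (hB : 0 ≤ B) (hQ : 0 ≤ Q)
    (hW : 0 ≤ W) (hCA : 0 ≤ CA) (hCB : 0 ≤ CB) (hr : 0 < r) (hr1 : r ≤ 1) (hκ : 0 < κ)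
    (hκk : κ ≤ k) (hk1 : k ≤ 1) (h1 : A ^ 4 ≤ CA * Q) (h2 : B ≤ CB / r * W)
    (h3 : Q ≤ Real.exp 2 * W) :
    A ^ (4 * k) * (2 * B) ^ (1 - k) ≤
      max 1 CA * (CA * Real.exp 2 + 2 * CB + 1) / r * Q ^ κ * W ^ (1 - κ) := by
  set D := CA * Real.exp 2 + 2 * CB with hD
  have hD0 : 0 ≤ D := by positivity
  have step1 := rpow_mul_rpow_le_of_le hA (by positivity : (0 : ℝ) ≤ 2 * B) hκ.le hκk hk1
  refine step1.trans ?_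
  have hsum : A ^ 4 + 2 * B ≤ D / r * W := by
    have e1 : CA * Q ≤ CA * Real.exp 2 * W / r := by
      calc CA * Q ≤ CA * (Real.exp 2 * W) := mul_le_mul_of_nonneg_left h3 hCA
        _ = CA * Real.exp 2 * W * 1 := by ring
        _ ≤ CA * Real.exp 2 * W * r⁻¹ := by
            refine mul_le_mul_of_nonneg_left (one_le_inv_iff₀.2 ⟨hr, hr1⟩) (by positivity)
        _ = CA * Real.exp 2 * W / r := by rw [div_eq_mul_inv]
    have e2 : 2 * B ≤ 2 * CB / r * W := by
      calc 2 * B ≤ 2 * (CB / r * W) := by linarith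
        _ = 2 * CB / r * W := by ring
    calc A ^ 4 + 2 * B ≤ CA * Real.exp 2 * W / r + 2 * CB / r * W := by linarith
      _ = D / r * W := by rw [hD]; field_simp
  have hκ1 : κ ≤ 1 := hκk.trans hk1
  have step2 : (A ^ 4) ^ κ ≤ (CA * Q) ^ κ := Real.rpow_le_rpow (by positivity) h1 hκ.le
  have step3 : (A ^ 4 + 2 * B) ^ (1 - κ) ≤ (D / r * W) ^ (1 - κ) :=
    Real.rpow_le_rpow (by positivity) hsum (by linarith)
  have step4 : (CA * Q) ^ κ ≤ max 1 CA * Q ^ κ := by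
    rw [Real.mul_rpow hCA hQ]
    exact mul_le_mul_of_nonneg_right (rpow_le_max_one hCA hκ.le hκ1) (Real.rpow_nonneg hQ _)
  have step5 : (D / r * W) ^ (1 - κ) ≤ (D + 1) / r * W ^ (1 - κ) := by
    rw [Real.mul_rpow (by positivity) hW]
    refine mul_le_mul_of_nonneg_right ?_ (Real.rpow_nonneg hW _)
    refine (rpow_le_max_one (by positivity) (by linarith) (by linarith)).trans (max_le ?_ ?_)
    · rw [le_div_iff₀ hr]; linarith
    · exact div_le_div_of_nonneg_right (by linarith) hr.le
  calc (A ^ 4) ^ κ * (A ^ 4 + 2 * B) ^ (1 - κ) ≤ (max 1 CA * Q ^ κ) * ((D + 1) / r * W ^ (1 - κ)) :=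
        mul_le_mul (step2.trans step4) (step3.trans step5) (Real.rpow_nonneg (by positivity) _)
          (by positivity)
    _ = _ := by rw [hD]; ring

/-- `1/(r a²) ≤ e^{-1}/(2π t₀ c_t⁴)` for `a = e^{πt/r} - 1`. [folklore] -/
theorem inv_r_apar_sq_le (hr : 0 < r) (hr1 : r ≤ 1) {t₀ t : ℝ} (ht₀ : 0 < t₀) (ht : t₀ ≤ t) :
    (r * (Real.exp (π * t / r) - 1) ^ 2)⁻¹ ≤
      Real.exp (-1) / (2 * π * t₀ * (1 - Real.exp (-(π * t₀))) ^ 2) := by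
  obtain ⟨ha1, _, ha, hct⟩ := apar_bounds hr hr1 ht₀ ht
  set a := Real.exp (π * t / r) - 1 with hadef
  set c2 := 1 - Real.exp (-(π * t₀)) with hc2
  -- `a ≥ c2 e^{π t₀ / r}`
  have h1 : c2 * Real.exp (π * t₀ / r) ≤ a := by
    refine le_trans (mul_le_mul_of_nonneg_left (Real.exp_le_exp.2 ?_) hct.le) ha1
    exact div_le_div_of_nonneg_right (by nlinarith [pi_pos]) hr.le
  set y := 2 * π * t₀ / r with hy
  have hy0 : 0 < y := by positivity
  have h2 : (c2 * Real.exp (π * t₀ / r)) ^ 2 = c2 ^ 2 * Real.exp y := by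
    rw [mul_pow, ← Real.exp_nat_mul]; congr 2; rw [hy]; push_cast; ring
  have h3 : c2 ^ 2 * Real.exp y ≤ a ^ 2 := by
    rw [← h2]; exact pow_le_pow_left₀ (by positivity) h1 2
  -- `y e^{-y} ≤ e^{-1}`
  have h4 : y * Real.exp (-y) ≤ Real.exp (-1) := by
    have := Real.add_one_le_exp (y - 1)
    rw [sub_add_cancel] at this
    calc y * Real.exp (-y) ≤ Real.exp (y - 1) * Real.exp (-y) :=
          mul_le_mul_of_nonneg_right this (Real.exp_pos _).le
      _ = Real.exp (-1) := by rw [← Real.exp_add]; congr 1; ring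
  have hr_eq : r = 2 * π * t₀ / y := by rw [hy]; field_simp
  calc (r * a ^ 2)⁻¹ ≤ (r * (c2 ^ 2 * Real.exp y))⁻¹ := by
        refine inv_anti₀ (by positivity) (mul_le_mul_of_nonneg_left h3 hr.le)
    _ = y * Real.exp (-y) / (2 * π * t₀ * c2 ^ 2) := by
        rw [hr_eq, Real.exp_neg]; field_simp
    _ ≤ Real.exp (-1) / (2 * π * t₀ * c2 ^ 2) := div_le_div_of_nonneg_right h4 (by positivity)

/-- **The pointwise estimate** (BD18, proof of Lemma 3.2, the display before "Integrating in
`t ∈ I ∖ I''`"), in normalised coordinates: slit `[-ℓ, 0]`, point `t ∈ [t₀, 1]`, strip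
half-width `r ∈ (0, 1]`. [cite: BourgainDyatlov2018, Lemma 3.2] -/
theorem norm_sq_le_pointwise {ℓ t₀ : ℝ} (hℓ : 0 < ℓ) (hℓ1 : ℓ ≤ 1) (ht₀ : 0 < t₀) :
    ∃ C : ℝ, 0 < C ∧ ∀ r : ℝ, 0 < r → r ≤ 1 → ∀ t : ℝ, t₀ ≤ t → t ≤ 1 →
      ∀ F : ℂ → ℂ, Differentiable ℂ F → ∀ M : ℝ, (∀ z : ℂ, |z.im| ≤ r → ‖F z‖ ≤ M) →
      ∀ κ : ℝ, 0 < κ → κ ≤ Real.exp (-C / r) →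
        ‖F t‖ ^ 2 ≤ C / r * (∫ x in Icc (-ℓ) 0, ‖F x‖ ^ 2) ^ κ *
          (∫ x, Real.exp (-|x - t|) *
            (‖F x‖ ^ 2 + ‖F (x + r * I)‖ ^ 2 + ‖F (x - r * I)‖ ^ 2)) ^ (1 - κ) := by
  set ct := Real.sqrt (1 - Real.exp (-(π * t₀))) with hct
  set cl := Real.sqrt (1 - Real.exp (-(π * ℓ))) with hcl
  have hct2 : 0 < 1 - Real.exp (-(π * t₀)) := by
    have : Real.exp (-(π * t₀)) < 1 := by rw [Real.exp_lt_one_iff]; nlinarith [pi_pos]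
    linarith
  have hcl2 : 0 < 1 - Real.exp (-(π * ℓ)) := by
    have : Real.exp (-(π * ℓ)) < 1 := by rw [Real.exp_lt_one_iff]; nlinarith [pi_pos]
    linarith
  have hct0 : 0 < ct := Real.sqrt_pos.2 hct2
  have hcl0 : 0 < cl := Real.sqrt_pos.2 hcl2
  set Cκ := π / 2 + Real.log (π / cl) with hCκ
  have hCκ0 : 0 < Cκ := by
    have hcl1 : cl < 1 := by rw [hcl, Real.sqrt_lt' one_pos]; linarith [Real.exp_pos (-(π * ℓ))]
    have : 0 < Real.log (π / cl) := by
      apply Real.log_pos; rw [lt_div_iff₀ hcl0]; nlinarith [Real.two_le_pi]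
    positivity
  set CA := 27 / π ^ 3 * (Real.exp (-1) / (2 * π * t₀ * (1 - Real.exp (-(π * t₀))) ^ 2)) with hCA
  have hCA0 : 0 ≤ CA := by positivity
  set CB := 2 * (2 * ct * cl)⁻¹ + (2 * ct)⁻¹ with hCB
  have hCB0 : 0 ≤ CB := by positivity
  set E5 := Real.exp (Real.exp (-1)) ^ 5 with hE5
  set CP := E5 * (max 1 CA * (CA * Real.exp 2 + 2 * CB + 1)) with hCP
  have hCP0 : 0 < CP := by positivity
  refine ⟨max Cκ CP, lt_max_of_lt_left hCκ0, ?_⟩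
  intro r hr hr1 t ht ht1 F hF M hM κ hκ hκC
  have ht' : 0 < t := ht₀.trans_le ht
  set a := Real.exp (π * t / r) - 1 with hadef
  have ha : 0 < a := apar_pos hr ht'
  set U := Ucut r a (-ℓ) with hUdef
  set k := 2 / π * Real.arctan U with hkdef
  set Q := ∫ x in Icc (-ℓ) 0, ‖F x‖ ^ 2 with hQdef
  set W := ∫ x, Real.exp (-|x - t|) * (‖F x‖ ^ 2 + ‖F (x + r * I)‖ ^ 2 + ‖F (x - r * I)‖ ^ 2)
    with hWdef
  have hMx : ∀ x : ℝ, ‖F x‖ ≤ M := fun x => hM x (by simp [hr.le])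
  -- `κ ≤ k ≤ 1`
  have hk1 : k ≤ 1 := by
    have h1 : Real.arctan U < π / 2 := Real.arctan_lt_pi_div_two U
    have : 2 / π * Real.arctan U ≤ 2 / π * (π / 2) := mul_le_mul_of_nonneg_left h1.le (by positivity)
    rw [hkdef]; refine this.trans (le_of_eq ?_); field_simp
  have hκk : κ ≤ k := by
    refine hκC.trans (le_trans ?_ (slit_mass_ge hr hr1 ht' ht1 hℓ))
    rw [Real.exp_le_exp, neg_div, neg_le_neg_iff]
    exact div_le_div_of_nonneg_right (le_max_left _ _) hr.le
  -- the main inequality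
  have hmain := sq_norm_le_A_B hF hr ht' hℓ hM a U hadef hUdef
  set A₀ := ∫ u in Ioo (-U) U, pfun u * Real.sqrt ‖F (zbd r a u)‖ with hA₀
  set B₀ := ∫ u in (Ioo (-U) U)ᶜ, pfun u * ‖F (zbd r a u)‖ ^ 2 with hB₀
  have hA₀0 : 0 ≤ A₀ :=
    setIntegral_nonneg measurableSet_Ioo fun u _ => mul_nonneg (pfun_pos u).le (Real.sqrt_nonneg _)
  have hB₀0 : 0 ≤ B₀ :=
    setIntegral_nonneg measurableSet_Ioo.compl fun u _ => mul_nonneg (pfun_pos u).le (sq_nonneg _)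
  have hQ0 : 0 ≤ Q := setIntegral_nonneg measurableSet_Icc fun x _ => sq_nonneg _
  have hW0 : 0 ≤ W := integral_nonneg fun x => by positivity
  -- `A₀⁴ ≤ CA Q`
  have h1 : A₀ ^ 4 ≤ CA * Q := by
    have h := A0_pow_four_le hF.continuous hr ha hℓ hMx
    rw [← hUdef] at h
    refine h.trans (mul_le_mul_of_nonneg_right ?_ hQ0)
    have := inv_r_apar_sq_le hr hr1 ht₀ ht
    rw [← hadef] at this
    calc 27 / (π ^ 3 * r * a ^ 2) = 27 / π ^ 3 * (r * a ^ 2)⁻¹ := by field_simp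
      _ ≤ CA := mul_le_mul_of_nonneg_left this (by positivity)
  -- `B₀ ≤ CB / r W`
  have h2 : B₀ ≤ CB / r * W := by
    have h := B0_le hF.continuous hr hr1 ht₀ ht hℓ hM a hadef
    rw [← hUdef] at h
    exact h
  -- `Q ≤ e² W`
  have h3 : Q ≤ Real.exp 2 * W := by
    refine (Q_le hF.continuous hℓ1 ht' ht1 hMx).trans (mul_le_mul_of_nonneg_left ?_ (Real.exp_pos _).le)
    have hφm : Measurable fun x : ℝ => ‖F x‖ ^ 2 :=
      (hF.continuous.measurable.comp Complex.measurable_ofReal).norm.pow_const 2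
    have hint : Integrable fun x => Real.exp (-|x - t|) * ‖F x‖ ^ 2 :=
      integrable_expw_mul hφm (C := M ^ 2)
        (fun x => by rw [abs_of_nonneg (sq_nonneg _)]; exact pow_le_pow_left₀ (norm_nonneg _) (hMx x) 2) t
    by_cases hWint : Integrable fun x => Real.exp (-|x - t|) *
        (‖F x‖ ^ 2 + ‖F (x + r * I)‖ ^ 2 + ‖F (x - r * I)‖ ^ 2)
    · refine integral_mono hint hWint fun x => ?_
      have := Real.exp_pos (-|x - t|)
      nlinarith [sq_nonneg ‖F (x + r * I)‖, sq_nonneg ‖F (x - r * I)‖]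
    · -- cannot happen, but the inequality needed also follows from `B0_le`'s proof pattern;
      -- we simply prove integrability
      exfalso; apply hWint
      have hb : ∀ (c : ℂ), |c.im| ≤ r → Integrable fun x : ℝ => Real.exp (-|x - t|) * ‖F (x + c)‖ ^ 2 := by
        intro c hc
        refine integrable_expw_mul ((hF.continuous.measurable.comp
          (Complex.measurable_ofReal.add_const _)).norm.pow_const 2) (C := M ^ 2) (fun x => ?_) t
        rw [abs_of_nonneg (sq_nonneg _)]
        exact pow_le_pow_left₀ (norm_nonneg _) (hM _ (by simpa using hc)) 2
      have e : (fun x : ℝ => Real.exp (-|x - t|) * (‖F x‖ ^ 2 + ‖F (x + r * I)‖ ^ 2 + ‖F (x - r * I)‖ ^ 2)) =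
          fun x : ℝ => Real.exp (-|x - t|) * ‖F (x + (0 : ℂ))‖ ^ 2 +
            Real.exp (-|x - t|) * ‖F (x + r * I)‖ ^ 2 + Real.exp (-|x - t|) * ‖F (x + (-(r * I)))‖ ^ 2 := by
        ext x; simp only [add_zero, ← sub_eq_add_neg]; ring
      rw [e]
      exact ((hb 0 (by simp [hr.le])).add (hb _ (by simp [abs_of_pos hr]))).add
        (hb _ (by simp [abs_of_pos hr]))
  have halg := final_algebra hA₀0 hB₀0 hQ0 hW0 hCA0 hCB0 hr hr1 hκ hκk hk1 h1 h2 h3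
  have hE50 : 0 ≤ E5 := by positivity
  calc ‖F t‖ ^ 2 ≤ E5 * (A₀ ^ (4 * k) * (2 * B₀) ^ (1 - k)) := hmain
    _ ≤ E5 * (max 1 CA * (CA * Real.exp 2 + 2 * CB + 1) / r * Q ^ κ * W ^ (1 - κ)) :=
        mul_le_mul_of_nonneg_left halg hE50
    _ = CP / r * (Q ^ κ * W ^ (1 - κ)) := by rw [hCP]; ring
    _ ≤ max Cκ CP / r * (Q ^ κ * W ^ (1 - κ)) := by
        refine mul_le_mul_of_nonneg_right (div_le_div_of_nonneg_right (le_max_right _ _) hr.le) ?_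
        positivity
    _ = _ := by ring

end Pointwise


/-! ### From the pointwise estimate to the cells `[j, j+1]` -/

section Cells

variable {F : ℂ → ℂ} {M r : ℝ}

/-- The weight `W(t) = ∫ e^{-|x-t|} (‖F x‖² + ‖F(x+ir)‖² + ‖F(x-ir)‖²) dx`. [folklore] -/
def Wfun (F : ℂ → ℂ) (r t : ℝ) : ℝ :=
  ∫ x : ℝ, Real.exp (-|x - t|) * (‖F x‖ ^ 2 + ‖F (x + r * I)‖ ^ 2 + ‖F (x - r * I)‖ ^ 2)

/-- The three-line profile `S(x) = ‖F x‖² + ‖F(x+ir)‖² + ‖F(x-ir)‖²`. [folklore] -/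
def Sfun (F : ℂ → ℂ) (r x : ℝ) : ℝ := ‖F x‖ ^ 2 + ‖F (x + r * I)‖ ^ 2 + ‖F (x - r * I)‖ ^ 2

/-- `S ≥ 0`. [folklore] -/
theorem Sfun_nonneg (F : ℂ → ℂ) (r x : ℝ) : 0 ≤ Sfun F r x := by unfold Sfun; positivity

/-- `S ≤ 3M²` when `‖F‖ ≤ M` on the closed strip. [folklore] -/
theorem Sfun_le (hr : 0 < r) (hM : ∀ z : ℂ, |z.im| ≤ r → ‖F z‖ ≤ M) (x : ℝ) :
    Sfun F r x ≤ 3 * M ^ 2 := by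
  have h1 : ‖F x‖ ≤ M := hM _ (by simp [hr.le])
  have h2 : ‖F (x + r * I)‖ ≤ M := hM _ (by simp [abs_of_pos hr])
  have h3 : ‖F (x - r * I)‖ ≤ M := hM _ (by simp [abs_of_pos hr])
  unfold Sfun
  nlinarith [norm_nonneg (F x), norm_nonneg (F (x + r * I)), norm_nonneg (F (x - r * I))]

/-- `S` is continuous. [folklore] -/
theorem continuous_Sfun (hF : Continuous F) (r : ℝ) : Continuous (Sfun F r) := by
  unfold Sfun; fun_prop

/-- `S` is measurable. [folklore] -/
theorem measurable_Sfun (hF : Continuous F) (r : ℝ) : Measurable (Sfun F r) :=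
  (continuous_Sfun hF r).measurable

/-- `W(t) = ∫ e^{-|x-t|} S(x) dx`. [folklore] -/
theorem Wfun_eq (F : ℂ → ℂ) (r t : ℝ) : Wfun F r t = ∫ x : ℝ, Real.exp (-|x - t|) * Sfun F r x := rfl

/-- The integrand of `W(t)` is integrable. [folklore] -/
theorem integrable_Wfun_integrand (hF : Continuous F) (hr : 0 < r)
    (hM : ∀ z : ℂ, |z.im| ≤ r → ‖F z‖ ≤ M) (t : ℝ) :
    Integrable fun x : ℝ => Real.exp (-|x - t|) * Sfun F r x :=
  integrable_expw_mul (measurable_Sfun hF r) (C := 3 * M ^ 2)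
    (fun x => by rw [abs_of_nonneg (Sfun_nonneg F r x)]; exact Sfun_le hr hM x) t

/-- `W ≥ 0`. [folklore] -/
theorem Wfun_nonneg (F : ℂ → ℂ) (r t : ℝ) : 0 ≤ Wfun F r t :=
  integral_nonneg fun x => mul_nonneg (Real.exp_pos _).le (Sfun_nonneg F r x)

/-- `∫ e^{-|x - t|} dx = 2`. [folklore] -/
theorem integral_exp_neg_abs_sub (t : ℝ) : ∫ x : ℝ, Real.exp (-|x - t|) = 2 := by
  have h1 : ∫ x : ℝ, Real.exp (-|x - t|) = ∫ x : ℝ, Real.exp (-|x|) := by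
    have := integral_sub_right_eq_self (μ := volume) (fun x : ℝ => Real.exp (-|x|)) t
    exact this
  rw [h1, ← integral_add_compl (measurableSet_Iic (a := (0 : ℝ))) (integrable_exp_neg_abs_sub 0 |>.congr
    (ae_of_all _ fun x => by simp))]
  have h2 : ∫ x in Iic (0 : ℝ), Real.exp (-|x|) = 1 := by
    rw [setIntegral_congr_fun measurableSet_Iic (fun x (hx : x ≤ 0) => by rw [abs_of_nonpos hx, neg_neg]),
      integral_exp_Iic, Real.exp_zero]
  have h3 : ∫ x in (Iic (0 : ℝ))ᶜ, Real.exp (-|x|) = 1 := by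
    rw [Set.compl_Iic, setIntegral_congr_fun measurableSet_Ioi (fun x (hx : 0 < x) => by rw [abs_of_pos hx]),
      integral_exp_neg_Ioi_zero]
  rw [h2, h3]; norm_num

/-- `W ≤ 6M²`. [folklore] -/
theorem Wfun_le (hF : Continuous F) (hr : 0 < r) (hM : ∀ z : ℂ, |z.im| ≤ r → ‖F z‖ ≤ M) (t : ℝ) :
    Wfun F r t ≤ 6 * M ^ 2 := by
  rw [Wfun_eq]
  calc ∫ x : ℝ, Real.exp (-|x - t|) * Sfun F r x ≤ ∫ x : ℝ, Real.exp (-|x - t|) * (3 * M ^ 2) :=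
        integral_mono (integrable_Wfun_integrand hF hr hM t) ((integrable_exp_neg_abs_sub t).mul_const _)
          fun x => mul_le_mul_of_nonneg_left (Sfun_le hr hM x) (Real.exp_pos _).le
    _ = 6 * M ^ 2 := by rw [integral_mul_const, integral_exp_neg_abs_sub]; ring

/-- `W` is continuous (dominated convergence, locally in `t`). [folklore] -/
theorem continuous_Wfun (hF : Continuous F) (hr : 0 < r) (hM : ∀ z : ℂ, |z.im| ≤ r → ‖F z‖ ≤ M) :
    Continuous (Wfun F r) := by
  have hM0 : 0 ≤ M := (norm_nonneg _).trans (hM 0 (by simp [hr.le]))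
  have e : Wfun F r = fun t => ∫ x : ℝ, Real.exp (-|x - t|) * Sfun F r x := rfl
  rw [e, continuous_iff_continuousAt]
  intro t₀
  refine continuousAt_of_dominated (bound := fun x => Real.exp 1 * Real.exp (-|x - t₀|) * (3 * M ^ 2))
    (Eventually.of_forall fun t => (integrable_Wfun_integrand hF hr hM t).aestronglyMeasurable) ?_ ?_ ?_
  · have : ∀ᶠ t in 𝓝 t₀, |t - t₀| < 1 := by
      have := Metric.ball_mem_nhds t₀ one_pos
      filter_upwards [this] with t ht
      rwa [Metric.mem_ball, Real.dist_eq] at ht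
    filter_upwards [this] with t ht
    refine ae_of_all _ fun x => ?_
    rw [Real.norm_eq_abs, abs_of_nonneg (mul_nonneg (Real.exp_pos _).le (Sfun_nonneg F r x))]
    refine mul_le_mul ?_ (Sfun_le hr hM x) (Sfun_nonneg F r x) (by positivity)
    rw [← Real.exp_add, Real.exp_le_exp]
    have := abs_sub_abs_le_abs_sub (x - t₀) (x - t)
    have e2 : x - t₀ - (x - t) = t - t₀ := by ring
    rw [e2] at this
    linarith
  · exact ((integrable_exp_neg_abs_sub t₀).const_mul _).mul_const _
  · exact ae_of_all _ fun x => by fun_prop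


/-- **Concavity on a unit cell**: `∫_{[j,j+1]} w^s ≤ (∫_{[j,j+1]} w)^s` for `0 < s < 1`, `w ≥ 0`
continuous (weighted AM–GM and a limiting argument). [folklore] -/
theorem setIntegral_rpow_le {w : ℝ → ℝ} (hw : Continuous w) (hw0 : ∀ t, 0 ≤ w t) (j : ℝ) {s : ℝ}
    (hs0 : 0 < s) (hs1 : s < 1) :
    ∫ t in Icc j (j + 1), w t ^ s ≤ (∫ t in Icc j (j + 1), w t) ^ s := by
  set L := ∫ t in Icc j (j + 1), w t with hL
  have hL0 : 0 ≤ L := setIntegral_nonneg measurableSet_Icc fun t _ => hw0 t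
  have hvol : volume.real (Icc j (j + 1)) = 1 := by
    rw [Measure.real, Real.volume_Icc]; simp
  have hwint : IntegrableOn w (Icc j (j + 1)) := hw.integrableOn_Icc
  have hwsint : IntegrableOn (fun t => w t ^ s) (Icc j (j + 1)) :=
    (hw.rpow_const fun x => Or.inr hs0.le).integrableOn_Icc
  -- for every `η > 0`: `∫ w^s ≤ (L + η)^s`
  have hη : ∀ η : ℝ, 0 < η → ∫ t in Icc j (j + 1), w t ^ s ≤ (L + η) ^ s := by
    intro η hη
    set lam := L + η with hlam
    have hlam0 : 0 < lam := by positivity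
    have hpt : ∀ t, w t ^ s ≤ lam ^ s * (s * (w t / lam) + (1 - s)) := by
      intro t
      have h1 := Real.geom_mean_le_arith_mean2_weighted hs0.le (by linarith : 0 ≤ 1 - s)
        (div_nonneg (hw0 t) hlam0.le) zero_le_one (by ring)
      rw [Real.one_rpow, mul_one, mul_one] at h1
      have h2 : w t ^ s = lam ^ s * (w t / lam) ^ s := by
        rw [Real.div_rpow (hw0 t) hlam0.le, mul_div_cancel₀ _ (Real.rpow_pos_of_pos hlam0 s).ne']
      rw [h2]
      exact mul_le_mul_of_nonneg_left h1 (Real.rpow_nonneg hlam0.le _)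
    calc ∫ t in Icc j (j + 1), w t ^ s ≤ ∫ t in Icc j (j + 1), lam ^ s * (s * (w t / lam) + (1 - s)) :=
          setIntegral_mono_on hwsint
            ((((hwint.div_const lam).const_mul s).add
              (continuous_const.integrableOn_Icc (a := j) (b := j + 1))).const_mul _)
            measurableSet_Icc fun t _ => hpt t
      _ = lam ^ s * (s * (L / lam) + (1 - s)) := by
          rw [integral_const_mul, integral_add ((hwint.div_const lam).const_mul s)
            (continuous_const.integrableOn_Icc (a := j) (b := j + 1)),
            integral_const_mul, setIntegral_const, hvol]
          simp only [smul_eq_mul, one_mul]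
          rw [integral_div, ← hL]
      _ ≤ lam ^ s * (s * 1 + (1 - s)) := by
          gcongr
          rw [div_le_one hlam0]; linarith
      _ = lam ^ s := by ring
  -- limit `η → 0`
  have hlim : Tendsto (fun η : ℝ => (L + η) ^ s) (𝓝[>] 0) (𝓝 ((L + 0) ^ s)) := by
    have hc : Continuous fun η : ℝ => (L + η) ^ s :=
      (continuous_const.add continuous_id).rpow_const fun x => Or.inr hs0.le
    exact (hc.tendsto 0).mono_left nhdsWithin_le_nhds
  rw [add_zero] at hlim
  exact ge_of_tendsto hlim (by
    filter_upwards [self_mem_nhdsWithin] with η hη' using hη η hη')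

variable (F r) in
/-- Reflection invariance of `W`: for `G z = F (c - z)`, `W_G (c - t) = W_F (t)`. [folklore] -/
theorem Wfun_reflect (c t : ℝ) : Wfun (fun z => F (c - z)) r (c - t) = Wfun F r t := by
  rw [Wfun, Wfun, ← integral_sub_left_eq_self (μ := volume)
    (fun y : ℝ => Real.exp (-|y - t|) * (‖F y‖ ^ 2 + ‖F (y + r * I)‖ ^ 2 + ‖F (y - r * I)‖ ^ 2)) c]
  refine integral_congr_ae (ae_of_all _ fun x => ?_)
  have e1 : (c : ℂ) - x = ((c - x : ℝ) : ℂ) := by push_cast; ring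
  have e2 : (c : ℂ) - (x + r * I) = ((c - x : ℝ) : ℂ) - r * I := by push_cast; ring
  have e3 : (c : ℂ) - (x - r * I) = ((c - x : ℝ) : ℂ) + r * I := by push_cast; ring
  have e4 : |x - (c - t)| = |c - x - t| := by rw [abs_sub_comm]; ring_nf
  simp only
  rw [e1, e2, e3, e4]
  ring

variable (F r) in
/-- Translation invariance of `W`: for `G z = F (z + c)`, `W_G (t - c) = W_F (t)`. [folklore] -/
theorem Wfun_translate (c t : ℝ) : Wfun (fun z => F (z + c)) r (t - c) = Wfun F r t := by
  rw [Wfun, Wfun, ← integral_add_right_eq_self (μ := volume)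
    (fun y : ℝ => Real.exp (-|y - t|) * (‖F y‖ ^ 2 + ‖F (y + r * I)‖ ^ 2 + ‖F (y - r * I)‖ ^ 2)) c]
  refine integral_congr_ae (ae_of_all _ fun x => ?_)
  have e1 : (x : ℂ) + c = ((x + c : ℝ) : ℂ) := by push_cast; ring
  have e2 : (x : ℂ) + r * I + c = ((x + c : ℝ) : ℂ) + r * I := by push_cast; ring
  have e3 : (x : ℂ) - r * I + c = ((x + c : ℝ) : ℂ) - r * I := by push_cast; ring
  have e4 : |x - (t - c)| = |x + c - t| := by ring_nf
  simp only
  rw [e1, e2, e3, e4]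

/-- Reflected slit integral. [folklore] -/
theorem setIntegral_reflect (h : ℝ → ℝ) (c ℓ : ℝ) (hℓ : 0 ≤ ℓ) :
    ∫ x in Icc (-ℓ) 0, h (c - x) = ∫ x in Icc c (c + ℓ), h x := by
  rw [integral_Icc_eq_integral_Ioc, ← intervalIntegral.integral_of_le (by linarith : -ℓ ≤ 0),
    intervalIntegral.integral_comp_sub_left h c, sub_zero, sub_neg_eq_add,
    intervalIntegral.integral_of_le (by linarith), integral_Icc_eq_integral_Ioc]

/-- Translated slit integral. [folklore] -/
theorem setIntegral_translate (h : ℝ → ℝ) (c ℓ : ℝ) (hℓ : 0 ≤ ℓ) :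
    ∫ x in Icc (-ℓ) 0, h (x + c) = ∫ x in Icc (c - ℓ) c, h x := by
  rw [integral_Icc_eq_integral_Ioc, ← intervalIntegral.integral_of_le (by linarith : -ℓ ≤ 0),
    intervalIntegral.integral_comp_add_right h c, zero_add, show -ℓ + c = c - ℓ by ring,
    intervalIntegral.integral_of_le (by linarith), integral_Icc_eq_integral_Ioc]


/-- **The cell estimate** (BD18, proof of Lemma 3.2: "Integrating in `t ∈ I ∖ I''`"): for a cell
`I = [j, j+1]` with `I'' = [β, β + c₀] ⊆ I`,
`∫_I ‖F‖² ≤ ((C+3)/r) (∫_{I''} ‖F‖²)^κ (∫_I W)^{1-κ}`. [cite: BourgainDyatlov2018, Lemma 3.2] -/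
theorem cell_estimate {C κ c₀ : ℝ} (hc₀ : 0 < c₀) (hr : 0 < r) (hr1 : r ≤ 1)
    (hκ : 0 < κ) (hκ1 : κ < 1) (hC : 0 ≤ C) (hF : Differentiable ℂ F)
    (hM : ∀ z : ℂ, |z.im| ≤ r → ‖F z‖ ≤ M)
    (hP : ∀ t : ℝ, c₀ / 4 ≤ t → t ≤ 1 → ∀ G : ℂ → ℂ, Differentiable ℂ G →
      (∀ z : ℂ, |z.im| ≤ r → ‖G z‖ ≤ M) →
        ‖G t‖ ^ 2 ≤ C / r * (∫ x in Icc (-(c₀ / 2)) 0, ‖G x‖ ^ 2) ^ κ * (Wfun G r t) ^ (1 - κ))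
    (j β : ℝ) (hβ : j ≤ β) (hβ1 : β + c₀ ≤ j + 1) :
    ∫ t in Icc j (j + 1), ‖F t‖ ^ 2 ≤
      (C + 3) / r * (∫ x in Icc β (β + c₀), ‖F x‖ ^ 2) ^ κ * (∫ t in Icc j (j + 1), Wfun F r t) ^ (1 - κ) := by
  have hFc := hF.continuous
  have hM0 : 0 ≤ M := (norm_nonneg _).trans (hM 0 (by simp [hr.le]))
  set h : ℝ → ℝ := fun x => ‖F x‖ ^ 2 with hh
  have hhc : Continuous h := by simp only [hh]; fun_prop
  have hh0 : ∀ x, 0 ≤ h x := fun x => sq_nonneg _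
  set a := ∫ x in Icc β (β + c₀), h x with hadef
  set Q₀ := ∫ x in Icc (β + c₀ / 4) (β + 3 * c₀ / 4), h x with hQ₀def
  set W := Wfun F r with hWdef
  set b := ∫ t in Icc j (j + 1), W t with hbdef
  have hWc : Continuous W := continuous_Wfun hFc hr hM
  have hW0 : ∀ t, 0 ≤ W t := Wfun_nonneg F r
  have ha0 : 0 ≤ a := setIntegral_nonneg measurableSet_Icc fun x _ => hh0 x
  have hb0 : 0 ≤ b := setIntegral_nonneg measurableSet_Icc fun t _ => hW0 t
  have hQ₀a : Q₀ ≤ a := setIntegral_mono_set hhc.integrableOn_Icc (ae_of_all _ hh0)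
    (ae_of_all _ (Icc_subset_Icc (by linarith) (by linarith)))
  have hQ₀0 : 0 ≤ Q₀ := setIntegral_nonneg measurableSet_Icc fun x _ => hh0 x
  -- pointwise estimate off `I''`
  have hpt : ∀ t ∈ Icc j (j + 1), t ∉ Ioo β (β + c₀) → h t ≤ C / r * a ^ κ * W t ^ (1 - κ) := by
    intro t ht hnot
    have hcase : t ≤ β ∨ β + c₀ ≤ t := by
      rcases le_or_gt t β with h1 | h1
      · exact Or.inl h1
      · rcases le_or_gt (β + c₀) t with h2 | h2
        · exact Or.inr h2
        · exact absurd ⟨h1, h2⟩ hnot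
    have key : h t ≤ C / r * Q₀ ^ κ * W t ^ (1 - κ) := by
      rcases hcase with hle | hge
      · -- reflect about `c = β + c₀/4`
        set c := β + c₀ / 4 with hc
        set G : ℂ → ℂ := fun z => F (c - z) with hG
        have hGd : Differentiable ℂ G := hF.comp ((differentiable_const _).sub differentiable_id)
        have hGM : ∀ z : ℂ, |z.im| ≤ r → ‖G z‖ ≤ M := fun z hz => hM _ (by simpa using hz)
        have h1 := hP (c - t) (by rw [hc]; linarith) (by rw [hc]; linarith [ht.1]) G hGd hGM
        have e1 : G ((c - t : ℝ) : ℂ) = F t := by simp only [hG]; push_cast; ring_nf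
        have e2 : ∫ x in Icc (-(c₀ / 2)) 0, ‖G x‖ ^ 2 = Q₀ := by
          have := setIntegral_reflect h c (c₀ / 2) (by linarith)
          simp only [hh] at this
          rw [hQ₀def, show β + 3 * c₀ / 4 = c + c₀ / 2 by rw [hc]; ring]
          refine Eq.trans ?_ this
          refine setIntegral_congr_fun measurableSet_Icc fun x _ => ?_
          simp only [hG]; push_cast; ring_nf
        have e3 : Wfun G r (c - t) = W t := Wfun_reflect F r c t
        rw [e1, e2, e3] at h1
        exact h1
      · -- translate by `c = β + 3c₀/4`
        set c := β + 3 * c₀ / 4 with hc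
        set G : ℂ → ℂ := fun z => F (z + c) with hG
        have hGd : Differentiable ℂ G := hF.comp (differentiable_id.add (differentiable_const _))
        have hGM : ∀ z : ℂ, |z.im| ≤ r → ‖G z‖ ≤ M := fun z hz => hM _ (by simpa using hz)
        have h1 := hP (t - c) (by rw [hc]; linarith) (by rw [hc]; linarith [ht.2]) G hGd hGM
        have e1 : G ((t - c : ℝ) : ℂ) = F t := by simp only [hG]; push_cast; ring_nf
        have e2 : ∫ x in Icc (-(c₀ / 2)) 0, ‖G x‖ ^ 2 = Q₀ := by
          have := setIntegral_translate h c (c₀ / 2) (by linarith)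
          simp only [hh] at this
          rw [hQ₀def, show β + c₀ / 4 = c - c₀ / 2 by rw [hc]; ring]
          refine Eq.trans ?_ this
          refine setIntegral_congr_fun measurableSet_Icc fun x _ => ?_
          simp only [hG]; push_cast; ring_nf
        have e3 : Wfun G r (t - c) = W t := Wfun_translate F r c t
        rw [e1, e2, e3] at h1
        exact h1
    refine key.trans ?_
    exact mul_le_mul_of_nonneg_right (mul_le_mul_of_nonneg_left (Real.rpow_le_rpow hQ₀0 hQ₀a hκ.le)
      (div_nonneg hC hr.le)) (Real.rpow_nonneg (hW0 t) _)
  -- integrate over the cell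
  set P : ℝ → ℝ := fun t => C / r * a ^ κ * W t ^ (1 - κ) + (Ioo β (β + c₀)).indicator h t with hPdef
  have hWs : Continuous fun t => W t ^ (1 - κ) := hWc.rpow_const fun x => Or.inr (by linarith)
  have hPint : IntegrableOn P (Icc j (j + 1)) := by
    refine ((hWs.integrableOn_Icc).const_mul _).add ?_
    exact (hhc.integrableOn_Icc).indicator measurableSet_Ioo
  have hle : ∀ t ∈ Icc j (j + 1), h t ≤ P t := by
    intro t ht
    by_cases hmem : t ∈ Ioo β (β + c₀)
    · simp only [hPdef, indicator_of_mem hmem]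
      have : 0 ≤ C / r * a ^ κ * W t ^ (1 - κ) :=
        mul_nonneg (mul_nonneg (div_nonneg hC hr.le) (Real.rpow_nonneg ha0 _)) (Real.rpow_nonneg (hW0 t) _)
      linarith
    · simp only [hPdef, indicator_of_notMem hmem, add_zero]
      exact hpt t ht hmem
  have hint1 : ∫ t in Icc j (j + 1), h t ≤ C / r * a ^ κ * (∫ t in Icc j (j + 1), W t ^ (1 - κ)) +
      ∫ t in Icc j (j + 1), (Ioo β (β + c₀)).indicator h t := by
    have := setIntegral_mono_on hhc.integrableOn_Icc hPint measurableSet_Icc hle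
    rwa [integral_add ((hWs.integrableOn_Icc).const_mul _) ((hhc.integrableOn_Icc).indicator measurableSet_Ioo),
      integral_const_mul] at this
  have hind : ∫ t in Icc j (j + 1), (Ioo β (β + c₀)).indicator h t ≤ a := by
    rw [integral_indicator measurableSet_Ioo, Measure.restrict_restrict measurableSet_Ioo]
    exact setIntegral_mono_set hhc.integrableOn_Icc (ae_of_all _ hh0)
      (ae_of_all _ (fun x hx => ⟨hx.1.1.le, hx.1.2.le⟩))
  have hconc : ∫ t in Icc j (j + 1), W t ^ (1 - κ) ≤ b ^ (1 - κ) :=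
    setIntegral_rpow_le hWc hW0 j (by linarith) (by linarith)
  -- `a ≤ e b`
  have hab : a ≤ Real.exp 1 * b := by
    have hWlow : ∀ t ∈ Icc j (j + 1), Real.exp (-1) * a ≤ W t := by
      intro t ht
      have h1 : Real.exp (-1) * a ≤ ∫ x in Icc β (β + c₀), Real.exp (-|x - t|) * h x := by
        rw [← integral_const_mul]
        refine setIntegral_mono_on (hhc.integrableOn_Icc.const_mul _)
          ((Continuous.integrableOn_Icc (by fun_prop))) measurableSet_Icc fun x hx => ?_
        refine mul_le_mul_of_nonneg_right (Real.exp_le_exp.2 ?_) (hh0 x)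
        have : |x - t| ≤ 1 := by rw [abs_le]; constructor <;> linarith [hx.1, hx.2, ht.1, ht.2]
        linarith
      have h2 : ∫ x in Icc β (β + c₀), Real.exp (-|x - t|) * h x ≤ ∫ x, Real.exp (-|x - t|) * h x :=
        setIntegral_le_integral (integrable_expw_mul hhc.measurable (C := M ^ 2)
          (fun x => by rw [abs_of_nonneg (hh0 x)]; exact pow_le_pow_left₀ (norm_nonneg _) (hM _ (by simp [hr.le])) 2) t)
          (ae_of_all _ fun x => mul_nonneg (Real.exp_pos _).le (hh0 x))
      have h3 : ∫ x, Real.exp (-|x - t|) * h x ≤ W t := by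
        rw [hWdef, Wfun_eq]
        refine integral_mono (integrable_expw_mul hhc.measurable (C := M ^ 2)
          (fun x => by rw [abs_of_nonneg (hh0 x)]; exact pow_le_pow_left₀ (norm_nonneg _) (hM _ (by simp [hr.le])) 2) t)
          (integrable_Wfun_integrand hFc hr hM t) fun x => ?_
        refine mul_le_mul_of_nonneg_left ?_ (Real.exp_pos _).le
        simp only [hh, Sfun]
        nlinarith [sq_nonneg ‖F (x + r * I)‖, sq_nonneg ‖F (x - r * I)‖]
      linarith
    have : ∫ t in Icc j (j + 1), Real.exp (-1) * a ≤ b :=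
      setIntegral_mono_on (continuous_const.integrableOn_Icc) hWc.integrableOn_Icc measurableSet_Icc hWlow
    rw [setIntegral_const, Measure.real, Real.volume_Icc, show j + 1 - j = 1 by ring] at this
    simp only [ENNReal.toReal_ofReal zero_le_one, smul_eq_mul, one_mul] at this
    calc a = Real.exp 1 * (Real.exp (-1) * a) := by rw [← mul_assoc, ← Real.exp_add]; norm_num
      _ ≤ Real.exp 1 * b := mul_le_mul_of_nonneg_left this (Real.exp_pos _).le
  -- `a ≤ e a^κ b^{1-κ}`
  have hab2 : a ≤ Real.exp 1 * (a ^ κ * b ^ (1 - κ)) := by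
    have e1 : a = a ^ κ * a ^ (1 - κ) := by
      rw [← Real.rpow_add_of_nonneg ha0 hκ.le (by linarith)]; norm_num
    have e2 : a ^ (1 - κ) ≤ (Real.exp 1 * b) ^ (1 - κ) := Real.rpow_le_rpow ha0 hab (by linarith)
    have e3 : (Real.exp 1 * b) ^ (1 - κ) ≤ Real.exp 1 * b ^ (1 - κ) := by
      rw [Real.mul_rpow (Real.exp_pos _).le hb0]
      refine mul_le_mul_of_nonneg_right ?_ (Real.rpow_nonneg hb0 _)
      calc Real.exp 1 ^ (1 - κ) ≤ Real.exp 1 ^ (1 : ℝ) :=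
            Real.rpow_le_rpow_of_exponent_le (Real.one_le_exp zero_le_one) (by linarith)
        _ = Real.exp 1 := Real.rpow_one _
    calc a = a ^ κ * a ^ (1 - κ) := e1
      _ ≤ a ^ κ * (Real.exp 1 * b ^ (1 - κ)) := mul_le_mul_of_nonneg_left (e2.trans e3) (Real.rpow_nonneg ha0 _)
      _ = _ := by ring
  have he3 : Real.exp 1 ≤ 3 := by
    have := Real.exp_one_lt_d9; linarith
  calc ∫ t in Icc j (j + 1), h t
      ≤ C / r * a ^ κ * (∫ t in Icc j (j + 1), W t ^ (1 - κ)) + ∫ t in Icc j (j + 1), (Ioo β (β + c₀)).indicator h t := hint1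
    _ ≤ C / r * a ^ κ * b ^ (1 - κ) + a := by gcongr
    _ ≤ C / r * a ^ κ * b ^ (1 - κ) + 3 / r * (a ^ κ * b ^ (1 - κ)) := by
        have h1 : Real.exp 1 * (a ^ κ * b ^ (1 - κ)) ≤ 3 / r * (a ^ κ * b ^ (1 - κ)) := by
          refine mul_le_mul_of_nonneg_right ?_ (mul_nonneg (Real.rpow_nonneg ha0 _) (Real.rpow_nonneg hb0 _))
          rw [le_div_iff₀ hr]; nlinarith
        linarith
    _ = (C + 3) / r * a ^ κ * b ^ (1 - κ) := by ring

end Cells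


/-! ### Summation over the cells (Lebesgue integrals) -/

section Sums

/-- `∫⁻ = Σ_j ∫⁻_{[j,j+1)}`. [folklore] -/
theorem lintegral_eq_tsum_Ico (φ : ℝ → ℝ≥0∞) :
    ∫⁻ x, φ x = ∑' j : ℤ, ∫⁻ x in Ico (j : ℝ) (j + 1), φ x := by
  rw [← lintegral_iUnion (fun j => measurableSet_Ico) (pairwise_disjoint_Ico_intCast ℝ) φ,
    iUnion_Ico_intCast, Measure.restrict_univ]

/-- Discrete Hölder inequality with exponents `1/κ` and `1/(1-κ)`. [folklore] -/
theorem tsum_rpow_mul_rpow_le (u v : ℤ → ℝ≥0∞) {κ : ℝ} (hκ : 0 < κ) (hκ1 : κ < 1) :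
    ∑' j, u j ^ κ * v j ^ (1 - κ) ≤ (∑' j, u j) ^ κ * (∑' j, v j) ^ (1 - κ) := by
  have hpq : (1 / κ).HolderConjugate (1 / (1 - κ)) := by
    refine Real.holderConjugate_iff.2 ⟨one_lt_one_div hκ hκ1, ?_⟩
    simp only [one_div, inv_inv]; ring
  have h := ENNReal.lintegral_mul_le_Lp_mul_Lq (Measure.count : Measure ℤ) hpq
    (f := fun j => u j ^ κ) (g := fun j => v j ^ (1 - κ)) (Measurable.of_discrete.aemeasurable)
    (Measurable.of_discrete.aemeasurable)
  simp only [lintegral_count, Pi.mul_apply, one_div, inv_inv] at h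
  have e1 : ∀ j, (u j ^ κ) ^ κ⁻¹ = u j := fun j => by
    rw [← ENNReal.rpow_mul, mul_inv_cancel₀ hκ.ne', ENNReal.rpow_one]
  have e2 : ∀ j, (v j ^ (1 - κ)) ^ (1 - κ)⁻¹ = v j := fun j => by
    rw [← ENNReal.rpow_mul, mul_inv_cancel₀ (by linarith : (1 - κ) ≠ 0), ENNReal.rpow_one]
  simp only [e1, e2] at h
  exact h

/-- Tonelli for the weight `W`: `∫⁻ W = 2 ∫⁻ S`. [folklore] -/
theorem lintegral_Wfun_eq {F : ℂ → ℂ} {M r : ℝ} (hF : Continuous F) (hr : 0 < r)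
    (hM : ∀ z : ℂ, |z.im| ≤ r → ‖F z‖ ≤ M) :
    ∫⁻ t, ENNReal.ofReal (Wfun F r t) = 2 * ∫⁻ x, ENNReal.ofReal (Sfun F r x) := by
  have h1 : ∀ t, ENNReal.ofReal (Wfun F r t) = ∫⁻ x, ENNReal.ofReal (Real.exp (-|x - t|) * Sfun F r x) := by
    intro t
    rw [Wfun_eq, ofReal_integral_eq_lintegral_ofReal (integrable_Wfun_integrand hF hr hM t)
      (ae_of_all _ fun x => mul_nonneg (Real.exp_pos _).le (Sfun_nonneg F r x))]
  simp_rw [h1]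
  rw [lintegral_lintegral_swap]
  · have h2 : ∀ x, ∫⁻ t, ENNReal.ofReal (Real.exp (-|x - t|) * Sfun F r x) = 2 * ENNReal.ofReal (Sfun F r x) := by
      intro x
      simp_rw [ENNReal.ofReal_mul (Real.exp_pos _).le]
      rw [lintegral_mul_const _ (by fun_prop), ← ofReal_integral_eq_lintegral_ofReal]
      · rw [show (fun t : ℝ => Real.exp (-|x - t|)) = fun t => Real.exp (-|t - x|) by
          ext t; rw [abs_sub_comm], integral_exp_neg_abs_sub, ENNReal.ofReal_ofNat]
      · have := integrable_exp_neg_abs_sub x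
        exact this.congr (ae_of_all _ fun t => by simp [abs_sub_comm])
      · exact ae_of_all _ fun t => (Real.exp_pos _).le
    simp_rw [h2]
    rw [lintegral_const_mul _ ((measurable_Sfun hF r).ennreal_ofReal)]
  · refine Measurable.aemeasurable ?_
    refine Measurable.ennreal_ofReal ?_
    exact ((Real.measurable_exp.comp ((measurable_snd.sub measurable_fst).norm.neg)).mul
      ((measurable_Sfun hF r).comp measurable_snd))

end Sums

/-! ### The Fourier side: `f = 𝓕⁻ g` and its entire extension -/

section FourierSide

open Literature.MathematicalPhysics.QuantumFieldTheory in
/-- The line formula: `F(x + iy) = 𝓕⁻ (e^{-2πy·} g) (x)` for the Fourier–Laplace extension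
`F = laplaceExt g`. [folklore] -/
theorem laplaceExt_add_mul_I (g : ℝ → ℂ) (x y : ℝ) :
    laplaceExt g (x + y * I) = 𝓕⁻ (fun ξ => ((Real.exp (-(2 * π * y * ξ)) : ℝ) : ℂ) * g ξ) x := by
  rw [← laplaceExt_ofReal, laplaceExt, laplaceExt]
  refine integral_congr_ae (ae_of_all _ fun w => ?_)
  simp only
  rw [← mul_assoc]
  congr 1
  rw [Complex.ofReal_exp, ← Complex.exp_add]
  congr 1
  push_cast
  ring_nf
  rw [Complex.I_sq]
  ring

open Literature.MathematicalPhysics.QuantumFieldTheory in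
/-- Sup bound on the strip: `‖F z‖ ≤ ∫ e^{2πr|ξ|} ‖g ξ‖ dξ` for `|Im z| ≤ r`. [folklore] -/
theorem norm_laplaceExt_le_of_abs_im_le {g : ℝ → ℂ} {r R : ℝ} (hg : Integrable g)
    (hR : ∀ ξ, R < |ξ| → g ξ = 0) {z : ℂ} (hz : |z.im| ≤ r) :
    ‖laplaceExt g z‖ ≤ ∫ ξ, Real.exp (2 * π * r * |ξ|) * ‖g ξ‖ := by
  have hint : Integrable fun ξ => Real.exp (2 * π * r * |ξ|) * ‖g ξ‖ := by
    refine (hg.norm.const_mul (Real.exp (2 * π * |r| * max R 0))).mono' (by fun_prop)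
      (ae_of_all _ fun ξ => ?_)
    rw [Real.norm_eq_abs, abs_of_nonneg (by positivity)]
    by_cases h : g ξ = 0
    · simp [h]
    · have hξ : |ξ| ≤ max R 0 := (le_of_not_gt fun h' => h (hR ξ h')).trans (le_max_left _ _)
      refine mul_le_mul_of_nonneg_right (Real.exp_le_exp.2 ?_) (norm_nonneg _)
      have : r * |ξ| ≤ |r| * max R 0 := by
        calc r * |ξ| ≤ |r| * |ξ| := mul_le_mul_of_nonneg_right (le_abs_self r) (abs_nonneg _)
          _ ≤ |r| * max R 0 := mul_le_mul_of_nonneg_left hξ (abs_nonneg _)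
      nlinarith [pi_pos]
  rw [laplaceExt]
  refine (norm_integral_le_integral_norm _).trans (integral_mono_of_nonneg
    (ae_of_all _ fun _ => norm_nonneg _) hint (ae_of_all _ fun w => ?_))
  dsimp only
  rw [norm_mul, norm_cexp_kernel]
  refine mul_le_mul_of_nonneg_right (Real.exp_le_exp.2 ?_) (norm_nonneg _)
  have h1 : -(w * z.im) ≤ |w| * r := by
    calc -(w * z.im) ≤ |w * z.im| := neg_le_abs _
      _ = |w| * |z.im| := abs_mul _ _
      _ ≤ |w| * r := mul_le_mul_of_nonneg_left hz (abs_nonneg _)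
  nlinarith [pi_pos]

/-- The damped Fourier datum on the line `Im z = y`. [folklore] -/
theorem norm_expmul_le {g : ℝ → ℂ} {R : ℝ} (hR : ∀ ξ, R < |ξ| → g ξ = 0) (y ξ : ℝ) :
    ‖((Real.exp (-(2 * π * y * ξ)) : ℝ) : ℂ) * g ξ‖ ≤ Real.exp (2 * π * |y| * max R 0) * ‖g ξ‖ := by
  by_cases h : g ξ = 0
  · simp [h]
  · have hξ : |ξ| ≤ max R 0 := (le_of_not_gt fun h' => h (hR ξ h')).trans (le_max_left _ _)
    rw [norm_mul, Complex.norm_real, Real.norm_eq_abs, abs_of_pos (Real.exp_pos _)]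
    refine mul_le_mul_of_nonneg_right (Real.exp_le_exp.2 ?_) (norm_nonneg _)
    have : -(y * ξ) ≤ |y| * max R 0 := by
      calc -(y * ξ) ≤ |y * ξ| := neg_le_abs _
        _ = |y| * |ξ| := abs_mul _ _
        _ ≤ |y| * max R 0 := mul_le_mul_of_nonneg_left hξ (abs_nonneg _)
    nlinarith [pi_pos]

open Literature.MathematicalPhysics.QuantumFieldTheory in
/-- **Plancherel on the lines `Im z = y`, `|y| ≤ r`:** `∫ ‖F(x+iy)‖² dx ≤ ∫ e^{4πr|ξ|} ‖g ξ‖² dξ`,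
and `x ↦ ‖F(x+iy)‖²` is integrable. [folklore] -/
theorem integral_norm_sq_laplaceExt_line_le {g : ℝ → ℂ} {r R : ℝ} (hg : Integrable g)
    (hg2 : MemLp g 2 volume) (hR : ∀ ξ, R < |ξ| → g ξ = 0) {y : ℝ} (hy : |y| ≤ r) :
    Integrable (fun x : ℝ => ‖laplaceExt g (x + y * I)‖ ^ 2) ∧
      ∫ x : ℝ, ‖laplaceExt g (x + y * I)‖ ^ 2 ≤ ∫ ξ, Real.exp (4 * π * r * |ξ|) * ‖g ξ‖ ^ 2 := by
  set gy : ℝ → ℂ := fun ξ => ((Real.exp (-(2 * π * y * ξ)) : ℝ) : ℂ) * g ξ with hgy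
  have hgym : AEStronglyMeasurable gy volume := by
    simp only [hgy]
    exact ((Complex.continuous_ofReal.comp (by fun_prop)).aestronglyMeasurable).mul hg.aestronglyMeasurable
  have hgy1 : Integrable gy :=
    (hg.norm.const_mul (Real.exp (2 * π * |y| * max R 0))).mono' hgym
      (ae_of_all _ fun ξ => norm_expmul_le hR y ξ)
  have hgy2 : MemLp gy 2 volume :=
    MemLp.of_le_mul hg2 hgym (ae_of_all _ fun ξ => norm_expmul_le hR y ξ)
  have hline : ∀ x : ℝ, laplaceExt g (x + y * I) = 𝓕⁻ gy x := fun x => laplaceExt_add_mul_I g x y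
  simp_rw [hline]
  refine ⟨Literature.Analysis.Fourier.integrable_norm_sq_fourierInv hgy1 hgy2, ?_⟩
  rw [Literature.Analysis.Fourier.integral_norm_sq_fourierInv_eq hgy1 hgy2]
  -- `∫ ‖gy‖² = ∫ e^{-4πyξ} ‖g‖² ≤ ∫ e^{4πr|ξ|} ‖g‖²`
  have hsq : Integrable fun ξ => ‖g ξ‖ ^ 2 := (memLp_two_iff_integrable_sq_norm hg2.1).1 hg2
  have hrhs : Integrable fun ξ => Real.exp (4 * π * r * |ξ|) * ‖g ξ‖ ^ 2 := by
    refine (hsq.const_mul (Real.exp (4 * π * |r| * max R 0))).mono' (by fun_prop)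
      (ae_of_all _ fun ξ => ?_)
    rw [Real.norm_eq_abs, abs_of_nonneg (by positivity)]
    by_cases h : g ξ = 0
    · simp [h]
    · have hξ : |ξ| ≤ max R 0 := (le_of_not_gt fun h' => h (hR ξ h')).trans (le_max_left _ _)
      refine mul_le_mul_of_nonneg_right (Real.exp_le_exp.2 ?_) (sq_nonneg _)
      have : r * |ξ| ≤ |r| * max R 0 := by
        calc r * |ξ| ≤ |r| * |ξ| := mul_le_mul_of_nonneg_right (le_abs_self r) (abs_nonneg _)
          _ ≤ |r| * max R 0 := mul_le_mul_of_nonneg_left hξ (abs_nonneg _)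
      nlinarith [pi_pos]
  refine integral_mono ((memLp_two_iff_integrable_sq_norm hgy2.1).1 hgy2) hrhs fun ξ => ?_
  simp only [hgy]
  rw [norm_mul, mul_pow, Complex.norm_real, Real.norm_eq_abs, abs_of_pos (Real.exp_pos _),
    ← Real.exp_nat_mul]
  refine mul_le_mul_of_nonneg_right (Real.exp_le_exp.2 ?_) (sq_nonneg _)
  push_cast
  have h1 : -(y * ξ) ≤ r * |ξ| := by
    calc -(y * ξ) ≤ |y * ξ| := neg_le_abs _
      _ = |y| * |ξ| := abs_mul _ _
      _ ≤ r * |ξ| := mul_le_mul_of_nonneg_right hy (abs_nonneg _)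
  nlinarith [pi_pos]

end FourierSide


end Literature.Analysis.Fourier.SlitStrip

/-! ### BD18 Lemma 3.2 -/

namespace Literature.Analysis.Fourier

open _root_.MeasureTheory Set Filter _root_.Topology Real _root_.Complex SlitStrip
open Literature.MathematicalPhysics.QuantumFieldTheory (laplaceExt laplaceExt_ofReal differentiable_laplaceExt)
open scoped ENNReal FourierTransform

/-- **Bourgain–Dyatlov 2018, Lemma 3.2** (the quantitative unique continuation bound (3.9), for the
grid of unit cells `I_j = [j, j+1]` and sub-intervals `I''_j = [b_j, b_j + c₀] ⊆ I_j` of a fixed size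
`c₀`): there is `C = C(c₀) > 0` such that for all `r ∈ (0,1)`, `0 < κ ≤ e^{-C/r}` and all
`f = 𝓕⁻ g ∈ L²(ℝ)` with `f̂ = g ∈ L²` vanishing off a bounded set (so `g ∈ L¹ ∩ L²`),
`∫_ℝ |f|² = Σ_j ‖f‖²_{L²(I_j)} ≤ (C/r) (∫_{⋃ I''_j} |f|²)^κ · ‖e^{2πr|ξ|} f̂(ξ)‖_{L²}^{2(1-κ)}`, where
`‖e^{2πr|ξ|} f̂‖²_{L²} = ∫ e^{4πr|ξ|} |g(ξ)|² dξ`. The proof replaces the harmonic-measure estimates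
of BD18 §2.4 by an explicit conformal map of the slit strip and Jensen's formula
(`SlitStrip.norm_sq_le_pointwise`). [cite: BourgainDyatlov2018, Lemma 3.2] -/
theorem bourgainDyatlov2018_lemma_3_2 (c₀ : ℝ) (hc₀ : 0 < c₀) (hc₀1 : c₀ ≤ 1) :
    ∃ C : ℝ, 0 < C ∧ ∀ r : ℝ, 0 < r → r < 1 → ∀ κ : ℝ, 0 < κ → κ ≤ Real.exp (-C / r) →
      ∀ b : ℤ → ℝ, (∀ j : ℤ, (j : ℝ) ≤ b j ∧ b j + c₀ ≤ j + 1) →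
      ∀ g : ℝ → ℂ, MemLp g 2 volume → (∃ R : ℝ, ∀ ξ, R < |ξ| → g ξ = 0) →
        ∫ x, ‖(𝓕⁻ g : ℝ → ℂ) x‖ ^ 2 ≤
          C / r * (∫ x in ⋃ j : ℤ, Icc (b j) (b j + c₀), ‖(𝓕⁻ g : ℝ → ℂ) x‖ ^ 2) ^ κ *
            (∫ ξ, Real.exp (4 * π * r * |ξ|) * ‖g ξ‖ ^ 2) ^ (1 - κ) := by
  obtain ⟨C₀, hC₀, hP⟩ := SlitStrip.norm_sq_le_pointwise (ℓ := c₀ / 2) (t₀ := c₀ / 4)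
    (by positivity) (by linarith) (by positivity)
  refine ⟨6 * (C₀ + 3), by positivity, ?_⟩
  rintro r hr hr1 κ hκ hκC b hb g hg2 ⟨R, hR⟩
  -- `g ∈ L²` with bounded support is integrable
  have hzero : ∀ ξ, ξ ∉ Icc (-(max R 0)) (max R 0) → g ξ = 0 := by
    intro ξ hξ
    refine hR ξ ?_
    simp only [mem_Icc, not_and_or, not_le] at hξ
    rcases hξ with h | h
    · have : max R 0 < -ξ := by linarith
      exact (le_max_left R 0).trans_lt (this.trans_le (neg_le_abs ξ))
    · exact (le_max_left R 0).trans_lt (h.trans_le (le_abs_self ξ))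
  have hg : Integrable g := by
    have hon : IntegrableOn g (Icc (-(max R 0)) (max R 0)) :=
      (hg2.restrict (Icc (-(max R 0)) (max R 0))).integrable one_le_two
    exact hon.integrable_of_forall_notMem_eq_zero hzero
  -- exponents
  have hκ0 : κ ≤ Real.exp (-C₀ / r) := by
    refine hκC.trans (Real.exp_le_exp.2 ?_)
    rw [neg_div, neg_div, neg_le_neg_iff]
    exact div_le_div_of_nonneg_right (by linarith) hr.le
  have hκ1 : κ < 1 := by
    refine lt_of_le_of_lt hκC ?_
    rw [Real.exp_lt_one_iff, neg_div]
    exact neg_neg_of_pos (div_pos (by positivity) hr)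
  -- the entire extension
  have hgc : HasCompactSupport g :=
    HasCompactSupport.intro (isCompact_Icc (a := -(max R 0)) (b := max R 0)) hzero
  set F : ℂ → ℂ := laplaceExt g with hFdef
  have hFd : Differentiable ℂ F := differentiable_laplaceExt hgc hg
  have hFc : Continuous F := hFd.continuous
  have hFx : ∀ x : ℝ, F x = 𝓕⁻ g x := laplaceExt_ofReal g
  set M := ∫ ξ, Real.exp (2 * π * r * |ξ|) * ‖g ξ‖ with hMdef
  have hM : ∀ z : ℂ, |z.im| ≤ r → ‖F z‖ ≤ M := fun z hz => norm_laplaceExt_le_of_abs_im_le hg hR hz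
  set Λ := ∫ ξ, Real.exp (4 * π * r * |ξ|) * ‖g ξ‖ ^ 2 with hΛdef
  have hΛ0 : 0 ≤ Λ := integral_nonneg fun ξ => by positivity
  -- Plancherel on the three lines
  have hl0 := integral_norm_sq_laplaceExt_line_le (r := r) hg hg2 hR (y := 0) (by simp [hr.le])
  have hlp := integral_norm_sq_laplaceExt_line_le (r := r) hg hg2 hR (y := r) (by rw [abs_of_pos hr])
  have hlm := integral_norm_sq_laplaceExt_line_le (r := r) hg hg2 hR (y := -r)
    (by rw [abs_neg, abs_of_pos hr])
  have e0 : ∀ x : ℝ, (x : ℂ) + ((0 : ℝ) : ℂ) * I = x := fun x => by push_cast; ring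
  have em : ∀ x : ℝ, (x : ℂ) + ((-r : ℝ) : ℂ) * I = x - r * I := fun x => by push_cast; ring
  simp_rw [e0] at hl0
  simp_rw [em] at hlm
  rw [← hFdef] at hl0 hlp hlm
  obtain ⟨hI0, hL0⟩ := hl0
  obtain ⟨hIp, hLp⟩ := hlp
  obtain ⟨hIm, hLm⟩ := hlm
  -- the pointwise estimate in the form used by the cells
  have hP' : ∀ t : ℝ, c₀ / 4 ≤ t → t ≤ 1 → ∀ G : ℂ → ℂ, Differentiable ℂ G →
      (∀ z : ℂ, |z.im| ≤ r → ‖G z‖ ≤ M) →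
        ‖G t‖ ^ 2 ≤ C₀ / r * (∫ x in Icc (-(c₀ / 2)) 0, ‖G x‖ ^ 2) ^ κ * (Wfun G r t) ^ (1 - κ) :=
    fun t ht ht1 G hG hGM => hP r hr hr1.le t ht ht1 G hG M hGM κ hκ hκ0
  -- cell estimates
  have hcell : ∀ j : ℤ, ∫ t in Icc (j : ℝ) (j + 1), ‖F t‖ ^ 2 ≤
      (C₀ + 3) / r * (∫ x in Icc (b j) (b j + c₀), ‖F x‖ ^ 2) ^ κ *
        (∫ t in Icc (j : ℝ) (j + 1), Wfun F r t) ^ (1 - κ) := fun j =>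
    cell_estimate hc₀ hr hr1.le hκ hκ1 hC₀.le hFd hM hP' j (b j) (hb j).1 (hb j).2
  -- pass to Lebesgue integrals and sum
  set K := (C₀ + 3) / r with hKdef
  have hK0 : 0 ≤ K := by positivity
  have hh : Continuous fun x : ℝ => ‖F x‖ ^ 2 := by fun_prop
  have hh0 : ∀ x : ℝ, 0 ≤ ‖F x‖ ^ 2 := fun x => sq_nonneg _
  set e : ℝ → ℝ≥0∞ := fun x => ENNReal.ofReal (‖F x‖ ^ 2) with hedef
  set u : ℤ → ℝ≥0∞ := fun j => ENNReal.ofReal (∫ x in Icc (b j) (b j + c₀), ‖F x‖ ^ 2) with hudef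
  set v : ℤ → ℝ≥0∞ := fun j => ENNReal.ofReal (∫ t in Icc (j : ℝ) (j + 1), Wfun F r t) with hvdef
  have hWc : Continuous (Wfun F r) := continuous_Wfun hFc hr hM
  have hW0 := Wfun_nonneg F r
  -- Step 1
  have step1 : ∫⁻ x, e x ≤ ENNReal.ofReal K * ((∑' j, u j) ^ κ * (∑' j, v j) ^ (1 - κ)) := by
    have h1 : ∀ j : ℤ, ∫⁻ x in Icc (j : ℝ) (j + 1), e x ≤ ENNReal.ofReal K * (u j ^ κ * v j ^ (1 - κ)) := by
      intro j
      rw [hedef, ← ofReal_integral_eq_lintegral_ofReal hh.integrableOn_Icc (ae_of_all _ hh0)]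
      refine (ENNReal.ofReal_le_ofReal (hcell j)).trans (le_of_eq ?_)
      have ha0 : 0 ≤ ∫ x in Icc (b j) (b j + c₀), ‖F x‖ ^ 2 :=
        setIntegral_nonneg measurableSet_Icc fun x _ => hh0 x
      have hb0 : 0 ≤ ∫ t in Icc (j : ℝ) (j + 1), Wfun F r t :=
        setIntegral_nonneg measurableSet_Icc fun t _ => hW0 t
      rw [hudef, hvdef, ENNReal.ofReal_rpow_of_nonneg ha0 hκ.le,
        ENNReal.ofReal_rpow_of_nonneg hb0 (by linarith), ← ENNReal.ofReal_mul (Real.rpow_nonneg ha0 _),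
        ← ENNReal.ofReal_mul hK0, hKdef]
      ring_nf
    calc ∫⁻ x, e x = ∑' j : ℤ, ∫⁻ x in Ico (j : ℝ) (j + 1), e x := lintegral_eq_tsum_Ico e
      _ ≤ ∑' j : ℤ, ∫⁻ x in Icc (j : ℝ) (j + 1), e x :=
          ENNReal.tsum_le_tsum fun j => lintegral_mono_set Ico_subset_Icc_self
      _ ≤ ∑' j : ℤ, ENNReal.ofReal K * (u j ^ κ * v j ^ (1 - κ)) := ENNReal.tsum_le_tsum h1
      _ = ENNReal.ofReal K * ∑' j : ℤ, u j ^ κ * v j ^ (1 - κ) := ENNReal.tsum_mul_left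
      _ ≤ _ := mul_le_mul' le_rfl (tsum_rpow_mul_rpow_le u v hκ hκ1)
  -- Step 2: `Σ u ≤ ofReal (∫_{U''} ‖F‖²)`
  have hIU : IntegrableOn (fun x : ℝ => ‖F x‖ ^ 2) (⋃ j : ℤ, Icc (b j) (b j + c₀)) := hI0.integrableOn
  have step2 : ∑' j, u j ≤ ENNReal.ofReal (∫ x in ⋃ j : ℤ, Icc (b j) (b j + c₀), ‖F x‖ ^ 2) := by
    have h1 : ∀ j, u j = ∫⁻ x in Ico (b j) (b j + c₀), e x := by
      intro j
      show ENNReal.ofReal (∫ x in Icc (b j) (b j + c₀), ‖F x‖ ^ 2) = _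
      rw [ofReal_integral_eq_lintegral_ofReal hh.integrableOn_Icc (ae_of_all _ hh0)]
      exact setLIntegral_congr Ico_ae_eq_Icc.symm
    have hdisj : Pairwise (Function.onFun Disjoint fun j : ℤ => Ico (b j) (b j + c₀)) := by
      intro i j hij
      rcases lt_or_gt_of_ne hij with h | h
      · refine Set.disjoint_left.2 fun x hx hx' => ?_
        have h1 : (i : ℝ) + 1 ≤ j := by exact_mod_cast h
        linarith [hx.2, hx'.1, (hb i).2, (hb j).1]
      · refine Set.disjoint_left.2 fun x hx hx' => ?_
        have h1 : (j : ℝ) + 1 ≤ i := by exact_mod_cast h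
        linarith [hx.1, hx'.2, (hb j).2, (hb i).1]
    simp_rw [h1]
    rw [← lintegral_iUnion (fun j => measurableSet_Ico) hdisj,
      ofReal_integral_eq_lintegral_ofReal hIU (ae_of_all _ hh0)]
    exact lintegral_mono_set (iUnion_mono fun j => Ico_subset_Icc_self)
  -- Step 3: `Σ v ≤ ofReal (6 Λ)`
  have hS : Integrable (Sfun F r) := by
    have : Sfun F r = fun x : ℝ => ‖F x‖ ^ 2 + ‖F (x + r * I)‖ ^ 2 + ‖F (x - r * I)‖ ^ 2 := rfl
    rw [this]
    exact (hI0.add hIp).add hIm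
  have hSle : ∫ x, Sfun F r x ≤ 3 * Λ := by
    have e2 : ∫ x, Sfun F r x = (∫ x : ℝ, (‖F x‖ ^ 2 + ‖F (x + r * I)‖ ^ 2)) +
        ∫ x : ℝ, ‖F (x - r * I)‖ ^ 2 := integral_add (hI0.add hIp) hIm
    have e3 : ∫ x : ℝ, (‖F x‖ ^ 2 + ‖F (x + r * I)‖ ^ 2) =
        (∫ x : ℝ, ‖F x‖ ^ 2) + ∫ x : ℝ, ‖F (x + r * I)‖ ^ 2 := integral_add hI0 hIp
    rw [e2, e3]; linarith
  have step3 : ∑' j, v j ≤ ENNReal.ofReal (6 * Λ) := by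
    have h1 : ∀ j : ℤ, v j = ∫⁻ t in Ico (j : ℝ) (j + 1), ENNReal.ofReal (Wfun F r t) := by
      intro j
      show ENNReal.ofReal (∫ t in Icc (j : ℝ) (j + 1), Wfun F r t) = _
      rw [ofReal_integral_eq_lintegral_ofReal hWc.integrableOn_Icc (ae_of_all _ fun t => hW0 t)]
      exact setLIntegral_congr Ico_ae_eq_Icc.symm
    simp_rw [h1]
    rw [← lintegral_eq_tsum_Ico, lintegral_Wfun_eq hFc hr hM,
      ← ofReal_integral_eq_lintegral_ofReal hS (ae_of_all _ (Sfun_nonneg F r)),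
      show (6 : ℝ) * Λ = 2 * (3 * Λ) by ring, ENNReal.ofReal_mul zero_le_two, ENNReal.ofReal_ofNat]
    exact mul_le_mul' le_rfl (ENNReal.ofReal_le_ofReal hSle)
  -- Step 4: combine
  set A := ∫ x in ⋃ j : ℤ, Icc (b j) (b j + c₀), ‖F x‖ ^ 2 with hAdef
  have hA0 : 0 ≤ A := setIntegral_nonneg (MeasurableSet.iUnion fun j => measurableSet_Icc) fun x _ => hh0 x
  have step4 : ∫⁻ x, e x ≤ ENNReal.ofReal (K * A ^ κ * (6 * Λ) ^ (1 - κ)) := by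
    refine step1.trans ?_
    rw [ENNReal.ofReal_mul (by positivity), ENNReal.ofReal_mul hK0,
      ← ENNReal.ofReal_rpow_of_nonneg hA0 hκ.le, ← ENNReal.ofReal_rpow_of_nonneg (by positivity) (by linarith),
      mul_assoc]
    exact mul_le_mul' le_rfl (mul_le_mul' (ENNReal.rpow_le_rpow step2 hκ.le)
      (ENNReal.rpow_le_rpow step3 (by linarith)))
  have hreal : ∫ x : ℝ, ‖F x‖ ^ 2 ≤ K * A ^ κ * (6 * Λ) ^ (1 - κ) := by
    rw [integral_eq_lintegral_of_nonneg_ae (ae_of_all _ hh0) hI0.aestronglyMeasurable]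
    exact ENNReal.toReal_le_of_le_ofReal (by positivity) step4
  -- back to `𝓕⁻ g`
  have eL : ∫ x, ‖(𝓕⁻ g : ℝ → ℂ) x‖ ^ 2 = ∫ x : ℝ, ‖F x‖ ^ 2 :=
    integral_congr_ae (ae_of_all _ fun x => by simp only [hFx])
  have eA : ∫ x in ⋃ j : ℤ, Icc (b j) (b j + c₀), ‖(𝓕⁻ g : ℝ → ℂ) x‖ ^ 2 = A :=
    setIntegral_congr_fun (MeasurableSet.iUnion fun j => measurableSet_Icc) fun x _ => by rw [hFx]
  rw [eL, eA]
  refine hreal.trans ?_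
  have h6 : (6 * Λ) ^ (1 - κ) ≤ 6 * Λ ^ (1 - κ) := by
    rw [Real.mul_rpow (by norm_num) hΛ0]
    refine mul_le_mul_of_nonneg_right ?_ (Real.rpow_nonneg hΛ0 _)
    calc (6 : ℝ) ^ (1 - κ) ≤ 6 ^ (1 : ℝ) := Real.rpow_le_rpow_of_exponent_le (by norm_num) (by linarith)
      _ = 6 := Real.rpow_one _
  calc K * A ^ κ * (6 * Λ) ^ (1 - κ) ≤ K * A ^ κ * (6 * Λ ^ (1 - κ)) :=
        mul_le_mul_of_nonneg_left h6 (mul_nonneg hK0 (Real.rpow_nonneg hA0 _))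
    _ = 6 * (C₀ + 3) / r * A ^ κ * Λ ^ (1 - κ) := by rw [hKdef]; ring

end Literature.Analysis.Fourier
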